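import Summits.FinalStateConjecture.FinalStateConjecture.Theses.ZeroEnergyKerrOrBomb
import Summits.FinalStateConjecture.FinalStateConjecture.Theses.AnalyticityInvadesErgoregion
import Literature.Geometry.Lorentzian.CausalityOpennessProofs
import Literature.Geometry.Lorentzian.LeviCivitaLocality
import Literature.Geometry.Lorentzian.MullerZumHagenAnalyticity
import Literature.Geometry.Lorentzian.KillingFieldAnalyticExtension
import Literature.Geometry.Lorentzian.KillingHorizonShadowAlong
import Literature.Geometry.Lorentzian.FlowInvariantFunctions
import Literature.Geometry.Lorentzian.DocStructureTimeFunction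
import Literature.Geometry.Lorentzian.DocProductStructure
import Literature.Geometry.Lorentzian.NearHorizonAxialKilling
import Literature.Geometry.Lorentzian.StationaryNormAtInfinity
import Literature.Geometry.Lorentzian.NomizuKillingExtension
import Literature.Geometry.Lorentzian.NomizuKillingExtensionProofs
import Literature.Geometry.Lorentzian.ChartwiseAnalyticity
import Literature.Analysis.PDE.PartiallyAnalyticUniqueContinuation
import Mathlib.Analysis.Normed.Module.Connected
-- the three LANDED stubs of the rev-4 reduction (S1a p139503, S3 p139035, S4a p137190), called as theorems
import Summits.FinalStateConjecture.FinalStateConjecture.Theorems.ZeroEnergyKerrOrBombNonTrappingHawkingRigidityStubTwoVariableAnalyticitySeeds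
import Summits.FinalStateConjecture.FinalStateConjecture.Theorems.ZeroEnergyKerrOrBombNonTrappingHawkingRigidityStubInvariantKillingSubcollar
import Summits.FinalStateConjecture.FinalStateConjecture.Theorems.ZeroEnergyKerrOrBombNonTrappingHawkingRigidityStubSlabPatching
-- rev 3: the LANDED rev-2 stub N3a (p149613, wave 1 of lead a1), called as a theorem
import Summits.FinalStateConjecture.FinalStateConjecture.Theorems.ZeroEnergyKerrOrBombNonTrappingHawkingRigidityStubCommutingKillingFlowBox
-- rev 4: the LANDED rev-3 stubs S1b (p152581) and S2a (p154819) (wave 2 of lead a1), called as theorems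
import Summits.FinalStateConjecture.FinalStateConjecture.Theorems.ZeroEnergyKerrOrBombNonTrappingHawkingRigidityStubInvariantRadialFunction
import Summits.FinalStateConjecture.FinalStateConjecture.Theorems.ZeroEnergyKerrOrBombNonTrappingHawkingRigidityStubPointContinuationAnalytic
-- rev 7: the LANDED rev-6 stub S1b₇ (p162333, wave 4 of lead a1), called as a theorem
import Summits.FinalStateConjecture.FinalStateConjecture.Theorems.ZeroEnergyKerrOrBombNonTrappingHawkingRigidityStubInvariantRadialFunctionConnected
-- rev 8: the LANDED far seed N1 (p163426, rev-7 signature; waves 3–4 of lead a1), called as a theorem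
import Summits.FinalStateConjecture.FinalStateConjecture.Theorems.ZeroEnergyKerrOrBombNonTrappingHawkingRigidityStubFarAxialSeed
-- scratch check against the one landed Negative lemma of this crux (cdisprove cycle 1): h2 ⇒ h4; no stub
-- below USES h4 beyond carrying it as a binder, so none is an instance the lemma refutes.
import Summits.FinalStateConjecture.FinalStateConjecture.Theorems.NonTrappingHawkingRigidity.Negative.KillingNonvanishingOfIPlusRegular

/-!
# Line `azimuthal-partial-analyticity` — crux `NonTrappingHawkingRigidity` (stmt-FinalStateConjecture-13896)
# — crux-plan skeleton (planner, 2026-08-17; gen 1, round 1) — rev 2 (lead a1, 2026-08-17T06:30Z)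

REV 9 (lead c2, 2026-08-17T14:50Z): Nomizu's extension theorem is DISCHARGED in the tree
(`PseudoRiemannianMetric.Nomizu1960_killing_extension_holds`, `NomizuKillingExtensionProofs.lean`, 2026-08-17T10:49Z; covering space of
germs + Mathlib `IsCoveringMap` monodromy), so it leaves stub D (now FIVE named facts) and is consumed as a theorem by the composition
(feeding N1 `stub_farAxialSeed` and S2a); nothing else changed: `crux ⇐ S2 ∧ N1b ∧ N2 ∧ N3 ∧ D` as in rev 8.  Line adjudication of
this seat: `Lines/azimuthal-partial-analyticity-dead.md`.

REV 8 (lead a1, cycle 1, close): the far seed N1 `stub_farAxialSeed` LANDED p163426 (rev-7 signature) and is discharged inside.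
FIVE registered stubs remain open, none of them a prover's task today: S2 `stub_pointContinuation` (belt-only lever = the UNPRINTED
partially-analytic system UCP), N1b `stub_farSeedBets` (three BETS: h17 non-degeneracy, TimelikeReach, KillingContinuationCoherence —
refuter/planner targets), N2 `stub_highAzimuthalFrequencyBound` (Hörmander 26.1.7 + reduction; not statable in the tree yet), N3
`stub_azimuthalCascade` (the engine: CRUX-SIZED, lead's adjudication attached to the item), D `stub_literatureDebts` (six named facts;
FIVE since rev 9).
SEVEN stubs are LANDED theorems called by name: S1a p139503, S1b p152581 (superseded), S1b₇ p162333, S2a p154819, S3 p139035, S4a p137190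
(unused since rev 3), N3a p149613, N1 p163426.  `crux ⇐ S2 ∧ N1b ∧ N2 ∧ N3 ∧ D` is kernel-checked below.

REV 7 (lead a1, cycle 1, after wave 4): S1b₇ `stub_invariantRadialFunctionConnected` LANDED p162333 (discharged inside); N1's
registered text shortened below the registry's 3900-character signature cap (worker N1 wave 4: the idle binders h15–h16 dropped,
the smooth+Killing pairs contracted to `PseudoRiemannianMetric.IsKillingFieldOn`; the rev-6 proof bounced p162453 ONLY on the
truncated registry record) — proof ready in `work/stubs/stub_farAxialSeed_rev7.lean`.  Open registered stubs (6): S2, N1b, N1 (proof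
in hand), N2, N3, D.  KNOWN REGISTRY DEFECT: N3's signature (7613 chars) is also stored truncated; it must be contracted the same way
before any `--supports` landing (irrelevant while N3 is a research statement).

REV 6 (lead a1, cycle 1, after wave 3): worker N1 replied `stub-misstated` WITH A SORRY-FREE PROOF of the reshaped far seed
(`work/stubs/stub_farAxialSeed.lean`; 2 NEW named facts p157253 `alexakisIonescuKlainerman2010_nearHorizonAxialKilling`, p157385
`chruscielCosta2008_stationaryNormAtInfinity`; 9 Literature bricks p157760 KillingOnNormInvariance, p157974 KillingCoherentContinuation,
p158179 ChartwiseAnalyticKillingExtension, p158803 KillingOnPeriodicFlow, p159066 KillingOnConfinedComplete, p159204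
StationaryOrbitConfinement, p160564 KillingOnIntegralCurveUnique, p160635 StationaryOrbitRadialDrift, p161478 AxialSeedCompleteness).
The reshape is adopted verbatim: N1 now inputs h17 `CollarNonDegenerate`, (R7) `SubLevelsPreconnected`, `TimelikeReach` and
`KillingContinuationCoherence`; the three bets are ONE new registered stub N1b `stub_farSeedBets` (replacing the rev-5 corridor N1c,
found insufficient), (R7) comes from the NEW stub S1b₇ `stub_invariantRadialFunctionConnected` (S1b + preconnected sub-levels, a
re-land); D collects six debts.  Open registered stubs (7): S1b₇, S2, N1b, N1, N2, N3, D — of which N1 and S1b₇ have proofs in hand.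

REV 5 (lead a1, cycle 1, after wave 2): the far seed's BET is isolated as its own registered stub N1c `stub_timelikeCorridor`
(`TimelikeCorridor 𝓑 U ρ₀`: an open connected `C ⊆ doc` inside `{g(T,T) < 0} ∪ U`, accumulating at `𝓔⁺`, unbounded in `ρ₀`),
consumed by N1 as an extra hypothesis — so that the disprover / refuter panel has the bet as a Target and N1's remaining content
(near-horizon dichotomy + analytic continuation along a GIVEN corridor) is print-level.  Open registered stubs: S2, N1, N1c, N2, N3, D.

REV 4 (lead a1, cycle 1, after wave 2): S1b `stub_invariantRadialFunction` LANDED p152581 (on the product-structure fact) and S2a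
`stub_pointContinuationAnalytic` LANDED p154819 (local Nomizu; Literature bricks p152714 `AnalyticChartMetric.lean`, p152945
`MaxAtlasChartKilling.lean`, p153263 `Manifold/SimplyConnectedSublevelNhds.lean`, p153491 `NomizuKillingExtensionChart.lean`); both are
called as theorems.  Open registered stubs: S2 (belt-only lever, unprinted), N1 (far seed: corridor bet), N2 (Hörmander bound), N3 (engine,
lead, crux-sized), D (four debts).

REV 3 (lead a1, cycle 1, after wave 1): N3a `stub_commutingKillingFlowBox` LANDED (p149613; Literature helpers
p145722 `CommutingFlowBox.lean`, p146969 `CommutingFlowBoxChart.lean`) and is called as a theorem; S1b now takes the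
NEW named fact `chruscielCosta2008_docProductStructure` (p145855, `DocProductStructure.lean`, vendored by wave-1 worker
S1b: `doc ∪ 𝓔⁺ ≈ ℝ × (E3 ∖ ball)` equivariantly) as its leading hypothesis; N1 and N3 take it too, and N1 switches
to the `C^∞` Nomizu rendering `PseudoRiemannianMetric.Nomizu1960_killing_extension`; NEW stub S2a
`stub_pointContinuationAnalytic` (local Nomizu under FULL chartwise analyticity) takes over the `T`-timelike /
collar points of the sweep, so that S2 (the unprinted partially-analytic system UCP) is invoked at BELT points
only; D collects four debts (CC08 time function, MzH, Nomizu `C^∞` form, CC08 product structure).  7 open/closed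
registered stubs: S1b, S2, S2a, N1, N2, N3, D open; N3a, S1a, S3, S4a landed.

REV 2 (lead prover-line-stmt-FinalStateConjecture-13896-a1-0, cycle 1): ONE reshape, no statement weakened —
the soft last step (vi) of the engine is split off as a 7th registered stub N3a `stub_commutingKillingFlowBox`
(two commuting Killing fields with timelike independent span ⇒ `TwoVariableAnalyticAt`, joint flow box + Killing
⇒ components constant in `(x⁰, x¹)`; provable with `Literature/Geometry/Manifold/FlowBox.lean` +
`Literature/Analysis/ODE` + `CommutingFlowLocal.lean`), and N3 `stub_azimuthalCascade` now CONSUMES that statement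
as an extra hypothesis (vocabulary `CommutingKillingFlowBoxAnalyticity`; `engine_of` feeds it).  Everything else —
S1b, S2, N1, N2, D, the three landed rev-4 stubs and the Zorn composition — is the planner's text verbatim.

Crux (shared by routes `ZeroEnergyKerrOrBomb` rank 2 — primary here — and `AnalyticityInvadesErgoregion`
rank 4; letter-identical bodies): a vacuum, `I⁺`-regular, future-presented stationary AF black hole `𝓑`
with `T ≠ 0` on the d.o.c., simply connected d.o.c., a Killing–timelike collar `(U, K)` on a connected
horizon, closed-ergoregion belt compact modulo `T` and no zero-energy null geodesic trapped modulo `T`,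
admits `K'` smooth and Killing on the d.o.c. with `[T, K'] = 0` and `K' = K` near `𝓔⁺`.

## THE LINE and what changed with respect to the dead line `Sketch` (same idea card)

Lever (idea `azimuthal-partial-analyticity`, triage r1: pass ×2): Tataru–Robbiano–Zuily–Hörmander unique
continuation with TWO analytic variables spanning a timelike 2-plane has an EMPTY residual characteristic
set, so the collar Hawking field is continued outward across the NON-NULL levels of a radial function of the
d.o.c. (Zorn on anchored partial continuations — the rev-4 composition of `Lines/Sketch.lean`, kernel-checked,
reused below VERBATIM together with its three LANDED stubs S1a p139503, S3 p139035, S4a p137190 and its two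
registered open stubs S1b, S2).  `Sketch` died at its engine S4b `stub_adaptedAnalyticSweep` ("∃ radial `ρ`
with two-variable analyticity in `ρ`-adapted charts on the closed ergoregion"), adjudged CRUX-EQUIVALENT
because its FEED — the card's mechanism C⁺ ⇐ (circle action, semiclassical non-trapping bound, paraproduct
cascade) — was in none of its `Leans on:` (`Lines/Sketch-dead.md` §2; `Lines/Sketch.md` W-i/W-ii).  The
triage panel passed the idea on the condition that the feed be CUT INTO NAMED STUBS (TRIAGE-r1-1 "S4b ⇐ (G1′)
∧ (T1) ∧ (W7′) ∧ (S2) ∧ (G4); attack T1 first"; TRIAGE-r1-2 "make (W3) the first stub; state C⁺ in the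
adapted 4-D form").  This skeleton does exactly that, with three findings that fix WHERE the cut can be made:

1. **(T1) is print-level for the scalar interior model — and SHARP.**  Under h4 + h16 the `T`-reduced
   d'Alembertian on `doc/T` is of REAL PRINCIPAL TYPE over every compact set: the radial / fixed points of the
   reduced zero-energy Hamilton flow lie exactly over ergosurface points `x` with `d(g(T,T))_x ∥ T♭_x`
   (`ẋ = 2 g⁻¹ξ mod T = 0 ⇔ ξ ∥ T♭, g(T,T) = 0`; `ξ̇ = d g(T,T)`), and there the `T`-orbit is a zero-energy
   null PREGEODESIC (`∇_T T = −½∇g(T,T) ∥ T`) contained in the `T`-orbit of `{x}` — a trapped maximal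
   zero-energy null geodesic, excluded by h16.  Hence Hörmander's Thm. 26.1.7 (`u ∈ 𝓔'(K)`:
   `‖u‖₍ₛ₎ ≤ C(‖Pu‖₍ₛ₋₁₎ + ‖u‖₍ₛ₋₁₎)`) applies on the quotient, and for EXACT `m`-mode pairs of any smooth
   `T`-commuting `Ẑ` the error term is absorbed for `m ≥ m₀` (`‖u‖₍ₛ₋₁₎ = m⁻¹‖Ẑv‖₍ₛ₋₁₎ ≤ (C_Ẑ/m)‖v‖₍ₛ₎`):
   a ONE-DERIVATIVE-GAIN high-frequency bound with no convexity, no periodicity and no vacuum.  This is stub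
   N2 `stub_highAzimuthalFrequencyBound` (the triage's refutation target, now with a proof in print modulo the
   zero-momentum reduction) and it dissolves TRIAGE-r1-1's worry about "Vasy-type radial points where the belt
   meets the ergosurface": h16 forbids them.  The SHARP form is precisely what TRIAGE-r1-1 B3's `O(1/λ)`
   bookkeeping needs (a `λ^N`-lossy bound would not absorb the high-coefficient × low-unknown terms).
2. **The auxiliary frame must be CANONICAL, including the radial function** (TRIAGE-r1-1 B1 pushed one step
   further): for any ∀-quantified frame `(ρ, X, Ẑ)` given only by PROPERTIES, Kerr itself refutes "`g` is
   analytic along `Ẑ`" (take `ρ` non-axisymmetric in the belt: `X = ∇ρ/|∇ρ|²` and the transported `Ẑ = Θ^X_*∂_φ`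
   are then pure-gauge images, and the lapse `|∇ρ|⁻¹` has non-analytic azimuthal modes that no field equation
   controls).  So (G1′)/(G4)/(W7′) cannot be separate ∀-stubs: they live INSIDE the engine stub N3, whose
   conclusion is existential in `ρ` (the prover takes `ρ` = an analytic function of scalar invariants of
   `(g, T)` — on Kerr `r = Re(2M/(1 − 𝓔_T))`, `a cos θ = −Im(2M/(1 − 𝓔_T))` for the Ernst potential `𝓔_T` —,
   `X = ∇ρ/|∇ρ|²`, `Ẑ` = `X`-transport of the far seed), and N3's why-might-fail carries them by name.
3. **One-sided transported gauges leave an `O(λ^{-∞})` floor at the far end of the slab**, which kills the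
   exponential bootstrap; the cascade must therefore run from an end where the metric is EXACTLY invariant
   (the FAR AXIAL SEED, stub N1 — the "preliminary step absent from every card" of `Lines/Sketch.md` W-ii,
   asked WITHOUT its monodromy obstruction: only a connected `W ⊇` sub-collar trace ∪ far end is required,
   and the cascade never compares the transported `Ẑ` with the southern collar) inward THROUGH the
   non-degenerate horizon (no boundary condition there: regularity across `𝓗⁺`, Vasy 2013-type radial
   estimates — the horizon end of (T1), inside N3).  The Zorn sweep then runs OUTWARD as in rev 4, consuming
   only N3's OUTPUT; this is how the tension "mechanism wants `K` known off the belt / single-valuedness wants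
   the sweep" (`Lines/Sketch.md` W-ii, last paragraph) is resolved.

## Stubs (6 registered `sorry`s; 3 landed rev-4 theorems called by name)

* S1b `stub_invariantRadialFunction` (rev 4 VERBATIM; registered) — structure of the d.o.c.: a `T`-invariant
  radial function `ρ₀` (R1)–(R6).  Print (CC08 Thm. 4.5 + censorship + Poincaré); XL debt.
* S2 `stub_pointContinuation` (rev 4 VERBATIM; registered) — THE LEVER: one-step Killing continuation across
  a non-null level under two-variable analyticity (Tataru/RZ/H on the IK wave–transport system).  L–XL;
  `Lines/Sketch.md` §"S2 PRECISELY" (a solid unwritten paper, low risk).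
* N1 `stub_farAxialSeed` (NEW) — DICHOTOMY: either the collar is NON-ROTATING (`K = α T` on a sub-collar
  trace: then `K' := α • T` docks and the crux is trivial as typed, Disproof (F3) — `conclusion_of_nonRotating`,
  kernel-checked below), or the collar's axial symmetry reaches a neighbourhood of infinity: an open CONNECTED
  `W ⊆ doc` containing every point outside the `T`-orbit of a compact set, a local `T`-commuting Killing `Z`
  on `W`, NOT identically zero, with complete `2π`-periodic flow, docking `K = αT + βZ` (`β ≠ 0`) on a
  sub-collar trace inside `W` (Disproof (F4): the normalisation is OUTPUT, not input).  Müller zum Hagen +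
  Nomizu through a `T`-TIMELIKE CORRIDOR from the poles (where `T = K − βZ` is timelike inside `U`) to
  infinity.  BET: the corridor exists (the belt does not cap the poles).  L–XL.
* N2 `stub_highAzimuthalFrequencyBound` (NEW) — (T1) scalar, interior, no vacuum: finding 1.  L in print
  (Hörmander 26.1.7 + reduction), XL to formalise.
* N3 `stub_azimuthalCascade` (NEW; THE ENGINE; hardest) — telescope + `ρ₀` + a GENUINE far seed (connected,
  `Z ≢ 0`, docked: N1's rotating branch — the trivial seed `Z := 0` never reaches N3) + (T1) ⇒ ∃ radial `ρ`
  with SPACELIKE gradient on the closed ergoregion and TWO-VARIABLE ANALYTICITY at every belt point off `U`.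
  Inside: canonical radial gauge (finding 2), `Ẑ := Θ^X_* Z` inward through `𝓗⁺` (finding 3), the IK
  zeroth-order wave–transport structure for `(W = 𝓛_Ẑ Riem, π, P)` relative to the (non-geodesic) `X`,
  the system form of (T1) uniform over truncated backgrounds `g_{<λ/16}`, B3's `O(1/λ)` bookkeeping, the
  closed induction of `Lines/Sketch-dead.md` §3, and the joint `(T, Ẑ)` flow-box chart.  BETS: (G1′) the
  canonical `ρ` is regular with non-null levels on the belt; (G4) `span{T, Ẑ}` timelike at belt points;
  non-degenerate horizon (h14 ⇒ `κ ≠ 0`, Disproof (F7)).  XL, new mathematics.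
* D `stub_literatureDebts` — rev 9: `chruscielCosta2008_equivariantTimeFunction ∧
  mullerZumHagen1970_analytic_of_timelikeKilling ∧ chruscielCosta2008_docProductStructure ∧
  alexakisIonescuKlainerman2010_nearHorizonAxialKilling ∧ chruscielCosta2008_stationaryNormAtInfinity` (FIVE tree named
  facts, each closable by its `_holds`; the sixth, Nomizu's theorem, is discharged and used as a theorem since rev 9).
* LANDED, called by name: S1a `stub_invariantKillingSubcollar` (p139503), S3 `stub_slabPatching` (p139035),
  S4a `stub_twoVariableAnalyticitySeeds` (p137190).
* Composition (sorry-free): S1b gives `ρ₀`; N1's dichotomy — non-rotating ⇒ `conclusion_of_nonRotating`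
  (done); rotating ⇒ `engine_of` (N2, N3 on the genuine seed ⇒ `ρ`, spacelike gradient, belt analyticity) →
  `collarSweep_of` (S1a + CC08 ⇒ sub-collar field and timelike sweep along `ρ`) → Zorn on anchored partial
  continuations (rev 4 verbatim: chains glue; a maximal element of finite level is strictly extended by
  S4a/N3 + S2 + S3; level `⊤`; docking on `U' ∩ U''`) ⇒ `NonTrappingHawkingRigidity` BY NAME
  (`NonTrappingHawkingRigidity_of`; the AIE copy `NonTrappingHawkingRigidity_of'`).

Hypotheses of the crux NOT consumed by the composition itself: h5 (simple connectivity; idle — the sweep organises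
single-valuedness) and h4 (redundant: Negative lemma `KillingNonvanishingOfIPlusRegular`, imported as a scratch
check); both are carried verbatim in the stubs' binders.  Vacuum enters S2, S4a, N1, N3 — NOT N2; h16 enters N2
(real principal type) and N3; h15 enters N1 (belt below the far end) and N3.

## Disproof.lean honoured (cdisprove cycle 1, `Cruxes/NonTrappingHawkingRigidity/Disproof.lean`, read 05:20Z)

NO KILL; Targets none.  (F5) vacuum load-bearing on `{g(T,T) < 0} ∖ U`: honoured — S4a (MzH seeds), N1 (Nomizu
continuation THROUGH the `T`-timelike corridor is a vacuum-analyticity argument) and S2 at every level point use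
h1 outside the belt.  (F6) docking on a sub-collar only: the composition docks on `U' ∩ U''`; N1 docks on its own
`U'' ∩ doc`.  (F4) scale/orientation of `K` free: no stub mentions `κ` or `Ω_H`; N1 OUTPUTS the constants
`α, β` and the periodic `Z`.  (F7).3 h13 unused; (F7).4 `U` not `T`-invariant: S1a (landed) transports; (F7)
"h14 excludes extreme Kerr … load-bearing for the method (`κ ≠ 0`)": N3's horizon end uses exactly this.
(F1) h4 decoration: carried, never used.  (F9) uniform UC neighbourhoods: S3 (landed).
-/

set_option linter.dupNamespace false
set_option linter.unusedVariables false
set_option linter.unusedSectionVars false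

noncomputable section

namespace Summit.FinalStateConjecture.FinalStateConjecture.Cruxes.NonTrappingHawkingRigidity.AzimuthalPartialAnalyticity

-- the crux BY NAME: the item's decl in the PRIMARY route file of this unit (`ZeroEnergyKerrOrBomb`, rank 2);
-- the `AnalyticityInvadesErgoregion` copy (rank 4) has a letter-identical body and is closed
-- definitionally at the end of the file (`NonTrappingHawkingRigidity_of'`).
open Summit.FinalStateConjecture.FinalStateConjecture.Theses.ZeroEnergyKerrOrBomb (NonTrappingHawkingRigidity)
open Literature.Geometry.Lorentzian
open scoped Manifold ContDiff Topology Nat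
open Set Filter

/-! ## §1 Vocabulary (over existing declarations only; rev-4 vocabulary verbatim + three new predicates) -/

section Vocabulary

variable (𝓑 : StationaryAFBlackHole.{0}) [𝓑.metric.HasLeviCivita]

/-- `L` is a LOCAL `T`-COMMUTING KILLING FIELD on the set `W`: smooth as a section of `TM` on `W`, the
Killing equation `g(∇_v L, w) + g(v, ∇_w L) = 0` at every point of `W`, and `[T, L] = 0` on `W`
(`T = 𝓑.killing`) — verbatim the three clauses the crux imposes on the collar field and on `K'`
(vocabulary shared with `Cruxes/ZeroEnergyRigidity/Lines/osculating-frontier-induction.lean`).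
[cite: ONeill1983, Ch. 9, Def. 9.22] -/
def IsLocalKilling (W : Set 𝓑.carrier) (L : Π x : 𝓑.carrier, TangentSpace (𝓡 4) x) : Prop :=
  ContMDiffOn (𝓡 4) ((𝓡 4).prod 𝓘(ℝ, E4)) ((⊤ : ℕ∞) : WithTop ℕ∞)
      (fun x ↦ (Bundle.TotalSpace.mk' E4 x (L x) : TangentBundle (𝓡 4) 𝓑.carrier)) W ∧
    (∀ x ∈ W, ∀ v w : TangentSpace (𝓡 4) x,
      𝓑.metric.val x (𝓑.metric.leviCivita L x v) w + 𝓑.metric.val x v (𝓑.metric.leviCivita L x w) = 0) ∧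
    ∀ x ∈ W, VectorField.mlieBracket (𝓡 4) 𝓑.killing L x = 0

/-- The KILLING–TIMELIKE COLLAR hypotheses on `(U, K)` — verbatim the crux: `U` open, `U ⊇ 𝓔⁺`, `𝓔⁺`
connected, `K` a local `T`-commuting Killing field on `U`, non-zero and flow-tangent on `𝓔⁺`, timelike
on `U ∩ doc`. [cite: AlexakisIonescuKlainerman2010, Thm. 1.1] -/
def IsKillingTimelikeCollar (U : Set 𝓑.carrier) (K : Π x : 𝓑.carrier, TangentSpace (𝓡 4) x) : Prop :=
  IsOpen U ∧ 𝓑.horizon ⊆ U ∧ IsConnected 𝓑.horizon ∧ IsLocalKilling 𝓑 U K ∧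
    (∀ p ∈ 𝓑.horizon, K p ≠ 0) ∧
    (∀ γ : ℝ → 𝓑.carrier, IsMIntegralCurve γ K → γ 0 ∈ 𝓑.horizon → ∀ t, γ t ∈ 𝓑.horizon) ∧
    ∀ x ∈ U ∩ 𝓑.doc, 𝓑.metric.val x (K x) (K x) < 0

/-- The closed-ergoregion BELT off the collar is compact modulo the stationary flow — verbatim the
crux's h15. [cite: ChruscielCosta2008, §4] -/
def BeltCompactModFlow (U : Set 𝓑.carrier) : Prop :=
  ∃ S₀ : Set 𝓑.carrier, IsCompact S₀ ∧ S₀ ⊆ 𝓑.doc ∧ ∀ y ∈ 𝓑.doc,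
    0 ≤ 𝓑.metric.val y (𝓑.killing y) (𝓑.killing y) → y ∉ U → y ∈ stationaryOrbit 𝓑.killing S₀

/-- NO ZERO-ENERGY NULL GEODESIC TRAPPED MODULO THE FLOW — verbatim the crux's h16 (the
Alexakis–Ionescu–Klainerman hypothesis taken modulo the stationary flow). [cite: IonescuKlainerman2015, §4] -/
def NoTrappedGeodesicModFlow : Prop :=
  ∀ S : Set 𝓑.carrier, IsCompact S → S ⊆ 𝓑.doc → ∀ (γ : ℝ → 𝓑.carrier) (s : Set ℝ),
    IsMaximalGeodesicOn 𝓑.metric.toPseudoRiemannianMetric.leviCivita γ s → s.Nonempty →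
      (∀ t ∈ s, 𝓑.metric.val (γ t) (velocity (𝓡 4) γ t) (velocity (𝓡 4) γ t) = 0 ∧
        velocity (𝓡 4) γ t ≠ 0 ∧ 𝓑.metric.val (γ t) (velocity (𝓡 4) γ t) (𝓑.killing (γ t)) = 0) →
      ∃ t ∈ s, γ t ∉ stationaryOrbit 𝓑.killing S

/-- The REGULAR TELESCOPE = the hypotheses of the crux minus simple connectivity and `T ≠ 0`: vacuum,
`I⁺`-regular, future-presented, Killing–timelike collar, belt compact mod `T`, zero-energy non-trapping
mod `T` (documentation only: the registered stubs S1/S4 carry the crux's binders h1–h16 VERBATIM, so that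
a landed stub matches the registered signature letter for letter). [cite: ChruscielCosta2008, Def. 1.1] -/
def RegularTelescope (U : Set 𝓑.carrier) (K : Π x : 𝓑.carrier, TangentSpace (𝓡 4) x) : Prop :=
  𝓑.metric.toPseudoRiemannianMetric.IsRicciFlat ∧ 𝓑.IsIPlusRegular ∧
    (∀ p : 𝓑.carrier, p ∈ 𝓑.metric.chronologicalFuture 𝓑.timeOrientation 𝓑.Mext) ∧
    IsKillingTimelikeCollar 𝓑 U K ∧ BeltCompactModFlow 𝓑 U ∧ NoTrappedGeodesicModFlow 𝓑

/-- The strict sub-level set `{x ∈ doc | f x < c}` of a sweep function inside the d.o.c. [folklore] -/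
def subLevel (f : 𝓑.carrier → ℝ) (c : ℝ) : Set 𝓑.carrier :=
  {x | x ∈ 𝓑.doc ∧ f x < c}

/-- **A `T`-invariant TIMELIKE SWEEP of the d.o.c. off the sub-collar `U'`** (`IsTimelikeSweep 𝓑 U' f c₀`):
`f` is smooth on the d.o.c. and `T`-invariant (`df(T) = 0`); the sub-collar is its bottom sub-level set,
`{f < c₀} ∩ doc = U' ∩ doc`; off the sub-collar `df = g(w, ·)` for a SPACELIKE `w` (so the level sets
are `T`-invariant TIMELIKE — non-characteristic — hypersurfaces, and `df ≠ 0` there); and every slab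
`{c₀ ≤ f ≤ c} ∩ doc` is compact modulo the stationary flow.  On Kerr: `f = r` (Boyer–Lindquist /
Kerr–Schild radius), `U' = {r < r₊ + δ}`, `g^{rr} = Δ/Σ > 0`.  This is the card's "(T,Ẑ)-invariant
height" in its weakest usable form and ideator 2's object `HasTimelikeSweep`. [cite: AlexakisIonescuKlainerman2010, §1 (the `r`-foliation)] -/
def IsTimelikeSweep (U' : Set 𝓑.carrier) (f : 𝓑.carrier → ℝ) (c₀ : ℝ) : Prop :=
  ContMDiffOn (𝓡 4) 𝓘(ℝ, ℝ) ((⊤ : ℕ∞) : WithTop ℕ∞) f 𝓑.doc ∧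
    (∀ x ∈ 𝓑.doc, mfderiv (𝓡 4) 𝓘(ℝ, ℝ) f x (𝓑.killing x) = 0) ∧
    subLevel 𝓑 f c₀ = U' ∩ 𝓑.doc ∧
    (∀ x ∈ 𝓑.doc, c₀ ≤ f x → ∃ w : TangentSpace (𝓡 4) x, 0 < 𝓑.metric.val x w w ∧
      ∀ u : TangentSpace (𝓡 4) x, mfderiv (𝓡 4) 𝓘(ℝ, ℝ) f x u = 𝓑.metric.val x w u) ∧
    ∀ c : ℝ, ∃ S : Set 𝓑.carrier, IsCompact S ∧ S ⊆ 𝓑.doc ∧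
      {x | x ∈ 𝓑.doc ∧ c₀ ≤ f x ∧ f x ≤ c} ⊆ stationaryOrbit 𝓑.killing S

/-- **`D` supports `q` through a NON-NULL level of `f`** (`NonNullSupportAt 𝓑 D q f`): on an open
`N ∋ q`, `f` is smooth, `df(q) = g(n, ·)` for a NON-NULL `n` (`g(n,n) ≠ 0`: the level hypersurface
`{f = f q}` is non-characteristic for `□_g` at `q`), and the strict sub-level side `{f < f q} ∩ N ∩ doc`
IS the trace of `D` on `N ∩ doc` (the known side near `q` is exactly the sub-level side: `D` carries no
unrelated pieces above the level near `q`).  No `T`-invariance and NO CONVEXITY of any kind is asked —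
this is the whole point of the line (contrast `ExposedAt` of the osculating-frontier line). [cite: Tataru1999PartiallyAnalytic, Thm. 1] -/
def NonNullSupportAt (D : Set 𝓑.carrier) (q : 𝓑.carrier) (f : 𝓑.carrier → ℝ) : Prop :=
  ∃ N : Set 𝓑.carrier, IsOpen N ∧ q ∈ N ∧
    ContMDiffOn (𝓡 4) 𝓘(ℝ, ℝ) ((⊤ : ℕ∞) : WithTop ℕ∞) f N ∧
    (∃ nq : TangentSpace (𝓡 4) q, 𝓑.metric.val q nq nq ≠ 0 ∧
      ∀ w : TangentSpace (𝓡 4) q, mfderiv (𝓡 4) 𝓘(ℝ, ℝ) f q w = 𝓑.metric.val q nq w) ∧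
    ∀ x ∈ N ∩ 𝓑.doc, x ∈ D ↔ f x < f q

/-- The metric components in the chart `ψ`: `G_{ab}(p) = g_{ψ⁻¹ p}(dψ⁻¹_p a, dψ⁻¹_p b)` (as in the route
file's `let An` of `ErgoregionAnalyticity` / `NomizuAcrossAnalyticDoc`). [folklore] -/
def chartMetric (ψ : OpenPartialHomeomorph 𝓑.carrier E4) (a b : E4) (p : E4) : ℝ :=
  𝓑.metric.val (ψ.symm p) (mfderiv 𝓘(ℝ, E4) (𝓡 4) ψ.symm p a) (mfderiv 𝓘(ℝ, E4) (𝓡 4) ψ.symm p b)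

/-- **TWO-VARIABLE (AXIAL) ANALYTICITY of the metric at `q`** — the regularity class C⁺ of the card,
stated chartwise by FACTORIAL DERIVATIVE BOUNDS (the tree's language for real-analyticity:
`AnalyticAt.exists_ball_norm_iteratedFDeriv_le` / `analyticOnNhd_of_locally_norm_iteratedFDeriv_le` in
`Literature/Analysis/Calculus/`): there is a chart `ψ` of the maximal smooth atlas around `q` such that
(i) the coordinate 2-plane `span{∂₀, ∂₁}` at `q` is TIMELIKE (contains a timelike vector) — so Tataru's
residual characteristic set `Char ∩ {ξ₀ = ξ₁ = 0}` is empty at (hence near) `q` —, and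
(ii) for every pair `a b` (constants depending on the pair: the components are bilinear in `(a, b)`; the
finitely many basis pairs give common constants), on a coordinate ball around `ψ q` inside the chart target the
component `G_{ab}(p) = g_{ψ⁻¹ p}(dψ⁻¹ a, dψ⁻¹ b)` is `C^∞` and satisfies UNIFORM Cauchy estimates in the two
directions `e₀, e₁`: `‖Dᵏ G_{ab}(z)(v₁,…,v_k)‖ ≤ M Cᵏ k!` for all `k`, all `z` in the ball and all `vᵢ ∈ {e₀, e₁}` —
equivalently (Krantz–Parks Prop. 2.2.10, slice-wise) the components are real-analytic in `(x⁰, x¹)`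
uniformly in `(x², x³)`, the hypothesis form of Tataru 1999 / Robbiano–Zuily 1998 / Hörmander 1997
("coefficients `C^∞`, analytic in the variables `x_a`").  Where the metric carries two commuting Killing
fields with timelike span a joint flow-box chart gives components INDEPENDENT of `(x⁰, x¹)`; where the
metric is real-analytic in all four variables (the `T`-timelike region and the collar, Müller zum Hagen
1970) the bounds hold in all directions.  The content of C⁺ is the belt.
[cite: RobbianoZuily1998, Thm. A] [cite: Hormander1997PartialAnalyticity, Thm. 1] [cite: KrantzParks2002, Prop. 2.2.10] -/
def TwoVariableAnalyticAt (q : 𝓑.carrier) : Prop :=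
  ∃ ψ ∈ IsManifold.maximalAtlas (𝓡 4) ((⊤ : ℕ∞) : WithTop ℕ∞) 𝓑.carrier, q ∈ ψ.source ∧
    (∃ a b : ℝ, 𝓑.metric.val q
        (a • mfderiv 𝓘(ℝ, E4) (𝓡 4) ψ.symm (ψ q) (EuclideanSpace.single 0 1) +
          b • mfderiv 𝓘(ℝ, E4) (𝓡 4) ψ.symm (ψ q) (EuclideanSpace.single 1 1))
        (a • mfderiv 𝓘(ℝ, E4) (𝓡 4) ψ.symm (ψ q) (EuclideanSpace.single 0 1) +
          b • mfderiv 𝓘(ℝ, E4) (𝓡 4) ψ.symm (ψ q) (EuclideanSpace.single 1 1)) < 0) ∧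
    ∀ a b : E4, ∃ δ > (0 : ℝ), ∃ M C : ℝ, 0 ≤ M ∧ 0 ≤ C ∧ Metric.ball (ψ q) δ ⊆ ψ.target ∧
      ContDiffOn ℝ ((⊤ : ℕ∞) : WithTop ℕ∞) (chartMetric 𝓑 ψ a b) (Metric.ball (ψ q) δ) ∧
      ∀ z ∈ Metric.ball (ψ q) δ, ∀ (k : ℕ) (v : Fin k → E4),
        (∀ i, v i = EuclideanSpace.single 0 1 ∨ v i = EuclideanSpace.single 1 1) →
        ‖iteratedFDeriv ℝ k (chartMetric 𝓑 ψ a b) z v‖ ≤ M * C ^ k * k !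

/-- **A ONE-STEP CONTINUATION of `(D, L)` AT `q`** (`PointContinuationAt 𝓑 D L q`): an open `W ∋ q`
inside the d.o.c. and a local `T`-commuting Killing field `L'` on `W` which agrees with `L` on ALL of
`W ∩ D` (the known side near `q`). [cite: IonescuKlainerman2012, Thm. 1.2 (shape of the conclusion)] -/
def PointContinuationAt (D : Set 𝓑.carrier) (L : Π x : 𝓑.carrier, TangentSpace (𝓡 4) x)
    (q : 𝓑.carrier) : Prop :=
  ∃ (W : Set 𝓑.carrier) (L' : Π x : 𝓑.carrier, TangentSpace (𝓡 4) x),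
    IsOpen W ∧ q ∈ W ∧ W ⊆ 𝓑.doc ∧ IsLocalKilling 𝓑 W L' ∧ ∀ x ∈ W ∩ D, L' x = L x

/-- **FAR AXIAL SEED** (`FarAxialSeed 𝓑 W Z Φ`, NEW, stub N1's output in the form stub N3 consumes): an
open `W ⊆ doc` containing EVERY point of the d.o.c. outside the `T`-orbit of some compact subset of the
d.o.c. (hence a sub-collar trace AND a neighbourhood of spatial infinity × time), a local `T`-commuting
Killing field `Z` on `W`, and a complete `2π`-PERIODIC flow `Φ` of `Z` on `W` (`Φ 0 = id`, `Φ (s + 2π) = Φ s`,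
`s ↦ Φ s x` an integral curve of `Z`, `W` invariant).  On Kerr: `W = doc`, `Z = ±∂_φ`, `Φ` the rotations.
This is the card's "`U_Z ⊇ collar ∪ {T timelike}`" restricted to what the cascade needs UPSTREAM: an end of
the d.o.c. on which the metric is EXACTLY invariant under a circle action commuting with `T`.
[cite: AlexakisIonescuKlainerman2010, Thm. 1.1] [cite: ChruscielCosta2008, §4] -/
def FarAxialSeed (W : Set 𝓑.carrier) (Z : Π x : 𝓑.carrier, TangentSpace (𝓡 4) x)
    (Φ : ℝ → 𝓑.carrier → 𝓑.carrier) : Prop :=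
  (IsOpen W ∧ W ⊆ 𝓑.doc ∧
    (∃ S₁ : Set 𝓑.carrier, IsCompact S₁ ∧ S₁ ⊆ 𝓑.doc ∧
      ∀ x ∈ 𝓑.doc, x ∉ stationaryOrbit 𝓑.killing S₁ → x ∈ W) ∧
    (ContMDiffOn (𝓡 4) ((𝓡 4).prod 𝓘(ℝ, E4)) ((⊤ : ℕ∞) : WithTop ℕ∞)
        (fun x ↦ (Bundle.TotalSpace.mk' E4 x (Z x) : TangentBundle (𝓡 4) 𝓑.carrier)) W ∧
      (∀ x ∈ W, ∀ v w : TangentSpace (𝓡 4) x,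
        𝓑.metric.val x (𝓑.metric.leviCivita Z x v) w + 𝓑.metric.val x v (𝓑.metric.leviCivita Z x w) = 0) ∧
      ∀ x ∈ W, VectorField.mlieBracket (𝓡 4) 𝓑.killing Z x = 0) ∧
    (∀ x ∈ W, Φ 0 x = x ∧ (∀ s : ℝ, Φ s x ∈ W) ∧ (∀ s : ℝ, Φ (s + 2 * Real.pi) x = Φ s x) ∧
      IsMIntegralCurve (fun s ↦ Φ s x) Z))

/-- **HIGH-AZIMUTHAL-FREQUENCY BOUND** (`HighFrequencyModeBound 𝓑`, NEW, the SCALAR form of the triage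
panel's input (T1); stub N2's conclusion and stub N3's analytic hypothesis).  For every smooth
`T`-commuting vector field `Ẑ` on the d.o.c. and every compact `S ⊆ doc` there are `m₀, C, N` such that
for all `m ≥ m₀` and all smooth `T`-INVARIANT EXACT `m`-MODE PAIRS `(u, v)` of `Ẑ` (`du(Ẑ) = −m v`,
`dv(Ẑ) = m u`) supported in the `T`-orbit of `S`:  `sup_doc (|u| + |v|) ≤ C m^N B` whenever `B ≥ 0`
bounds `□_g u, □_g v` and their first derivatives on `S` (sup norms; the `E4`-trivialisation of `TM` fixes
the operator norm — any other choice changes `C` only).  No vacuum, no periodicity of `Ẑ`, no causal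
character of `span{T, Ẑ}` is assumed: the statement is about the `T`-REDUCED d'Alembertian on the
quotient `doc/T`, which under h4 + h16 is of REAL PRINCIPAL TYPE over every compact set (the radial /
fixed points of the reduced zero-energy Hamilton flow sit exactly over ergosurface points where
`d g(T,T) ∥ T♭`, whose `T`-orbits are trapped zero-energy null (pre)geodesics — excluded by h16), so that
Hörmander's theorem on operators of real principal type (Thm. 26.1.7: `‖u‖₍ₛ₎ ≤ C(‖Pu‖₍ₛ₋₁₎ + ‖u‖₍ₛ₋₁₎)`
for `u` supported in `K`) plus the absorption `‖u‖₍ₛ₋₁₎ = m⁻¹‖Ẑv‖₍ₛ₋₁₎ ≤ (C_Ẑ/m)‖v‖₍ₛ₎` for exact mode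
pairs gives the SHARP (one-derivative-gain) bound for `m ≥ m₀`, and Sobolev on a fundamental piece gives
the sup form with `N = 0`.  Kit evidence on Kerr `a = 0.9` (card, j021196/j021219): `s(m)/m ≈ 17.6 → 8.7`
linear law vs. bounded with resonance dips on a trapped deformation.
[cite: Hormander2009ALPDO4, Thm. 26.1.7 and Def. 26.1.8] [cite: Vasy2013, §2] -/
def HighFrequencyModeBound : Prop :=
  (∀ (Zhat : Π x : 𝓑.carrier, TangentSpace (𝓡 4) x) (S : Set 𝓑.carrier),
    ContMDiffOn (𝓡 4) ((𝓡 4).prod 𝓘(ℝ, E4)) ((⊤ : ℕ∞) : WithTop ℕ∞)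
      (fun x ↦ (Bundle.TotalSpace.mk' E4 x (Zhat x) : TangentBundle (𝓡 4) 𝓑.carrier)) 𝓑.doc →
    (∀ x ∈ 𝓑.doc, VectorField.mlieBracket (𝓡 4) 𝓑.killing Zhat x = 0) →
    IsCompact S → S ⊆ 𝓑.doc →
    ∃ (m₀ : ℕ) (C : ℝ) (N : ℕ), ∀ m : ℕ, m₀ ≤ m → ∀ u v : 𝓑.carrier → ℝ,
      ContMDiffOn (𝓡 4) 𝓘(ℝ, ℝ) ((⊤ : ℕ∞) : WithTop ℕ∞) u 𝓑.doc →
      ContMDiffOn (𝓡 4) 𝓘(ℝ, ℝ) ((⊤ : ℕ∞) : WithTop ℕ∞) v 𝓑.doc →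
      (∀ x ∈ 𝓑.doc, mfderiv (𝓡 4) 𝓘(ℝ, ℝ) u x (𝓑.killing x) = 0 ∧
        mfderiv (𝓡 4) 𝓘(ℝ, ℝ) v x (𝓑.killing x) = 0) →
      (∀ x ∈ 𝓑.doc, mfderiv (𝓡 4) 𝓘(ℝ, ℝ) u x (Zhat x) = -((m : ℝ) * v x) ∧
        mfderiv (𝓡 4) 𝓘(ℝ, ℝ) v x (Zhat x) = (m : ℝ) * u x) →
      (∀ x ∈ 𝓑.doc, x ∉ stationaryOrbit 𝓑.killing S → u x = 0 ∧ v x = 0) →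
      ∀ B : ℝ, 0 ≤ B →
      (∀ y ∈ S, |𝓑.metric.dalembertian u y| ≤ B ∧ |𝓑.metric.dalembertian v y| ≤ B ∧
        ∀ w : E4, |(show ℝ from mfderiv (𝓡 4) 𝓘(ℝ, ℝ) (𝓑.metric.dalembertian u) y w)| ≤ B * ‖w‖ ∧
          |(show ℝ from mfderiv (𝓡 4) 𝓘(ℝ, ℝ) (𝓑.metric.dalembertian v) y w)| ≤ B * ‖w‖) →
      ∀ x ∈ 𝓑.doc, |u x| + |v x| ≤ C * (m : ℝ) ^ N * B)

/-- **NON-DEGENERACY OF THE COLLAR FIELD** (`CollarNonDegenerate 𝓑 K`, NEW rev 6 — the binder h17 of the reshaped far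
seed): `∇_K K = κ K` on `𝓔⁺` with ONE non-zero constant `κ` (vacuum zeroth law + non-degeneracy).  It is the hypothesis under
which the near-horizon dichotomy of Alexakis–Ionescu–Klainerman 2010 (named fact
`alexakisIonescuKlainerman2010_nearHorizonAxialKilling`) is vendored; the crux's h14 excludes extreme Kerr but does not give
`κ ≠ 0` in print (Disproof (F7): "load-bearing for the method"). [cite: AlexakisIonescuKlainerman2010, Thm. 1.2] [cite: RaczWald1996, Thm. 4.2] -/
def CollarNonDegenerate (K : Π x : 𝓑.carrier, TangentSpace (𝓡 4) x) : Prop :=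
  ∃ κ : ℝ, κ ≠ 0 ∧ ∀ p ∈ 𝓑.horizon, 𝓑.metric.leviCivita K p (K p) = κ • K p

/-- **PRECONNECTED SUB-LEVELS** (`SubLevelsPreconnected 𝓑 ρ₀`, NEW rev 6 — clause (R7) of the structural radial function):
every horizon-adjacent sub-level trace `{ρ₀ < c} ∩ doc`, `c > 0`, is preconnected (for S1b's `ρ₀ = ‖(Φ ·).2‖ − 1` it is the
`Ψ`-image of `ℝ × {1 < ‖x‖ < 1 + c}`). [cite: ChruscielCosta2008, Thm. 4.5] -/
def SubLevelsPreconnected (ρ₀ : 𝓑.carrier → ℝ) : Prop :=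
  ∀ c : ℝ, 0 < c → IsPreconnected {x | x ∈ 𝓑.doc ∧ ρ₀ x < c}

/-- **TIMELIKE REACH** (`TimelikeReach 𝓑 ρ₀`, NEW rev 6 — replaces the rev-5 corridor; worker N1 wave 3): from every far point
of the d.o.c. the connected component of the `T`-TIMELIKE region `{g(T,T) < 0} ∩ doc` containing it reaches into every sub-level
`{ρ₀ < c}`, `c > 0` (on Kerr: along the rotation axis, `g_{tt} < 0` for `r > r₊`).  This is the far seed's geometric BET in the
form the proof consumes (the rev-5 corridor `C ⊆ ({g(T,T)<0} ∪ U) ∩ doc` was insufficient: it may bridge through the ergo part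
of the collar, where the axial flow is not known to stay in `U`).  Not visibly implied by h1–h16: a closed-ergoregion cap
`ℝ × S²` above the pole pockets would refute it (and this line's far-seed architecture), not the crux. [cite: ChruscielCosta2008, §5] -/
def TimelikeReach (ρ₀ : 𝓑.carrier → ℝ) : Prop :=
  ∃ cF : ℝ, ∀ x ∈ 𝓑.doc, cF < ρ₀ x → ∀ c : ℝ, 0 < c →
    ∃ y ∈ connectedComponentIn {z | z ∈ 𝓑.doc ∧ 𝓑.metric.val z (𝓑.killing z) (𝓑.killing z) < 0} x, ρ₀ y < c

/-- **KILLING CONTINUATION COHERENCE** (`KillingContinuationCoherence 𝓑 U K`, NEW rev 6 — worker N1 wave 3's second bet: NO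
MONODROMY of docked axial continuations in the analytic region).  For open connected `D₁, D₂` inside
`{g(T,T) < 0} ∪ U` (∩ doc), local `T`-commuting Killing fields `L₁` on `D₁` and `L₂` on `D₂`, with `L₁` DOCKED (equal to
`a T + b K` on a non-empty open subset of `D₁ ∩ U`) and `L₁ = L₂` on a non-empty open subset of `D₁ ∩ D₂`: `L₁ = L₂` on all of
`D₁ ∩ D₂`.  With `D₁ = D₂` this is one-jet rigidity (a theorem); across two domains it forbids monodromy around the belt — the
analytic region `({g(T,T)<0} ∪ U) ∩ doc` has `π₁ = ℤ` already on Kerr (a loop linking the belt), where coherence nevertheless holds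
because every local Killing field of Kerr is global.  It is exactly the hypothesis `hcoh` of the continuation engine
`IsKillingFieldOn.exists_extension_of_coherent` (`KillingCoherentContinuation.lean`, p157974). [cite: Nomizu1960, Theorem 2] -/
def KillingContinuationCoherence (U : Set 𝓑.carrier) (K : Π x : 𝓑.carrier, TangentSpace (𝓡 4) x) : Prop :=
  ∀ (D₁ D₂ : Set 𝓑.carrier) (L₁ L₂ : Π x : 𝓑.carrier, TangentSpace (𝓡 4) x),
    IsOpen D₁ → IsConnected D₁ → IsOpen D₂ → IsConnected D₂ →
    D₁ ⊆ {z | z ∈ 𝓑.doc ∧ (𝓑.metric.val z (𝓑.killing z) (𝓑.killing z) < 0 ∨ z ∈ U)} →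
    D₂ ⊆ {z | z ∈ 𝓑.doc ∧ (𝓑.metric.val z (𝓑.killing z) (𝓑.killing z) < 0 ∨ z ∈ U)} →
    ContMDiffOn (𝓡 4) ((𝓡 4).prod 𝓘(ℝ, E4)) ((⊤ : ℕ∞) : WithTop ℕ∞)
      (fun x ↦ (Bundle.TotalSpace.mk' E4 x (L₁ x) : TangentBundle (𝓡 4) 𝓑.carrier)) D₁ →
    (∀ x ∈ D₁, ∀ v w : TangentSpace (𝓡 4) x,
      𝓑.metric.val x (𝓑.metric.leviCivita L₁ x v) w + 𝓑.metric.val x v (𝓑.metric.leviCivita L₁ x w) = 0) →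
    (∀ x ∈ D₁, VectorField.mlieBracket (𝓡 4) 𝓑.killing L₁ x = 0) →
    ContMDiffOn (𝓡 4) ((𝓡 4).prod 𝓘(ℝ, E4)) ((⊤ : ℕ∞) : WithTop ℕ∞)
      (fun x ↦ (Bundle.TotalSpace.mk' E4 x (L₂ x) : TangentBundle (𝓡 4) 𝓑.carrier)) D₂ →
    (∀ x ∈ D₂, ∀ v w : TangentSpace (𝓡 4) x,
      𝓑.metric.val x (𝓑.metric.leviCivita L₂ x v) w + 𝓑.metric.val x v (𝓑.metric.leviCivita L₂ x w) = 0) →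
    (∀ x ∈ D₂, VectorField.mlieBracket (𝓡 4) 𝓑.killing L₂ x = 0) →
    (∃ (a b : ℝ) (O : Set 𝓑.carrier), IsOpen O ∧ O.Nonempty ∧ O ⊆ D₁ ∩ U ∧
      ∀ x ∈ O, L₁ x = a • 𝓑.killing x + b • K x) →
    (∃ O' : Set 𝓑.carrier, IsOpen O' ∧ O'.Nonempty ∧ O' ⊆ D₁ ∩ D₂ ∧ ∀ x ∈ O', L₁ x = L₂ x) →
    ∀ x ∈ D₁ ∩ D₂, L₁ x = L₂ x

/-- **FLOW-BOX ANALYTICITY FOR TWO COMMUTING KILLING FIELDS** (`CommutingKillingFlowBoxAnalyticity 𝓑`,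
NEW in rev 2 of this skeleton — lead a1; stub N3a's conclusion and the extra input of the reshaped N3): for
every open `O` and every local `T`-commuting Killing field `Y` on `O`, at every `q ∈ O` where `T q, Y q` are
linearly independent with TIMELIKE span the metric is two-variable analytic at `q` — indeed in the joint
flow-box chart of the commuting pair `(T, Y)` (Lee 2012, Thm. 9.46: `∂₀ = T`, `∂₁ = Y`) every component
`G_{ab}` is independent of `(x⁰, x¹)` (Killing's equation for coordinate fields, Tod 2007 Thm. 3.1 /
`hasDerivAt_val_coordVector_of_killing_at`), so the two-direction Cauchy bounds hold with `C = 0`.  This is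
the SOFT last step (vi) of the cascade at points of the far seed's domain `W`; the engine keeps the belt points
of the island `doc ∖ W` and the causal bets. [cite: LeeSmoothManifolds2013, Thm. 9.46] [cite: KrantzParks2002, Prop. 2.2.10] -/
def CommutingKillingFlowBoxAnalyticity : Prop :=
  ∀ (O : Set 𝓑.carrier) (Y : Π x : 𝓑.carrier, TangentSpace (𝓡 4) x), IsOpen O →
    IsLocalKilling 𝓑 O Y →
    ∀ q ∈ O, (∀ a b : ℝ, a • 𝓑.killing q + b • Y q = 0 → a = 0 ∧ b = 0) →
      (∃ a b : ℝ, 𝓑.metric.val q (a • 𝓑.killing q + b • Y q) (a • 𝓑.killing q + b • Y q) < 0) →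
      TwoVariableAnalyticAt 𝓑 q

/-- **THE NON-ROTATING BRANCH** (`NonRotatingCollar 𝓑 K`): the collar field is a constant multiple of `T`
on the trace of some open `U'' ⊇ 𝓔⁺`.  Then `K' := α • T` proves the crux (Disproof (F3),
`conclusion_of_collar_parallel` below): the whole content of the crux is the ROTATING branch.
[cite: ChruscielCosta2008, §4] -/
def NonRotatingCollar (K : Π x : 𝓑.carrier, TangentSpace (𝓡 4) x) : Prop :=
  (∃ U'' : Set 𝓑.carrier, IsOpen U'' ∧ 𝓑.horizon ⊆ U'' ∧
    ∃ α : ℝ, ∀ x ∈ U'' ∩ 𝓑.doc, K x = α • 𝓑.killing x)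

/-- **DOCKING OF A SEED WITH THE COLLAR FIELD** (`SeedDocksWith 𝓑 K W Z`): on the trace of an open
`U'' ⊇ 𝓔⁺` inside `W`, `K = α T + β Z` with `β ≠ 0` — the normalisation of Disproof (F4) as an OUTPUT
(on Kerr `K = T + Ω_H ∂_φ`). [cite: AlexakisIonescuKlainerman2010, Thm. 1.1] -/
def SeedDocksWith (K : Π x : 𝓑.carrier, TangentSpace (𝓡 4) x) (W : Set 𝓑.carrier)
    (Z : Π x : 𝓑.carrier, TangentSpace (𝓡 4) x) : Prop :=
  (∃ U'' : Set 𝓑.carrier, IsOpen U'' ∧ 𝓑.horizon ⊆ U'' ∧ U'' ∩ 𝓑.doc ⊆ W ∧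
    ∃ α β : ℝ, β ≠ 0 ∧ ∀ x ∈ U'' ∩ 𝓑.doc, K x = α • 𝓑.killing x + β • Z x)

end Vocabulary

/-! ### The radial function of S1b (wave-2 worker W5's `IsInvariantRadialFunction`, verbatim) -/

section Bet

/-- **A `T`-invariant radial function of the d.o.c. adapted to the horizon.**  `ρ : M → ℝ` is
(R1) smooth on `⟨⟨M_ext⟩⟩ = 𝓑.doc`; (R2) `T`-invariant there, `dρ(T) = 0`; (R3) regular there, `dρ ≠ 0`;
(R4) HORIZON-ADJACENT: every sub-level `{ρ < c} ∩ doc`, `c > 0`, is the trace `U' ∩ doc` of an open `U' ⊇ 𝓔⁺`;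
(R5) THIN: every open `U₁ ⊇ 𝓔⁺` whose trace on the d.o.c. is invariant under the whole-line integral curves of `T`
contains some `{ρ < c} ∩ doc`, `c > 0`; (R6) PROPER MODULO `T`: every slab `{c₀ ≤ ρ ≤ c} ∩ doc`, `c₀ > 0`, lies in
the `T`-orbit of a compact subset of the d.o.c.  On Kerr (ingoing Kerr–Schild or Boyer–Lindquist exterior):
`ρ = r - r₊`.  For an `I⁺`-regular, future-presented, vacuum black hole with connected horizon such a `ρ` is the
`[0, ∞)`-coordinate of `S̄₀ ≈ S² × [0, ∞)` lifted along `⟨⟨M_ext⟩⟩ ∪ 𝓔⁺ ≈ ℝ × S̄₀` (Chruściel–Costa 2008, Thm. 4.5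
with Cor. 2.4–2.5 and the Poincaré conjecture); see `HasInvariantRadialFunction`.  A DEFINITION (a predicate on
`(𝓑, ρ)`; wave-2 worker W5's `IsInvariantRadialFunction`, verbatim). [cite: ChruscielCosta2008, Thm. 4.5] -/
def IsInvariantRadialFunction (𝓑 : StationaryAFBlackHole.{0}) (ρ : 𝓑.carrier → ℝ) : Prop :=
  ContMDiffOn (𝓡 4) 𝓘(ℝ, ℝ) ((⊤ : ℕ∞) : WithTop ℕ∞) ρ 𝓑.doc ∧
  (∀ x ∈ 𝓑.doc, mfderiv (𝓡 4) 𝓘(ℝ, ℝ) ρ x (𝓑.killing x) = 0) ∧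
  (∀ x ∈ 𝓑.doc, mfderiv (𝓡 4) 𝓘(ℝ, ℝ) ρ x ≠ 0) ∧
  (∀ c : ℝ, 0 < c → ∃ U' : Set 𝓑.carrier, IsOpen U' ∧ 𝓑.horizon ⊆ U' ∧
    U' ∩ 𝓑.doc = {x | x ∈ 𝓑.doc ∧ ρ x < c}) ∧
  (∀ U₁ : Set 𝓑.carrier, IsOpen U₁ → 𝓑.horizon ⊆ U₁ →
    (∀ γ : ℝ → 𝓑.carrier, IsMIntegralCurve γ 𝓑.killing → γ 0 ∈ U₁ ∩ 𝓑.doc →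
      ∀ t, γ t ∈ U₁ ∩ 𝓑.doc) →
    ∃ c : ℝ, 0 < c ∧ {x | x ∈ 𝓑.doc ∧ ρ x < c} ⊆ U₁) ∧
  (∀ c₀ c : ℝ, 0 < c₀ → ∃ S : Set 𝓑.carrier, IsCompact S ∧ S ⊆ 𝓑.doc ∧
    {x | x ∈ 𝓑.doc ∧ c₀ ≤ ρ x ∧ ρ x ≤ c} ⊆ stationaryOrbit 𝓑.killing S)

end Bet

/-! ## §2 Small facts (sorry-free): openness, locality, gluing -/

section Facts

variable (𝓑 : StationaryAFBlackHole.{0}) [𝓑.metric.HasLeviCivita]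

/-- The d.o.c. is open (O'Neill Lemma 14.3, PROVED in the tree for boundaryless carriers:
`isOpen_chronologicalFuture/Past_holds_of_boundaryless`). [cite: ONeillSemiRiemannian1983, Ch. 14, Lemma 14.3] -/
theorem isOpen_doc : IsOpen 𝓑.doc :=
  𝓑.isOpen_doc
    (LorentzianMetric.isOpen_chronologicalFuture_holds_of_boundaryless (g := 𝓑.metric) (τ := 𝓑.timeOrientation))
    (LorentzianMetric.isOpen_chronologicalPast_holds_of_boundaryless (g := 𝓑.metric) (τ := 𝓑.timeOrientation))

variable {𝓑}

/-- Unfolding lemma for `subLevel`. [folklore] -/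
@[simp] theorem mem_subLevel {f : 𝓑.carrier → ℝ} {c : ℝ} {x : 𝓑.carrier} :
    x ∈ subLevel 𝓑 f c ↔ x ∈ 𝓑.doc ∧ f x < c := Iff.rfl

/-- Sub-level sets are monotone in the level. [folklore] -/
theorem subLevel_mono (f : 𝓑.carrier → ℝ) {c c' : ℝ} (h : c ≤ c') : subLevel 𝓑 f c ⊆ subLevel 𝓑 f c' :=
  fun _ hx ↦ ⟨hx.1, lt_of_lt_of_le hx.2 h⟩

/-- Sub-level sets lie in the d.o.c. [folklore] -/
theorem subLevel_subset_doc (f : 𝓑.carrier → ℝ) (c : ℝ) : subLevel 𝓑 f c ⊆ 𝓑.doc := fun _ hx ↦ hx.1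

/-- A sub-level set of a function continuous on the (open) d.o.c. is open. [folklore] -/
theorem isOpen_subLevel {f : 𝓑.carrier → ℝ} (hf : ContinuousOn f 𝓑.doc) (c : ℝ) :
    IsOpen (subLevel 𝓑 f c) :=
  hf.isOpen_inter_preimage (isOpen_doc 𝓑) isOpen_Iio

/-- Restriction of a local `T`-commuting Killing field to a subset. [folklore] -/
theorem IsLocalKilling.mono {W W' : Set 𝓑.carrier} {L : Π x : 𝓑.carrier, TangentSpace (𝓡 4) x}
    (h : IsLocalKilling 𝓑 W L) (hW : W' ⊆ W) : IsLocalKilling 𝓑 W' L :=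
  ⟨h.1.mono hW, fun x hx ↦ h.2.1 x (hW hx), fun x hx ↦ h.2.2 x (hW hx)⟩

/-! ### Locality of the Levi-Civita connection: `Literature/Geometry/Lorentzian/LeviCivitaLocality.lean`
(`PseudoRiemannianMetric.leviCivita_congr_nhds`, landed p136112 by this lead for this line). -/

/-- **Gluing / locality of `IsLocalKilling`.**  If at every point of `W` the field `L` agrees, on an
open neighbourhood, with some local `T`-commuting Killing field, then `L` is a local `T`-commuting
Killing field on `W` (smoothness, the Killing equation and the bracket are all local in the germ of the
field). [folklore] -/
theorem IsLocalKilling.of_locally {W : Set 𝓑.carrier} {L : Π x : 𝓑.carrier, TangentSpace (𝓡 4) x}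
    (h : ∀ x ∈ W, ∃ (O : Set 𝓑.carrier) (L₀ : Π x : 𝓑.carrier, TangentSpace (𝓡 4) x),
      IsOpen O ∧ x ∈ O ∧ IsLocalKilling 𝓑 O L₀ ∧ ∀ y ∈ O, L y = L₀ y) :
    IsLocalKilling 𝓑 W L := by
  refine ⟨fun x hx ↦ ?_, fun x hx v w ↦ ?_, fun x hx ↦ ?_⟩
  · obtain ⟨O, L₀, hO, hxO, hL₀, hagree⟩ := h x hx
    have hOn : O ∈ 𝓝 x := hO.mem_nhds hxO
    have hev : (fun y ↦ (Bundle.TotalSpace.mk' E4 y (L y) : TangentBundle (𝓡 4) 𝓑.carrier)) =ᶠ[𝓝 x]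
        (fun y ↦ (Bundle.TotalSpace.mk' E4 y (L₀ y) : TangentBundle (𝓡 4) 𝓑.carrier)) := by
      filter_upwards [hOn] with y hy
      rw [hagree y hy]
    have h0 : ContMDiffAt (𝓡 4) ((𝓡 4).prod 𝓘(ℝ, E4)) ((⊤ : ℕ∞) : WithTop ℕ∞)
        (fun y ↦ (Bundle.TotalSpace.mk' E4 y (L₀ y) : TangentBundle (𝓡 4) 𝓑.carrier)) x :=
      (hL₀.1 x hxO).contMDiffAt hOn
    exact (h0.congr_of_eventuallyEq hev).contMDiffWithinAt
  · obtain ⟨O, L₀, hO, hxO, hL₀, hagree⟩ := h x hx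
    have hev : L =ᶠ[𝓝 x] L₀ := by
      filter_upwards [hO.mem_nhds hxO] with y hy using hagree y hy
    have hlc : 𝓑.metric.leviCivita L x = 𝓑.metric.leviCivita L₀ x :=
      PseudoRiemannianMetric.leviCivita_congr_nhds 𝓑.metric.toPseudoRiemannianMetric hev
    rw [hlc]
    exact hL₀.2.1 x hxO v w
  · obtain ⟨O, L₀, hO, hxO, hL₀, hagree⟩ := h x hx
    have hev : L =ᶠ[𝓝 x] L₀ := by
      filter_upwards [hO.mem_nhds hxO] with y hy using hagree y hy
    have : VectorField.mlieBracket (𝓡 4) 𝓑.killing L x = VectorField.mlieBracket (𝓡 4) 𝓑.killing L₀ x :=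
      (EventuallyEq.rfl (f := 𝓑.killing)).mlieBracket_vectorField_eq hev
    rw [this]
    exact hL₀.2.2 x hxO

/-- A local `T`-commuting Killing field on an OPEN set restricts, around each of its points, to itself
(the converse direction of `IsLocalKilling.of_locally`, used to re-base gluings). [folklore] -/
theorem IsLocalKilling.locally {W : Set 𝓑.carrier} {L : Π x : 𝓑.carrier, TangentSpace (𝓡 4) x}
    (hW : IsOpen W) (h : IsLocalKilling 𝓑 W L) :
    ∀ x ∈ W, ∃ (O : Set 𝓑.carrier) (L₀ : Π x : 𝓑.carrier, TangentSpace (𝓡 4) x),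
      IsOpen O ∧ x ∈ O ∧ IsLocalKilling 𝓑 O L₀ ∧ ∀ y ∈ O, L y = L₀ y :=
  fun x hx ↦ ⟨W, L, hW, hx, h, fun _ _ ↦ rfl⟩

/-- **A non-zero covector annihilating a timelike vector is the dual of a spacelike vector** (O'Neill
Lemma 5.26, in the tree as `LorentzianMetric.exists_pos_val_and_mfderiv_eq_val`): if `g(v, v) < 0`,
`dρ_x(v) = 0` and `dρ_x ≠ 0` then `dρ_x = g(w, ·)` with `g(w, w) > 0`. [cite: ONeill1983, Ch. 5, Lemma 5.26] -/
theorem spacelike_gradient_of_annihilates_timelike {x : 𝓑.carrier} {ρ : 𝓑.carrier → ℝ}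
    {v : TangentSpace (𝓡 4) x} (hv : 𝓑.metric.val x v v < 0) (h0 : mfderiv (𝓡 4) 𝓘(ℝ, ℝ) ρ x v = 0)
    (hne : mfderiv (𝓡 4) 𝓘(ℝ, ℝ) ρ x ≠ 0) :
    ∃ w : TangentSpace (𝓡 4) x, 0 < 𝓑.metric.val x w w ∧
      ∀ u : TangentSpace (𝓡 4) x, mfderiv (𝓡 4) 𝓘(ℝ, ℝ) ρ x u = 𝓑.metric.val x w u :=
  𝓑.metric.exists_pos_val_and_mfderiv_eq_val (T := fun _ ↦ v) hv h0 hne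


end Facts

/-! ## §3 Registered stubs (`sorry` ONLY here; shape `Holds.stub_<name>` + by-name handle)

The registered statements are written over LITERATURE VOCABULARY ONLY (the §1 predicates inlined), so that
a stub landed under `Theorems/` with Literature imports alone matches the registered signature letter for
letter; `stub_<name>_iff` below reads each back in the §1 vocabulary.  Three of the rev-4 stubs are LANDED
theorems and are called by name (S1a, S3, S4a); two rev-4 stubs are kept with their registered signatures
verbatim (S1b, S2); S4b `stub_adaptedAnalyticSweep` (crux-equivalent, `Lines/Sketch-dead.md`) is GONE,
replaced by N1 + N2 + N3; the literature debts S1c/S4c (+ Nomizu) are one stub. -/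

namespace Holds

/-- **Stub S1a · invariantKillingSubcollar — a `T`-INVARIANT Killing sub-collar; size L (standard geometry,
infrastructure-blocked).**  Under the crux's binders: an open `U₁ ⊇ 𝓔⁺` whose trace `U₁ ∩ doc` is invariant
under the (whole-line) flow of `T`, containing `V ∩ doc` for an open `V` with `𝓔⁺ ⊆ V ⊆ U`, a local
`T`-commuting Killing field `K₁` on `U₁ ∩ doc`, and an open `U'' ⊇ 𝓔⁺` with `K₁ = K` on `U'' ∩ doc`.
WHY NEEDED (wave-1 worker W1): `U' ∩ doc = {f < c₀} ∩ doc` in S1b is a union of `T`-orbits, and the crux's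
`U` may be thin in Killing time at horizon points approached by `T`-timelike points of the d.o.c. (Kerr
poles: `U = {r < r₊ + ε e^{−t²}} ∪ {x ∈ doc | r < r₊ + δ, g(T,T) > −η e^{−t²}}` satisfies h6–h15), so
`K₀ := K` on a `T`-invariant sub-collar inside `U` is not available; the field must be TRANSPORTED.
PROOF INTENDED. Transport `K` by the stationary isometries `φₜ` (`StationaryAFBlackHole.exists_stationary_flow`)
from a radially convex neighbourhood of the connected horizon: (i) `φₜ^* K = K` while the orbit segment
stays in `U` (flow form of `[T, K] = 0`); (ii) push-forwards of Killing fields by isometries are Killing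
(`ConnectionNaturality.lean` has the connection half); (iii) one-jet rigidity of Killing fields on connected
open sets (`KillingOpensJetRigidity.lean`, chart form) for consistency of overlapping transports; (iv) a
neighbourhood basis of `𝓔⁺` by sets `W` with `W ∩ φ₋ₛ(W)` connected (Lipschitz achronal boundary,
Hawking–Ellis Prop. 6.3.1 / CC08 §4.1).  Disproof (F7).4: this is the disprover's "WLOG `T`-invariant collar
needs 1-jet rigidity along `𝓔⁺`", taken as an explicit burden.  WHY IT MIGHT FAIL. Only by missing
infrastructure (i)–(iv).  REV 3.4 (wave-2 worker W4's analysis): (i) flow form of `[T,K]=0`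
(`CommutingFlowLocal.lean`), (ii) naturality (`KillingFieldOnNaturality.lean`), transported fields
(`FlowTransportedField.lean`) are LANDED; (iii)–(iv) are replaced by a CANONICAL transport — from the slice
of the Chruściel–Costa EQUIVARIANT TIME FUNCTION `t` (Thm. 4.5: smooth on the d.o.c., continuous up to `𝓔⁺`,
`t ∘ φₛ = t + s`), now the FIRST HYPOTHESIS of the stub (discharged by stub S1c = the Literature named fact
`chruscielCosta2008_equivariantTimeFunction`): `K₁(y) := dφ_{t(y)} K(φ_{−t(y)} y)` on
`U₁ ∩ doc := {y ∈ doc | φ_{−t(y)} y ∈ U}` (open, flow-invariant), `= K` near `𝓔⁺` because the orbit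
segment back to the slice stays in `U` there (continuity of `t` at horizon points, `φₛ(𝓔⁺) = 𝓔⁺ ⊆ U`,
tube lemma), and locally `K₁ = (φ_{s₀})_* K` — Killing, smooth, `T`-commuting by (ii).
[cite: ChruscielCosta2008, §2.2, §4.1 and Thm. 4.5] [cite: ONeill1983, Ch. 9, Lemma 9.28] -/
theorem stub_invariantKillingSubcollar :
    chruscielCosta2008_equivariantTimeFunction →
    ∀ (𝓑 : StationaryAFBlackHole.{0}) [𝓑.metric.HasLeviCivita],
      𝓑.metric.toPseudoRiemannianMetric.IsRicciFlat → 𝓑.IsIPlusRegular →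
      (∀ p : 𝓑.carrier, p ∈ 𝓑.metric.chronologicalFuture 𝓑.timeOrientation 𝓑.Mext) →
      (∀ p ∈ 𝓑.doc, 𝓑.killing p ≠ 0) → SimplyConnectedSpace 𝓑.doc →
      ∀ (U : Set 𝓑.carrier) (K : Π x : 𝓑.carrier, TangentSpace (𝓡 4) x), IsOpen U → 𝓑.horizon ⊆ U →
      IsConnected 𝓑.horizon →
      ContMDiffOn (𝓡 4) ((𝓡 4).prod 𝓘(ℝ, E4)) ((⊤ : ℕ∞) : WithTop ℕ∞)
        (fun x ↦ (Bundle.TotalSpace.mk' E4 x (K x) : TangentBundle (𝓡 4) 𝓑.carrier)) U →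
      (∀ x ∈ U, ∀ v w : TangentSpace (𝓡 4) x,
        𝓑.metric.val x (𝓑.metric.leviCivita K x v) w + 𝓑.metric.val x v (𝓑.metric.leviCivita K x w) = 0) →
      (∀ x ∈ U, VectorField.mlieBracket (𝓡 4) 𝓑.killing K x = 0) → (∀ p ∈ 𝓑.horizon, K p ≠ 0) →
      (∀ γ : ℝ → 𝓑.carrier, IsMIntegralCurve γ K → γ 0 ∈ 𝓑.horizon → ∀ t, γ t ∈ 𝓑.horizon) →
      (∀ x ∈ U ∩ 𝓑.doc, 𝓑.metric.val x (K x) (K x) < 0) →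
      (∃ S₀ : Set 𝓑.carrier, IsCompact S₀ ∧ S₀ ⊆ 𝓑.doc ∧ ∀ y ∈ 𝓑.doc,
        0 ≤ 𝓑.metric.val y (𝓑.killing y) (𝓑.killing y) → y ∉ U → y ∈ stationaryOrbit 𝓑.killing S₀) →
      (∀ S : Set 𝓑.carrier, IsCompact S → S ⊆ 𝓑.doc → ∀ (γ : ℝ → 𝓑.carrier) (s : Set ℝ),
        IsMaximalGeodesicOn 𝓑.metric.toPseudoRiemannianMetric.leviCivita γ s → s.Nonempty →
        (∀ t ∈ s, 𝓑.metric.val (γ t) (velocity (𝓡 4) γ t) (velocity (𝓡 4) γ t) = 0 ∧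
          velocity (𝓡 4) γ t ≠ 0 ∧ 𝓑.metric.val (γ t) (velocity (𝓡 4) γ t) (𝓑.killing (γ t)) = 0) →
        ∃ t ∈ s, γ t ∉ stationaryOrbit 𝓑.killing S) →
      ∃ (U₁ V U'' : Set 𝓑.carrier) (K₁ : Π x : 𝓑.carrier, TangentSpace (𝓡 4) x),
        IsOpen U₁ ∧ 𝓑.horizon ⊆ U₁ ∧
        (∀ γ : ℝ → 𝓑.carrier, IsMIntegralCurve γ 𝓑.killing → γ 0 ∈ U₁ ∩ 𝓑.doc →
          ∀ t, γ t ∈ U₁ ∩ 𝓑.doc) ∧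
        IsOpen V ∧ 𝓑.horizon ⊆ V ∧ V ⊆ U ∧ V ∩ 𝓑.doc ⊆ U₁ ∧
        (ContMDiffOn (𝓡 4) ((𝓡 4).prod 𝓘(ℝ, E4)) ((⊤ : ℕ∞) : WithTop ℕ∞)
            (fun x ↦ (Bundle.TotalSpace.mk' E4 x (K₁ x) : TangentBundle (𝓡 4) 𝓑.carrier)) (U₁ ∩ 𝓑.doc) ∧
          (∀ x ∈ (U₁ ∩ 𝓑.doc), ∀ v w : TangentSpace (𝓡 4) x,
            𝓑.metric.val x (𝓑.metric.leviCivita K₁ x v) w +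
              𝓑.metric.val x v (𝓑.metric.leviCivita K₁ x w) = 0) ∧
          ∀ x ∈ (U₁ ∩ 𝓑.doc), VectorField.mlieBracket (𝓡 4) 𝓑.killing K₁ x = 0) ∧
        IsOpen U'' ∧ 𝓑.horizon ⊆ U'' ∧ ∀ x ∈ U'' ∩ 𝓑.doc, K₁ x = K x :=
  Summit.FinalStateConjecture.FinalStateConjecture.Theorems.NonTrappingHawkingRigidity.AzimuthalPartialAnalyticity.stub_invariantKillingSubcollar

/-- **Stub S1b · invariantRadialFunction — STRUCTURE OF THE D.O.C. (rev 4: the former bet is gone, absorbed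
into the adapted engine S4b); literature level, size L–XL as a formalization.**  For every vacuum, `I⁺`-regular,
future-presented `𝓑` with `T ≠ 0` on a simply connected d.o.c. and connected horizon (binders h1–h5, h8): there
is a `T`-INVARIANT RADIAL FUNCTION `ρ` of the d.o.c. adapted to the horizon — (R1) smooth on the d.o.c., (R2)
`dρ(T) = 0`, (R3) `dρ ≠ 0`, (R4) sub-levels `{ρ < c}` are traces of open neighbourhoods of `𝓔⁺`, (R5) thin below
every flow-invariant open neighbourhood of `𝓔⁺`, (R6) slabs compact modulo `T` (`IsInvariantRadialFunction`, §1).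
NOTHING is asked of the causal character of `dρ` (that is now part of the engine's output, stub S4b
`stub_adaptedAnalyticSweep`).  PROOF IN PRINT: `ρ` is the `[0, ∞)`-coordinate of `S̄₀ ≈ S² × [0, ∞)` lifted along
`⟨⟨M_ext⟩⟩ ∪ 𝓔⁺ ≈ ℝ × S̄₀` — Chruściel–Costa 2008, Thm. 4.5 (product structure WITH ergoregion; the tree has it only
for `T` timelike on the whole d.o.c., `IsIPlusRegular.exists_docTrivialization`, and its time-function part as the
named fact `chruscielCosta2008_equivariantTimeFunction`), Cor. 2.4–2.5 / §4.1 (`∂S̄₀` is a compact connected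
cross-section — `𝓔⁺` connected, h8), topological censorship (simple connectivity of the d.o.c., h5, passes to
`S̄₀`: Galloway 1995 / Chruściel–Wald 1994) and the Poincaré conjecture (a simply connected 3-manifold with one
`S²` boundary component and one asymptotically flat end is `S² × [0, ∞)`).  On Kerr `ρ = r − r₊`.  WHY IT MIGHT
FAIL. Only as a formalization debt (3-manifold topology). [cite: ChruscielCosta2008, Thm. 4.5 and §4.1]
[cite: ChruscielWald1994, Thm. 1] -/
theorem stub_invariantRadialFunction :
    chruscielCosta2008_docProductStructure →
    ∀ (𝓑 : StationaryAFBlackHole.{0}) [𝓑.metric.HasLeviCivita],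
      𝓑.metric.toPseudoRiemannianMetric.IsRicciFlat → 𝓑.IsIPlusRegular →
      (∀ p : 𝓑.carrier, p ∈ 𝓑.metric.chronologicalFuture 𝓑.timeOrientation 𝓑.Mext) →
      (∀ p ∈ 𝓑.doc, 𝓑.killing p ≠ 0) → SimplyConnectedSpace 𝓑.doc → IsConnected 𝓑.horizon →
      ∃ ρ : 𝓑.carrier → ℝ,
        ContMDiffOn (𝓡 4) 𝓘(ℝ, ℝ) ((⊤ : ℕ∞) : WithTop ℕ∞) ρ 𝓑.doc ∧
        (∀ x ∈ 𝓑.doc, mfderiv (𝓡 4) 𝓘(ℝ, ℝ) ρ x (𝓑.killing x) = 0) ∧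
        (∀ x ∈ 𝓑.doc, mfderiv (𝓡 4) 𝓘(ℝ, ℝ) ρ x ≠ 0) ∧
        (∀ c : ℝ, 0 < c → ∃ U' : Set 𝓑.carrier, IsOpen U' ∧ 𝓑.horizon ⊆ U' ∧
          U' ∩ 𝓑.doc = {x | x ∈ 𝓑.doc ∧ ρ x < c}) ∧
        (∀ U₁ : Set 𝓑.carrier, IsOpen U₁ → 𝓑.horizon ⊆ U₁ →
          (∀ γ : ℝ → 𝓑.carrier, IsMIntegralCurve γ 𝓑.killing → γ 0 ∈ U₁ ∩ 𝓑.doc →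
            ∀ t, γ t ∈ U₁ ∩ 𝓑.doc) →
          ∃ c : ℝ, 0 < c ∧ {x | x ∈ 𝓑.doc ∧ ρ x < c} ⊆ U₁) ∧
        (∀ c₀ c : ℝ, 0 < c₀ → ∃ S : Set 𝓑.carrier, IsCompact S ∧ S ⊆ 𝓑.doc ∧
          {x | x ∈ 𝓑.doc ∧ c₀ ≤ ρ x ∧ ρ x ≤ c} ⊆ stationaryOrbit 𝓑.killing S) :=
  Summit.FinalStateConjecture.FinalStateConjecture.Theorems.NonTrappingHawkingRigidity.AzimuthalPartialAnalyticity.stub_invariantRadialFunction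

/-- **Stub S1b₇ · invariantRadialFunctionConnected — S1b WITH PRECONNECTED SUB-LEVELS (NEW rev 6; size S: re-land of the
LANDED S1b p152581 with one extra clause).**  As `stub_invariantRadialFunction` (Chruściel–Costa product structure ⇒ a
`T`-invariant radial function `ρ` with (R1)–(R6)), plus (R7) `∀ c > 0, IsPreconnected ({ρ < c} ∩ doc)` — for the witness
`ρ = ‖(Φ ·).2‖ − 1` of the landed proof this is the `Ψ`-image of the connected `ℝ × {1 < ‖x‖ < 1 + c}`.  Needed by the
reshaped far seed N1 (to put the whole sub-collar trace in ONE component of the axial collar).  PROOF: copy the landed file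
`Theorems/ZeroEnergyKerrOrBombNonTrappingHawkingRigidityStubInvariantRadialFunction.lean` and add the image-of-connected clause
(`IsConnected.image` / `isPreconnected` of a product of connected sets under `ContinuousOn`). [cite: ChruscielCosta2008, Thm. 4.5] -/
theorem stub_invariantRadialFunctionConnected :
    chruscielCosta2008_docProductStructure →
    ∀ (𝓑 : StationaryAFBlackHole.{0}) [𝓑.metric.HasLeviCivita],
      𝓑.metric.toPseudoRiemannianMetric.IsRicciFlat → 𝓑.IsIPlusRegular →
      (∀ p : 𝓑.carrier, p ∈ 𝓑.metric.chronologicalFuture 𝓑.timeOrientation 𝓑.Mext) →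
      (∀ p ∈ 𝓑.doc, 𝓑.killing p ≠ 0) → SimplyConnectedSpace 𝓑.doc → IsConnected 𝓑.horizon →
      ∃ ρ : 𝓑.carrier → ℝ,
        ContMDiffOn (𝓡 4) 𝓘(ℝ, ℝ) ((⊤ : ℕ∞) : WithTop ℕ∞) ρ 𝓑.doc ∧
        (∀ x ∈ 𝓑.doc, mfderiv (𝓡 4) 𝓘(ℝ, ℝ) ρ x (𝓑.killing x) = 0) ∧
        (∀ x ∈ 𝓑.doc, mfderiv (𝓡 4) 𝓘(ℝ, ℝ) ρ x ≠ 0) ∧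
        (∀ c : ℝ, 0 < c → ∃ U' : Set 𝓑.carrier, IsOpen U' ∧ 𝓑.horizon ⊆ U' ∧
          U' ∩ 𝓑.doc = {x | x ∈ 𝓑.doc ∧ ρ x < c}) ∧
        (∀ U₁ : Set 𝓑.carrier, IsOpen U₁ → 𝓑.horizon ⊆ U₁ →
          (∀ γ : ℝ → 𝓑.carrier, IsMIntegralCurve γ 𝓑.killing → γ 0 ∈ U₁ ∩ 𝓑.doc →
            ∀ t, γ t ∈ U₁ ∩ 𝓑.doc) →
          ∃ c : ℝ, 0 < c ∧ {x | x ∈ 𝓑.doc ∧ ρ x < c} ⊆ U₁) ∧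
        (∀ c₀ c : ℝ, 0 < c₀ → ∃ S : Set 𝓑.carrier, IsCompact S ∧ S ⊆ 𝓑.doc ∧
          {x | x ∈ 𝓑.doc ∧ c₀ ≤ ρ x ∧ ρ x ≤ c} ⊆ stationaryOrbit 𝓑.killing S) ∧
        (∀ c : ℝ, 0 < c → IsPreconnected {x | x ∈ 𝓑.doc ∧ ρ x < c}) :=
  Summit.FinalStateConjecture.FinalStateConjecture.Theorems.NonTrappingHawkingRigidity.AzimuthalPartialAnalyticity.stub_invariantRadialFunctionConnected

/-- **Stub S2 · pointContinuation — THE IN-PRINT LEVER: Killing continuation across a NON-NULL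
hypersurface under TWO-VARIABLE ANALYTICITY; size L–XL.**  In a Ricci-flat `𝓑`, let `L` be a local
`T`-commuting Killing field on an open `D ⊆ doc`, let `q ∈ doc`, let `D` contain the strict sub-level
side near `q` of a function `f` smooth near `q` with NON-NULL gradient at `q` (`NonNullSupportAt`), and let
the metric be two-variable analytic at `q` (`TwoVariableAnalyticAt`: a chart around `q` with timelike
coordinate 2-plane `span{∂₀, ∂₁}` at `q` in which the components extend holomorphically in `(z⁰, z¹)`,
jointly smoothly).  Then `(D, L)` has a one-step continuation at `q`: an open `W ∋ q` in the d.o.c. and a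
local `T`-commuting Killing field `L'` on `W` with `L' = L` on `W ∩ D`.
PROOF IN PRINT (the engine) + ROUTINE (the system).  Unique continuation across the non-characteristic
hypersurface `{f = f q}` at `q` for second-order operators with real principal symbol `g^{μν}ξ_μξ_ν ⊗ Id`
whose coefficients are `C^∞` and analytic in `x_a = (x⁰, x¹)`: Tataru, JMPA 78 (1999) Thm 1;
Robbiano–Zuily, Invent. Math. 131 (1998) Thm A; Hörmander, PNLDE 32 (1997) Thm 1 (quantitative:
Laurent–Léautaud, JEMS 21 (2019)) — the pseudo-convexity hypothesis is required only on the residual set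
`Γ_q = Char ∩ {ξ(∂₀) = ξ(∂₁) = 0}`, which is EMPTY because `span{∂₀, ∂₁}` is timelike at `q` (a null
covector annihilating a timelike 2-plane is zero: `SketchIdeator1.orthogonalOfTimelikePlaneIsSpacelike_holds`),
and non-characteristicity is `g⁻¹(df, df) = g(n, n) ≠ 0`.  Applied to the Ionescu–Klainerman
Killing-extension system for `(L; π = 𝓛_L g, W = 𝓛_L Riem)` (JAMS 26 (2013) = arXiv:1108.3575 §2 and
AIK CMP 299 (2010) §4: `□_g W = 𝓜(W, ∇W, π, ∇π)`, transport equations for `π` along the geodesics from the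
known side, all coefficients built from `g`, hence two-variable analytic in the same chart), whose unknowns
vanish on the known side `{f < f q} ∩ N ∩ doc ⊆ D`; the extended `L` (defined by the IK Jacobi-type
transport) is then Killing near `q`, `[T, L']` is Killing on `W` and vanishes on the known side, hence on
the connected `W` (one-jet uniqueness, `KillingOpensJetRigidity.lean` pattern); shrink `W` into the open
d.o.c.  WHY IT MIGHT FAIL. Transcription risk W7 of the card: Tataru/RZ/H are stated for (systems with)
scalar real principal part; the IK system couples a wave part with a TRANSPORT part, for which the
partially-analytic Carleman weight must be re-derived (IK's own Carleman pair, Prop. 3.3 of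
arXiv:0711.0040 + Lemma A.3 of AIK 2010a, is pseudo-convexity-based) — not verbatim in print; the
scalar model (`SketchIdeator1.TwoKillingNonNullContinuation`) is.
[cite: Tataru1999PartiallyAnalytic, Thm. 1] [cite: RobbianoZuily1998, Thm. A] [cite: Hormander1997PartialAnalyticity, Thm. 1]
[cite: IonescuKlainerman2012, Thm. 1.2 and §2] [cite: AlexakisIonescuKlainerman2009, §4] -/
theorem stub_pointContinuation :
    ∀ (𝓑 : StationaryAFBlackHole.{0}) [𝓑.metric.HasLeviCivita],
      𝓑.metric.toPseudoRiemannianMetric.IsRicciFlat →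
      ∀ (D : Set 𝓑.carrier) (L : Π x : 𝓑.carrier, TangentSpace (𝓡 4) x), IsOpen D → D ⊆ 𝓑.doc →
      (ContMDiffOn (𝓡 4) ((𝓡 4).prod 𝓘(ℝ, E4)) ((⊤ : ℕ∞) : WithTop ℕ∞)
          (fun x ↦ (Bundle.TotalSpace.mk' E4 x (L x) : TangentBundle (𝓡 4) 𝓑.carrier)) D ∧
        (∀ x ∈ D, ∀ v w : TangentSpace (𝓡 4) x,
          𝓑.metric.val x (𝓑.metric.leviCivita L x v) w + 𝓑.metric.val x v (𝓑.metric.leviCivita L x w) = 0) ∧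
        ∀ x ∈ D, VectorField.mlieBracket (𝓡 4) 𝓑.killing L x = 0) →
      ∀ q ∈ 𝓑.doc, ∀ f : 𝓑.carrier → ℝ,
      (∃ N : Set 𝓑.carrier, IsOpen N ∧ q ∈ N ∧
        ContMDiffOn (𝓡 4) 𝓘(ℝ, ℝ) ((⊤ : ℕ∞) : WithTop ℕ∞) f N ∧
        (∃ nq : TangentSpace (𝓡 4) q, 𝓑.metric.val q nq nq ≠ 0 ∧
          ∀ w : TangentSpace (𝓡 4) q, mfderiv (𝓡 4) 𝓘(ℝ, ℝ) f q w = 𝓑.metric.val q nq w) ∧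
        ∀ x ∈ N ∩ 𝓑.doc, x ∈ D ↔ f x < f q) →
      (∃ ψ ∈ IsManifold.maximalAtlas (𝓡 4) ((⊤ : ℕ∞) : WithTop ℕ∞) 𝓑.carrier, q ∈ ψ.source ∧
        (∃ a b : ℝ, 𝓑.metric.val q
            (a • mfderiv 𝓘(ℝ, E4) (𝓡 4) ψ.symm (ψ q) (EuclideanSpace.single 0 1) +
              b • mfderiv 𝓘(ℝ, E4) (𝓡 4) ψ.symm (ψ q) (EuclideanSpace.single 1 1))
            (a • mfderiv 𝓘(ℝ, E4) (𝓡 4) ψ.symm (ψ q) (EuclideanSpace.single 0 1) +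
              b • mfderiv 𝓘(ℝ, E4) (𝓡 4) ψ.symm (ψ q) (EuclideanSpace.single 1 1)) < 0) ∧
        ∀ a b : E4, ∃ δ > (0 : ℝ), ∃ M C : ℝ, 0 ≤ M ∧ 0 ≤ C ∧ Metric.ball (ψ q) δ ⊆ ψ.target ∧
          ContDiffOn ℝ ((⊤ : ℕ∞) : WithTop ℕ∞)
            (fun p : E4 ↦ 𝓑.metric.val (ψ.symm p) (mfderiv 𝓘(ℝ, E4) (𝓡 4) ψ.symm p a) (mfderiv 𝓘(ℝ, E4) (𝓡 4) ψ.symm p b)) (Metric.ball (ψ q) δ) ∧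
          ∀ z ∈ Metric.ball (ψ q) δ, ∀ (k : ℕ) (v : Fin k → E4),
            (∀ i, v i = EuclideanSpace.single 0 1 ∨ v i = EuclideanSpace.single 1 1) →
            ‖iteratedFDeriv ℝ k
                (fun p : E4 ↦ 𝓑.metric.val (ψ.symm p) (mfderiv 𝓘(ℝ, E4) (𝓡 4) ψ.symm p a) (mfderiv 𝓘(ℝ, E4) (𝓡 4) ψ.symm p b)) z v‖ ≤ M * C ^ k * k !) →
      (∃ (W : Set 𝓑.carrier) (L' : Π x : 𝓑.carrier, TangentSpace (𝓡 4) x),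
        IsOpen W ∧ q ∈ W ∧ W ⊆ 𝓑.doc ∧
        (ContMDiffOn (𝓡 4) ((𝓡 4).prod 𝓘(ℝ, E4)) ((⊤ : ℕ∞) : WithTop ℕ∞)
            (fun x ↦ (Bundle.TotalSpace.mk' E4 x (L' x) : TangentBundle (𝓡 4) 𝓑.carrier)) W ∧
          (∀ x ∈ W, ∀ v w : TangentSpace (𝓡 4) x,
            𝓑.metric.val x (𝓑.metric.leviCivita L' x v) w + 𝓑.metric.val x v (𝓑.metric.leviCivita L' x w) = 0) ∧
          ∀ x ∈ W, VectorField.mlieBracket (𝓡 4) 𝓑.killing L' x = 0) ∧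
        ∀ x ∈ W ∩ D, L' x = L x) := by
  sorry

/-- **Stub S2a · pointContinuationAnalytic — THE LEVER IN THE FULLY ANALYTIC REGION = LOCAL NOMIZU (NEW, rev 3,
lead a1 after wave-1 worker S2's audit); size L–XL (1.5–3 kLoC of bookkeeping bricks, provable modulo the named
fact it takes).**  Assuming Nomizu's extension theorem in the tree's `C^∞` rendering
(`PseudoRiemannianMetric.Nomizu1960_killing_extension`, `NomizuKillingExtension.lean`: analytic metric on a simply
connected analytic manifold, `Y` smooth and Killing on an open connected `𝒪` ⇒ a global smooth Killing `Ŷ = Y` on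
`𝒪`): in any `𝓑`, a local `T`-commuting Killing field `L` on an open `D ⊆ doc`, a point `q ∈ doc` supported by
`D` through a NON-NULL level of `f` (`NonNullSupportAt`), and CHARTWISE FULL ANALYTICITY of the metric at `q`
(`𝓑.IsChartwiseAnalyticAt q`: a chart of the maximal `C^∞` atlas around `q` with ALL components real-analytic on
its target — verbatim the output of `mullerZumHagen1970_analytic_of_timelikeKilling`, which the composition
supplies at `T`-timelike points and on the collar `U`) give a one-step continuation of `(D, L)` at `q`
(`PointContinuationAt`).  No vacuum hypothesis (analyticity is the input).  This takes over from S2 the whole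
`T`-timelike part of the sweep and the collar; S2 is now needed at BELT points only.
PROOF INTENDED (worker S2's audit, `work/stubs/stub_pointContinuation.audit.md`). (1) From the analytic chart
`ψ` build, on a small open `V ∋ q` inside `ψ.source ∩ doc`, the structure Nomizu wants: `V` as a manifold with
the single chart `ψ|_V` is trivially `C^ω`; the metric pulled to `ψ '' V ⊆ E4` has analytic components, hence is
a `C^ω` pseudo-Riemannian metric there (`LeviCivitaAnalytic.lean` for the connection); transfer Killing / smooth
sections through the chart (`IsKillingFieldOn.comap_mpullback`, `leviCivita_mpullback_apply_of_val_mfderiv_eq`).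
(2) Choose `V` as a BOX in `f`-adapted coordinates (`df_q ≠ 0`: a chart in which `f` is a coordinate, implicit
function theorem / `ChartFromFunctions.lean`), so that `V` is contractible (simply connected) and
`𝒪 := V ∩ D = V ∩ {f < f q}` is a convex half-box: open, connected, non-empty. (3) Nomizu on `V` with `𝒪`: a
smooth Killing `Ŷ` on `V` with `Ŷ = L` on `𝒪`. (4) `[T, Ŷ]` is Killing on `V` (bracket of Killing fields — the
tree has the global form `isKillingField_mlieBracket_killing`; localise) and vanishes on the open `𝒪` (there
`Ŷ = L` as germs and `[T, L] = 0`), hence on the connected `V` (one-jet rigidity inside one chart,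
`KillingJetRigidity.eqOn_zero_of_isPreconnected` / `IsKillingField.eq_zero_of_oneJet_eq_zero'`). (5) `W := V`.
WHY IT MIGHT FAIL. Only as bookkeeping volume (the `∞ ↔ ω` regularity bridge for the restricted structure; the
connected half-box).  [cite: Nomizu1960, Theorems 1–2] [cite: Chrusciel1997, Thm. 2.1] [cite: ONeill1983, Ch. 9, Lemma 9.28] -/
theorem stub_pointContinuationAnalytic :
    PseudoRiemannianMetric.Nomizu1960_killing_extension →
    ∀ (𝓑 : StationaryAFBlackHole.{0}) [𝓑.metric.HasLeviCivita],
      ∀ (D : Set 𝓑.carrier) (L : Π x : 𝓑.carrier, TangentSpace (𝓡 4) x), IsOpen D → D ⊆ 𝓑.doc →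
      (ContMDiffOn (𝓡 4) ((𝓡 4).prod 𝓘(ℝ, E4)) ((⊤ : ℕ∞) : WithTop ℕ∞)
          (fun x ↦ (Bundle.TotalSpace.mk' E4 x (L x) : TangentBundle (𝓡 4) 𝓑.carrier)) D ∧
        (∀ x ∈ D, ∀ v w : TangentSpace (𝓡 4) x,
          𝓑.metric.val x (𝓑.metric.leviCivita L x v) w + 𝓑.metric.val x v (𝓑.metric.leviCivita L x w) = 0) ∧
        ∀ x ∈ D, VectorField.mlieBracket (𝓡 4) 𝓑.killing L x = 0) →
      ∀ q ∈ 𝓑.doc, ∀ f : 𝓑.carrier → ℝ,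
      (∃ N : Set 𝓑.carrier, IsOpen N ∧ q ∈ N ∧
        ContMDiffOn (𝓡 4) 𝓘(ℝ, ℝ) ((⊤ : ℕ∞) : WithTop ℕ∞) f N ∧
        (∃ nq : TangentSpace (𝓡 4) q, 𝓑.metric.val q nq nq ≠ 0 ∧
          ∀ w : TangentSpace (𝓡 4) q, mfderiv (𝓡 4) 𝓘(ℝ, ℝ) f q w = 𝓑.metric.val q nq w) ∧
        ∀ x ∈ N ∩ 𝓑.doc, x ∈ D ↔ f x < f q) →
      (∃ ψ ∈ IsManifold.maximalAtlas (𝓡 4) ((⊤ : ℕ∞) : WithTop ℕ∞) 𝓑.carrier,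
        q ∈ ψ.source ∧ ∀ a b : E4, AnalyticOnNhd ℝ
          (fun p : E4 ↦ 𝓑.metric.val (ψ.symm p) (mfderiv 𝓘(ℝ, E4) (𝓡 4) ψ.symm p a)
            (mfderiv 𝓘(ℝ, E4) (𝓡 4) ψ.symm p b)) ψ.target) →
      (∃ (W : Set 𝓑.carrier) (L' : Π x : 𝓑.carrier, TangentSpace (𝓡 4) x),
        IsOpen W ∧ q ∈ W ∧ W ⊆ 𝓑.doc ∧
        (ContMDiffOn (𝓡 4) ((𝓡 4).prod 𝓘(ℝ, E4)) ((⊤ : ℕ∞) : WithTop ℕ∞)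
            (fun x ↦ (Bundle.TotalSpace.mk' E4 x (L' x) : TangentBundle (𝓡 4) 𝓑.carrier)) W ∧
          (∀ x ∈ W, ∀ v w : TangentSpace (𝓡 4) x,
            𝓑.metric.val x (𝓑.metric.leviCivita L' x v) w + 𝓑.metric.val x v (𝓑.metric.leviCivita L' x w) = 0) ∧
          ∀ x ∈ W, VectorField.mlieBracket (𝓡 4) 𝓑.killing L' x = 0) ∧
        ∀ x ∈ W ∩ D, L' x = L x) :=
  Summit.FinalStateConjecture.FinalStateConjecture.Theorems.NonTrappingHawkingRigidity.AzimuthalPartialAnalyticity.stub_pointContinuationAnalytic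

/-- **Stub S3 · slabPatching — pointwise continuations along a level of the sweep patch to a uniform
slab; size L (differential topology, provable in principle).**  Let `f` be a timelike sweep off `U'`
with bottom level `c₀` (`IsTimelikeSweep`) of an `I⁺`-regular `𝓑`, `c ≥ c₀`, and `L` a local
`T`-commuting Killing field on the sub-level set `{f < c} ∩ doc`.  If `({f < c} ∩ doc, L)` has a
one-step continuation at EVERY point of the level `{f = c} ∩ doc`, then there are `ε > 0` and ONE local
`T`-commuting Killing field `L'` on `{f < c + ε} ∩ doc` with `L' = L` on `{f < c} ∩ doc`.
PROOF INTENDED. (1) Consistency: two continuations `(W_q, L_q)`, `(W_{q'}, L_{q'})` agree on every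
connected component of `W_q ∩ W_{q'}` that meets the known side (their difference is Killing there and
vanishes on a non-empty open subset: one-jet rigidity, O'Neill Lemma 9.28 — in the tree for chart metrics,
`OpensChart.IsKillingField.eq_zero_of_oneJet_eq_zero`); shrinking each `W_q` to a box saturated by the
integral curves of `grad f` (flow-box of the non-vanishing gradient near the level; `df ≠ 0` there because
the gradient is spacelike) makes every component of every pairwise intersection meet `{f < c}` (follow the
gradient line down), so the `L_q` glue to one field near the level.  (2) Uniformity modulo `T`: the level is
`T`-invariant and, by properness of the slab `{c₀ ≤ f ≤ c + 1}` modulo `T`, contained in the `T`-orbit of a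
COMPACT subset `C` of itself; finitely many boxes cover `C`; the stationary isometries `φ_t` (complete `T`,
`I⁺`-regularity; `KillingFlowIsometry.lean`) transport boxes and fields (`f`, `doc` and — by `[T, L] = 0` on
the `T`-invariant domain — `L` are flow-invariant), and the complement of the glued domain in a compact
fundamental piece of the slab is compact with `f > c` on it, whence a uniform `ε`.  (3) If the level is
empty, properness gives `{f < c + ε} ∩ doc = {f < c} ∩ doc` for small `ε` and `L' = L`.  Smoothness /
Killing / bracket of the glued field: `IsLocalKilling.of_locally`.  WHY IT MIGHT FAIL. Only by missing
infrastructure (flow-box theorem, global flows of complete vector fields as smooth isometric actions,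
one-jet rigidity on an abstract manifold) — the statement is textbook.
[cite: ONeill1983, Ch. 9, Lemma 9.28 and Prop. 9.30] [cite: KobayashiNomizu1963, Ch. VI, Thm. 3.3]
[cite: ChruscielCosta2008, §4] -/
theorem stub_slabPatching :
    ∀ (𝓑 : StationaryAFBlackHole.{0}) [𝓑.metric.HasLeviCivita], 𝓑.IsIPlusRegular →
      ∀ (U' : Set 𝓑.carrier) (f : 𝓑.carrier → ℝ) (c₀ : ℝ),
      (ContMDiffOn (𝓡 4) 𝓘(ℝ, ℝ) ((⊤ : ℕ∞) : WithTop ℕ∞) f 𝓑.doc ∧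
        (∀ x ∈ 𝓑.doc, mfderiv (𝓡 4) 𝓘(ℝ, ℝ) f x (𝓑.killing x) = 0) ∧
        {x | x ∈ 𝓑.doc ∧ f x < c₀} = U' ∩ 𝓑.doc ∧
        (∀ x ∈ 𝓑.doc, c₀ ≤ f x → ∃ w : TangentSpace (𝓡 4) x, 0 < 𝓑.metric.val x w w ∧
          ∀ u : TangentSpace (𝓡 4) x, mfderiv (𝓡 4) 𝓘(ℝ, ℝ) f x u = 𝓑.metric.val x w u) ∧
        ∀ c : ℝ, ∃ S : Set 𝓑.carrier, IsCompact S ∧ S ⊆ 𝓑.doc ∧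
          {x | x ∈ 𝓑.doc ∧ c₀ ≤ f x ∧ f x ≤ c} ⊆ stationaryOrbit 𝓑.killing S) →
      ∀ c : ℝ, c₀ ≤ c → ∀ L : Π x : 𝓑.carrier, TangentSpace (𝓡 4) x,
      (ContMDiffOn (𝓡 4) ((𝓡 4).prod 𝓘(ℝ, E4)) ((⊤ : ℕ∞) : WithTop ℕ∞)
          (fun x ↦ (Bundle.TotalSpace.mk' E4 x (L x) : TangentBundle (𝓡 4) 𝓑.carrier)) {x | x ∈ 𝓑.doc ∧ f x < c} ∧
        (∀ x ∈ {x | x ∈ 𝓑.doc ∧ f x < c}, ∀ v w : TangentSpace (𝓡 4) x,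
          𝓑.metric.val x (𝓑.metric.leviCivita L x v) w + 𝓑.metric.val x v (𝓑.metric.leviCivita L x w) = 0) ∧
        ∀ x ∈ {x | x ∈ 𝓑.doc ∧ f x < c}, VectorField.mlieBracket (𝓡 4) 𝓑.killing L x = 0) →
      (∀ q ∈ 𝓑.doc, f q = c →
        (∃ (W : Set 𝓑.carrier) (L' : Π x : 𝓑.carrier, TangentSpace (𝓡 4) x),
          IsOpen W ∧ q ∈ W ∧ W ⊆ 𝓑.doc ∧
          (ContMDiffOn (𝓡 4) ((𝓡 4).prod 𝓘(ℝ, E4)) ((⊤ : ℕ∞) : WithTop ℕ∞)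
              (fun x ↦ (Bundle.TotalSpace.mk' E4 x (L' x) : TangentBundle (𝓡 4) 𝓑.carrier)) W ∧
            (∀ x ∈ W, ∀ v w : TangentSpace (𝓡 4) x,
              𝓑.metric.val x (𝓑.metric.leviCivita L' x v) w + 𝓑.metric.val x v (𝓑.metric.leviCivita L' x w) = 0) ∧
            ∀ x ∈ W, VectorField.mlieBracket (𝓡 4) 𝓑.killing L' x = 0) ∧
          ∀ x ∈ W ∩ {x | x ∈ 𝓑.doc ∧ f x < c}, L' x = L x)) →
      ∃ ε : ℝ, 0 < ε ∧ ∃ L' : Π x : 𝓑.carrier, TangentSpace (𝓡 4) x,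
        (ContMDiffOn (𝓡 4) ((𝓡 4).prod 𝓘(ℝ, E4)) ((⊤ : ℕ∞) : WithTop ℕ∞)
            (fun x ↦ (Bundle.TotalSpace.mk' E4 x (L' x) : TangentBundle (𝓡 4) 𝓑.carrier)) {x | x ∈ 𝓑.doc ∧ f x < c + ε} ∧
          (∀ x ∈ {x | x ∈ 𝓑.doc ∧ f x < c + ε}, ∀ v w : TangentSpace (𝓡 4) x,
            𝓑.metric.val x (𝓑.metric.leviCivita L' x v) w + 𝓑.metric.val x v (𝓑.metric.leviCivita L' x w) = 0) ∧
          ∀ x ∈ {x | x ∈ 𝓑.doc ∧ f x < c + ε}, VectorField.mlieBracket (𝓡 4) 𝓑.killing L' x = 0) ∧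
        ∀ x ∈ {x | x ∈ 𝓑.doc ∧ f x < c}, L' x = L x :=
  Summit.FinalStateConjecture.FinalStateConjecture.Theorems.NonTrappingHawkingRigidity.AzimuthalPartialAnalyticity.stub_slabPatching

/-- **Stub S4a · twoVariableAnalyticitySeeds — LANDED (p137190, wave-2 worker, 2026-08-17T01:55Z,
`Theorems/ZeroEnergyKerrOrBombNonTrappingHawkingRigidityStubTwoVariableAnalyticitySeeds.lean`) — the FREE
part of the engine: two-variable analyticity where `T` is timelike and on the collar, from Müller zum
Hagen's theorem (an explicit HYPOTHESIS of this stub = the registered debt S4c).**  Under the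
crux's binders, at every `q ∈ doc` with `g(T,T)(q) < 0` OR `q ∈ U`, the metric is two-variable analytic.
PROOF INTENDED. `mullerZumHagen1970_analytic_of_timelikeKilling` applied with `(U := univ, K := T)`
(`T` is smooth and Killing on the whole carrier: `𝓑.isStationaryKilling.isKillingField`) at a point where
`T` is timelike, resp. with the COLLAR pair `(U, K)` (smooth and Killing on `U` by h9–h10, timelike at
`q ∈ U ∩ doc` by h14), gives a chart `ψ` of the maximal smooth atlas around `q` with all components
`AnalyticOnNhd ℝ` on `ψ.target`; (i) TILT: compose `ψ` with a linear automorphism `A` of `E4` sending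
`dψ_q(v)` to `e₀` for a timelike `v` at `q` (components become `G_{A⁻¹a, A⁻¹b} ∘ A⁻¹`, still analytic;
the composite stays in the maximal atlas), so that `∂₀` is timelike at `q`; (ii) BOUNDS: the tree's
`AnalyticOnNhd.exists_ball_norm_iteratedFDeriv_le` (`Literature/Analysis/Calculus/AnalyticCauchyEstimates`)
gives `‖Dᵏ G(z)‖ ≤ M Cᵏ k!` on a ball, hence the directional bounds (‖eᵢ‖ = 1); smoothness of the
components on the ball from analyticity.  WHY IT MIGHT FAIL. Only chart bookkeeping (maximal-atlas
membership of the tilted chart; `mfderiv` of `ψ.symm ∘ A⁻¹`). [cite: MullerZumHagen1970, Thm.]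
[cite: KrantzParks2002, Prop. 2.2.10] -/
theorem stub_twoVariableAnalyticitySeeds :
    mullerZumHagen1970_analytic_of_timelikeKilling →
    ∀ (𝓑 : StationaryAFBlackHole.{0}) [𝓑.metric.HasLeviCivita],
      𝓑.metric.toPseudoRiemannianMetric.IsRicciFlat → 𝓑.IsIPlusRegular →
      (∀ p : 𝓑.carrier, p ∈ 𝓑.metric.chronologicalFuture 𝓑.timeOrientation 𝓑.Mext) →
      (∀ p ∈ 𝓑.doc, 𝓑.killing p ≠ 0) → SimplyConnectedSpace 𝓑.doc →
      ∀ (U : Set 𝓑.carrier) (K : Π x : 𝓑.carrier, TangentSpace (𝓡 4) x), IsOpen U → 𝓑.horizon ⊆ U →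
      IsConnected 𝓑.horizon →
      ContMDiffOn (𝓡 4) ((𝓡 4).prod 𝓘(ℝ, E4)) ((⊤ : ℕ∞) : WithTop ℕ∞)
        (fun x ↦ (Bundle.TotalSpace.mk' E4 x (K x) : TangentBundle (𝓡 4) 𝓑.carrier)) U →
      (∀ x ∈ U, ∀ v w : TangentSpace (𝓡 4) x,
        𝓑.metric.val x (𝓑.metric.leviCivita K x v) w + 𝓑.metric.val x v (𝓑.metric.leviCivita K x w) = 0) →
      (∀ x ∈ U, VectorField.mlieBracket (𝓡 4) 𝓑.killing K x = 0) → (∀ p ∈ 𝓑.horizon, K p ≠ 0) →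
      (∀ γ : ℝ → 𝓑.carrier, IsMIntegralCurve γ K → γ 0 ∈ 𝓑.horizon → ∀ t, γ t ∈ 𝓑.horizon) →
      (∀ x ∈ U ∩ 𝓑.doc, 𝓑.metric.val x (K x) (K x) < 0) →
      (∃ S₀ : Set 𝓑.carrier, IsCompact S₀ ∧ S₀ ⊆ 𝓑.doc ∧ ∀ y ∈ 𝓑.doc,
        0 ≤ 𝓑.metric.val y (𝓑.killing y) (𝓑.killing y) → y ∉ U → y ∈ stationaryOrbit 𝓑.killing S₀) →
      (∀ S : Set 𝓑.carrier, IsCompact S → S ⊆ 𝓑.doc → ∀ (γ : ℝ → 𝓑.carrier) (s : Set ℝ),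
        IsMaximalGeodesicOn 𝓑.metric.toPseudoRiemannianMetric.leviCivita γ s → s.Nonempty →
        (∀ t ∈ s, 𝓑.metric.val (γ t) (velocity (𝓡 4) γ t) (velocity (𝓡 4) γ t) = 0 ∧
          velocity (𝓡 4) γ t ≠ 0 ∧ 𝓑.metric.val (γ t) (velocity (𝓡 4) γ t) (𝓑.killing (γ t)) = 0) →
        ∃ t ∈ s, γ t ∉ stationaryOrbit 𝓑.killing S) →
      ∀ q ∈ 𝓑.doc, (𝓑.metric.val q (𝓑.killing q) (𝓑.killing q) < 0 ∨ q ∈ U) →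
      (∃ ψ ∈ IsManifold.maximalAtlas (𝓡 4) ((⊤ : ℕ∞) : WithTop ℕ∞) 𝓑.carrier, q ∈ ψ.source ∧
        (∃ a b : ℝ, 𝓑.metric.val q
            (a • mfderiv 𝓘(ℝ, E4) (𝓡 4) ψ.symm (ψ q) (EuclideanSpace.single 0 1) +
              b • mfderiv 𝓘(ℝ, E4) (𝓡 4) ψ.symm (ψ q) (EuclideanSpace.single 1 1))
            (a • mfderiv 𝓘(ℝ, E4) (𝓡 4) ψ.symm (ψ q) (EuclideanSpace.single 0 1) +
              b • mfderiv 𝓘(ℝ, E4) (𝓡 4) ψ.symm (ψ q) (EuclideanSpace.single 1 1)) < 0) ∧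
        ∀ a b : E4, ∃ δ > (0 : ℝ), ∃ M C : ℝ, 0 ≤ M ∧ 0 ≤ C ∧ Metric.ball (ψ q) δ ⊆ ψ.target ∧
          ContDiffOn ℝ ((⊤ : ℕ∞) : WithTop ℕ∞)
            (fun p : E4 ↦ 𝓑.metric.val (ψ.symm p) (mfderiv 𝓘(ℝ, E4) (𝓡 4) ψ.symm p a) (mfderiv 𝓘(ℝ, E4) (𝓡 4) ψ.symm p b)) (Metric.ball (ψ q) δ) ∧
          ∀ z ∈ Metric.ball (ψ q) δ, ∀ (k : ℕ) (v : Fin k → E4),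
            (∀ i, v i = EuclideanSpace.single 0 1 ∨ v i = EuclideanSpace.single 1 1) →
            ‖iteratedFDeriv ℝ k
                (fun p : E4 ↦ 𝓑.metric.val (ψ.symm p) (mfderiv 𝓘(ℝ, E4) (𝓡 4) ψ.symm p a) (mfderiv 𝓘(ℝ, E4) (𝓡 4) ψ.symm p b)) z v‖ ≤ M * C ^ k * k !) :=
  Summit.FinalStateConjecture.FinalStateConjecture.Theorems.NonTrappingHawkingRigidity.AzimuthalPartialAnalyticity.stub_twoVariableAnalyticitySeeds

/-- **Stub N1b · farSeedBets — THE FAR SEED'S THREE RESIDUAL HYPOTHESES AS ONE REGISTERED STATEMENT (NEW rev 6, lead a1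
after worker N1's wave-3 `stub-misstated`; replaces the rev-5 corridor stub N1c); size: unknown — a refuter / planner target, not a
prover's.**  Under the crux's binders and a structural radial function `ρ₀` ((R1)–(R6)):
(h17) `CollarNonDegenerate 𝓑 K` — one non-zero surface gravity `∇_K K = κ K` on `𝓔⁺` (vacuum zeroth law: `κ` constant, tree def
`VacuumHorizonZerothLaw`, unproved; `κ ≠ 0`: h14 excludes extreme Kerr, but "K timelike on `U ∩ doc` ⇒ non-degenerate" is not in
print — the same bet N3 makes, Disproof (F7));
(Reach) `TimelikeReach 𝓑 ρ₀` — the `T`-timelike region leads from infinity into every sub-collar (Kerr: the axis); replaces the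
corridor; the geometric BET of the whole far-seed architecture;
(Coherence) `KillingContinuationCoherence 𝓑 U K` — no monodromy of docked axial continuations in the analytic region
`({g(T,T)<0} ∪ U) ∩ doc` (which has `π₁ = ℤ` even on Kerr; printed rigidity theorems dodge this by GLOBAL analyticity + `π₁(doc) = 0`).
All three hold on every Kerr exterior; none is visibly implied by h1–h16; each is implied by the crux + Kerr uniqueness.  If a
refuter kills (Reach) or (Coherence) the LINE dies at its far seed (the crux is untouched); if the planner prefers, (h17) and (Reach)
are natural extra hypotheses of the crux itself (release note). [cite: AlexakisIonescuKlainerman2010, Thm. 1.2]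
[cite: ChruscielCosta2008, §5] [cite: Nomizu1960, Theorem 2] -/
theorem stub_farSeedBets :
    chruscielCosta2008_docProductStructure →
    ∀ (𝓑 : StationaryAFBlackHole.{0}) [𝓑.metric.HasLeviCivita],
      𝓑.metric.toPseudoRiemannianMetric.IsRicciFlat → 𝓑.IsIPlusRegular →
      (∀ p : 𝓑.carrier, p ∈ 𝓑.metric.chronologicalFuture 𝓑.timeOrientation 𝓑.Mext) →
      (∀ p ∈ 𝓑.doc, 𝓑.killing p ≠ 0) → SimplyConnectedSpace 𝓑.doc →
      ∀ (U : Set 𝓑.carrier) (K : Π x : 𝓑.carrier, TangentSpace (𝓡 4) x), IsOpen U → 𝓑.horizon ⊆ U →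
      IsConnected 𝓑.horizon →
      ContMDiffOn (𝓡 4) ((𝓡 4).prod 𝓘(ℝ, E4)) ((⊤ : ℕ∞) : WithTop ℕ∞)
        (fun x ↦ (Bundle.TotalSpace.mk' E4 x (K x) : TangentBundle (𝓡 4) 𝓑.carrier)) U →
      (∀ x ∈ U, ∀ v w : TangentSpace (𝓡 4) x,
        𝓑.metric.val x (𝓑.metric.leviCivita K x v) w + 𝓑.metric.val x v (𝓑.metric.leviCivita K x w) = 0) →
      (∀ x ∈ U, VectorField.mlieBracket (𝓡 4) 𝓑.killing K x = 0) → (∀ p ∈ 𝓑.horizon, K p ≠ 0) →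
      (∀ γ : ℝ → 𝓑.carrier, IsMIntegralCurve γ K → γ 0 ∈ 𝓑.horizon → ∀ t, γ t ∈ 𝓑.horizon) →
      (∀ x ∈ U ∩ 𝓑.doc, 𝓑.metric.val x (K x) (K x) < 0) →
      (∃ S₀ : Set 𝓑.carrier, IsCompact S₀ ∧ S₀ ⊆ 𝓑.doc ∧ ∀ y ∈ 𝓑.doc,
        0 ≤ 𝓑.metric.val y (𝓑.killing y) (𝓑.killing y) → y ∉ U → y ∈ stationaryOrbit 𝓑.killing S₀) →
      (∀ S : Set 𝓑.carrier, IsCompact S → S ⊆ 𝓑.doc → ∀ (γ : ℝ → 𝓑.carrier) (s : Set ℝ),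
        IsMaximalGeodesicOn 𝓑.metric.toPseudoRiemannianMetric.leviCivita γ s → s.Nonempty →
        (∀ t ∈ s, 𝓑.metric.val (γ t) (velocity (𝓡 4) γ t) (velocity (𝓡 4) γ t) = 0 ∧
          velocity (𝓡 4) γ t ≠ 0 ∧ 𝓑.metric.val (γ t) (velocity (𝓡 4) γ t) (𝓑.killing (γ t)) = 0) →
        ∃ t ∈ s, γ t ∉ stationaryOrbit 𝓑.killing S) →
      ∀ ρ₀ : 𝓑.carrier → ℝ,
      (ContMDiffOn (𝓡 4) 𝓘(ℝ, ℝ) ((⊤ : ℕ∞) : WithTop ℕ∞) ρ₀ 𝓑.doc ∧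
        (∀ x ∈ 𝓑.doc, mfderiv (𝓡 4) 𝓘(ℝ, ℝ) ρ₀ x (𝓑.killing x) = 0) ∧
        (∀ x ∈ 𝓑.doc, mfderiv (𝓡 4) 𝓘(ℝ, ℝ) ρ₀ x ≠ 0) ∧
        (∀ c : ℝ, 0 < c → ∃ U' : Set 𝓑.carrier, IsOpen U' ∧ 𝓑.horizon ⊆ U' ∧
          U' ∩ 𝓑.doc = {x | x ∈ 𝓑.doc ∧ ρ₀ x < c}) ∧
        (∀ U₁ : Set 𝓑.carrier, IsOpen U₁ → 𝓑.horizon ⊆ U₁ →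
          (∀ γ : ℝ → 𝓑.carrier, IsMIntegralCurve γ 𝓑.killing → γ 0 ∈ U₁ ∩ 𝓑.doc →
            ∀ t, γ t ∈ U₁ ∩ 𝓑.doc) →
          ∃ c : ℝ, 0 < c ∧ {x | x ∈ 𝓑.doc ∧ ρ₀ x < c} ⊆ U₁) ∧
        (∀ c₀ c : ℝ, 0 < c₀ → ∃ S : Set 𝓑.carrier, IsCompact S ∧ S ⊆ 𝓑.doc ∧
          {x | x ∈ 𝓑.doc ∧ c₀ ≤ ρ₀ x ∧ ρ₀ x ≤ c} ⊆ stationaryOrbit 𝓑.killing S)) →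
      (∃ κ : ℝ, κ ≠ 0 ∧ ∀ p ∈ 𝓑.horizon, 𝓑.metric.leviCivita K p (K p) = κ • K p) ∧
      (∃ cF : ℝ, ∀ x ∈ 𝓑.doc, cF < ρ₀ x → ∀ c : ℝ, 0 < c →
        ∃ y ∈ connectedComponentIn
            {z | z ∈ 𝓑.doc ∧ 𝓑.metric.val z (𝓑.killing z) (𝓑.killing z) < 0} x, ρ₀ y < c) ∧
      (∀ (D₁ D₂ : Set 𝓑.carrier) (L₁ L₂ : Π x : 𝓑.carrier, TangentSpace (𝓡 4) x),
        IsOpen D₁ → IsConnected D₁ → IsOpen D₂ → IsConnected D₂ →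
        D₁ ⊆ {z | z ∈ 𝓑.doc ∧ (𝓑.metric.val z (𝓑.killing z) (𝓑.killing z) < 0 ∨ z ∈ U)} →
        D₂ ⊆ {z | z ∈ 𝓑.doc ∧ (𝓑.metric.val z (𝓑.killing z) (𝓑.killing z) < 0 ∨ z ∈ U)} →
        ContMDiffOn (𝓡 4) ((𝓡 4).prod 𝓘(ℝ, E4)) ((⊤ : ℕ∞) : WithTop ℕ∞)
          (fun x ↦ (Bundle.TotalSpace.mk' E4 x (L₁ x) : TangentBundle (𝓡 4) 𝓑.carrier)) D₁ →
        (∀ x ∈ D₁, ∀ v w : TangentSpace (𝓡 4) x,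
          𝓑.metric.val x (𝓑.metric.leviCivita L₁ x v) w + 𝓑.metric.val x v (𝓑.metric.leviCivita L₁ x w) = 0) →
        (∀ x ∈ D₁, VectorField.mlieBracket (𝓡 4) 𝓑.killing L₁ x = 0) →
        ContMDiffOn (𝓡 4) ((𝓡 4).prod 𝓘(ℝ, E4)) ((⊤ : ℕ∞) : WithTop ℕ∞)
          (fun x ↦ (Bundle.TotalSpace.mk' E4 x (L₂ x) : TangentBundle (𝓡 4) 𝓑.carrier)) D₂ →
        (∀ x ∈ D₂, ∀ v w : TangentSpace (𝓡 4) x,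
          𝓑.metric.val x (𝓑.metric.leviCivita L₂ x v) w + 𝓑.metric.val x v (𝓑.metric.leviCivita L₂ x w) = 0) →
        (∀ x ∈ D₂, VectorField.mlieBracket (𝓡 4) 𝓑.killing L₂ x = 0) →
        (∃ (a b : ℝ) (O : Set 𝓑.carrier), IsOpen O ∧ O.Nonempty ∧ O ⊆ D₁ ∩ U ∧
          ∀ x ∈ O, L₁ x = a • 𝓑.killing x + b • K x) →
        (∃ O' : Set 𝓑.carrier, IsOpen O' ∧ O'.Nonempty ∧ O' ⊆ D₁ ∩ D₂ ∧ ∀ x ∈ O', L₁ x = L₂ x) →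
        ∀ x ∈ D₁ ∩ D₂, L₁ x = L₂ x) := by
  sorry

/-- **Stub N1 · farAxialSeed — DICHOTOMY: NON-ROTATING COLLAR, OR THE COLLAR'S AXIAL SYMMETRY REACHES
INFINITY (the far seed of the cascade); rev 6: RESHAPED by worker N1 wave 3 — inputs the AIK near-horizon axial field and the
CC08 norm asymptotics (named facts), h17, (R7), TimelikeReach and KillingContinuationCoherence (stubs N1b / S1b₇); PROVED in the
lead folder (`work/stubs/stub_farAxialSeed.lean`, sorry-free, + 9 Literature bricks p157760–p161478), to be landed; size L.**  Under the crux's binders, given a radial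
function `ρ₀` of the d.o.c. (S1b) and the three Literature facts it may use (Müller zum Hagen analyticity,
Nomizu extension, Chruściel–Costa time function): EITHER `K = α T` on the trace of an open `U'' ⊇ 𝓔⁺`
(non-rotating: the composition then docks `K' := α • T`, Disproof (F3)), OR there are an open CONNECTED
`W ⊆ doc` containing every point of the d.o.c. outside the `T`-orbit of some compact subset of the d.o.c.
(so `W` contains a sub-collar trace AND an end `{far} × ℝ`), a local `T`-commuting Killing field `Z` on `W`,
NOT IDENTICALLY ZERO, whose flow `Φ` on `W` is complete and `2π`-PERIODIC, and an open `U'' ⊇ 𝓔⁺` with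
`U'' ∩ doc ⊆ W` on whose trace the collar field docks as `K = α T + β Z`, `β ≠ 0` (the normalisation of
Disproof (F4) is an OUTPUT).  On Kerr: `W = doc`, `Z = ±∂_φ`, `(α, β) = (1, ±Ω_H)`.
PROOF INTENDED. (1) On the `T`-invariant sub-collar `U₁ ∩ doc` of S1a the fields `T, K₁` are commuting
Killing fields and `T` acts on the compact generator sphere of `𝓔⁺`; closures of one-parameter subgroups of
the (compact) isometry group of a cross-section are tori, so some `Z := (K₁ − αT)/β` has `2π`-periodic flow
near `𝓔⁺` (AIK 2010 §1; TRIAGE-r1-1 B2, parenthetical) — this is where (F4)'s normalisation is made.  (2) On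
the collar's AXIS (fixed set of the circle action, through the poles — `χ(S²) = 2`) `T = K₁ − βZ = K₁` is
TIMELIKE (h14), so `{g(T,T) < 0} ∩ U ≠ ∅`: the pole pockets.  (3) The metric is real-analytic in harmonic
charts on `A := {g(T,T) < 0} ∩ doc` (Müller zum Hagen, VACUUM h1 — Disproof (F5) honoured here) and on
`U ∩ doc` (via `K`); continue `Z` along `A` by Nomizu (analytic, locally; single-valued on a simply connected
far region `≈ ℝ × S² × (R, ∞)`), through ONE corridor from a pole pocket to the asymptotic end; periodicity and
`[T, Z] = 0` propagate by unique continuation of isometries (`Φ_{2π} = id` on an open set ⇒ on the connected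
`W`).  (4) `W :=` sub-collar trace (`{ρ₀ < c}`, by (R5) inside the `T`-invariant sub-collar of S1a) ∪ corridor ∪ far end
(`{ρ₀ > C}`), saturated under `Φ` and `T`; the complement of `W` in the d.o.c. lies in a slab, compact mod `T` by (R6).
(0) THE BRANCH: `K − αT` (for the `α` making it tangent to a cross-section) is Killing on the connected
`T`-invariant sub-collar trace; either it vanishes there (LEFT) or it is a genuine axial field (RIGHT).
WHY IT MIGHT FAIL. The CORRIDOR: h1–h16 do not visibly forbid a belt `{g(T,T) ≥ 0} ∖ U` that caps the pole
pockets (a `T`-invariant shell `ℝ × S²` on which `T` is spacelike/null, separating `U` from infinity); then no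
path of `T`-timelike points joins the collar to the far end and (3) has nowhere to run (`Lines/Sketch.md`
W-ii: "true on Kerr-like geometries, not implied by h1–h16 in general").  Cheap test for a refuter: does
I⁺-regularity + vacuum force `{g(T,T) < 0} ∪ (U ∩ doc)` to be connected?  (Monodromy around the belt is NOT
an issue for THIS statement: only one corridor is used and nothing is claimed on the second pole route.)
[cite: AlexakisIonescuKlainerman2010, Thm. 1.1 and §1] [cite: MullerZumHagen1970, Thm.]
[cite: Nomizu1960, Theorems 1–2] [cite: ChruscielCosta2008, §4.1 and Thm. 4.5] -/
theorem stub_farAxialSeed :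
    alexakisIonescuKlainerman2010_nearHorizonAxialKilling → chruscielCosta2008_stationaryNormAtInfinity →
    mullerZumHagen1970_analytic_of_timelikeKilling → PseudoRiemannianMetric.Nomizu1960_killing_extension →
    chruscielCosta2008_equivariantTimeFunction → chruscielCosta2008_docProductStructure →
    ∀ (𝓑 : StationaryAFBlackHole.{0}) [𝓑.metric.HasLeviCivita],
      𝓑.metric.toPseudoRiemannianMetric.IsRicciFlat → 𝓑.IsIPlusRegular →
      (∀ p : 𝓑.carrier, p ∈ 𝓑.metric.chronologicalFuture 𝓑.timeOrientation 𝓑.Mext) →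
      (∀ p ∈ 𝓑.doc, 𝓑.killing p ≠ 0) → SimplyConnectedSpace 𝓑.doc →
      ∀ (U : Set 𝓑.carrier) (K : Π x : 𝓑.carrier, TangentSpace (𝓡 4) x), IsOpen U → 𝓑.horizon ⊆ U →
      IsConnected 𝓑.horizon →
      ContMDiffOn (𝓡 4) ((𝓡 4).prod 𝓘(ℝ, E4)) ((⊤ : ℕ∞) : WithTop ℕ∞)
        (fun x ↦ (Bundle.TotalSpace.mk' E4 x (K x) : TangentBundle (𝓡 4) 𝓑.carrier)) U →
      (∀ x ∈ U, ∀ v w : TangentSpace (𝓡 4) x,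
        𝓑.metric.val x (𝓑.metric.leviCivita K x v) w + 𝓑.metric.val x v (𝓑.metric.leviCivita K x w) = 0) →
      (∀ x ∈ U, VectorField.mlieBracket (𝓡 4) 𝓑.killing K x = 0) → (∀ p ∈ 𝓑.horizon, K p ≠ 0) →
      (∀ γ : ℝ → 𝓑.carrier, IsMIntegralCurve γ K → γ 0 ∈ 𝓑.horizon → ∀ t, γ t ∈ 𝓑.horizon) →
      (∀ x ∈ U ∩ 𝓑.doc, 𝓑.metric.val x (K x) (K x) < 0) →
      (∃ κ : ℝ, κ ≠ 0 ∧ ∀ p ∈ 𝓑.horizon, 𝓑.metric.leviCivita K p (K p) = κ • K p) →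
      ∀ ρ₀ : 𝓑.carrier → ℝ,
      (ContMDiffOn (𝓡 4) 𝓘(ℝ, ℝ) ((⊤ : ℕ∞) : WithTop ℕ∞) ρ₀ 𝓑.doc ∧
        (∀ x ∈ 𝓑.doc, mfderiv (𝓡 4) 𝓘(ℝ, ℝ) ρ₀ x (𝓑.killing x) = 0) ∧
        (∀ x ∈ 𝓑.doc, mfderiv (𝓡 4) 𝓘(ℝ, ℝ) ρ₀ x ≠ 0) ∧
        (∀ c : ℝ, 0 < c → ∃ U' : Set 𝓑.carrier, IsOpen U' ∧ 𝓑.horizon ⊆ U' ∧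
          U' ∩ 𝓑.doc = {x | x ∈ 𝓑.doc ∧ ρ₀ x < c}) ∧
        (∀ U₁ : Set 𝓑.carrier, IsOpen U₁ → 𝓑.horizon ⊆ U₁ →
          (∀ γ : ℝ → 𝓑.carrier, IsMIntegralCurve γ 𝓑.killing → γ 0 ∈ U₁ ∩ 𝓑.doc →
            ∀ t, γ t ∈ U₁ ∩ 𝓑.doc) →
          ∃ c : ℝ, 0 < c ∧ {x | x ∈ 𝓑.doc ∧ ρ₀ x < c} ⊆ U₁) ∧
        (∀ c₀ c : ℝ, 0 < c₀ → ∃ S : Set 𝓑.carrier, IsCompact S ∧ S ⊆ 𝓑.doc ∧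
          {x | x ∈ 𝓑.doc ∧ c₀ ≤ ρ₀ x ∧ ρ₀ x ≤ c} ⊆ stationaryOrbit 𝓑.killing S)) →
      (∀ c : ℝ, 0 < c → IsPreconnected {x | x ∈ 𝓑.doc ∧ ρ₀ x < c}) →
      (∃ cF : ℝ, ∀ x ∈ 𝓑.doc, cF < ρ₀ x → ∀ c : ℝ, 0 < c →
        ∃ y ∈ connectedComponentIn
            {z | z ∈ 𝓑.doc ∧ 𝓑.metric.val z (𝓑.killing z) (𝓑.killing z) < 0} x, ρ₀ y < c) →
      (∀ (D₁ D₂ : Set 𝓑.carrier) (L₁ L₂ : Π x : 𝓑.carrier, TangentSpace (𝓡 4) x),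
        IsOpen D₁ → IsConnected D₁ → IsOpen D₂ → IsConnected D₂ →
        D₁ ⊆ {z | z ∈ 𝓑.doc ∧ (𝓑.metric.val z (𝓑.killing z) (𝓑.killing z) < 0 ∨ z ∈ U)} →
        D₂ ⊆ {z | z ∈ 𝓑.doc ∧ (𝓑.metric.val z (𝓑.killing z) (𝓑.killing z) < 0 ∨ z ∈ U)} →
        𝓑.metric.toPseudoRiemannianMetric.IsKillingFieldOn L₁ D₁ →
        (∀ x ∈ D₁, VectorField.mlieBracket (𝓡 4) 𝓑.killing L₁ x = 0) →
        𝓑.metric.toPseudoRiemannianMetric.IsKillingFieldOn L₂ D₂ →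
        (∀ x ∈ D₂, VectorField.mlieBracket (𝓡 4) 𝓑.killing L₂ x = 0) →
        (∃ (a b : ℝ) (O : Set 𝓑.carrier), IsOpen O ∧ O.Nonempty ∧ O ⊆ D₁ ∩ U ∧
          ∀ x ∈ O, L₁ x = a • 𝓑.killing x + b • K x) →
        (∃ O' : Set 𝓑.carrier, IsOpen O' ∧ O'.Nonempty ∧ O' ⊆ D₁ ∩ D₂ ∧ ∀ x ∈ O', L₁ x = L₂ x) →
        ∀ x ∈ D₁ ∩ D₂, L₁ x = L₂ x) →
      (∃ U'' : Set 𝓑.carrier, IsOpen U'' ∧ 𝓑.horizon ⊆ U'' ∧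
        ∃ α : ℝ, ∀ x ∈ U'' ∩ 𝓑.doc, K x = α • 𝓑.killing x) ∨
      ∃ (W : Set 𝓑.carrier) (Z : Π x : 𝓑.carrier, TangentSpace (𝓡 4) x) (Φ : ℝ → 𝓑.carrier → 𝓑.carrier),
        (IsOpen W ∧ W ⊆ 𝓑.doc ∧
          (∃ S₁ : Set 𝓑.carrier, IsCompact S₁ ∧ S₁ ⊆ 𝓑.doc ∧
            ∀ x ∈ 𝓑.doc, x ∉ stationaryOrbit 𝓑.killing S₁ → x ∈ W) ∧
          (𝓑.metric.toPseudoRiemannianMetric.IsKillingFieldOn Z W ∧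
            ∀ x ∈ W, VectorField.mlieBracket (𝓡 4) 𝓑.killing Z x = 0) ∧
          (∀ x ∈ W, Φ 0 x = x ∧ (∀ s : ℝ, Φ s x ∈ W) ∧ (∀ s : ℝ, Φ (s + 2 * Real.pi) x = Φ s x) ∧
            IsMIntegralCurve (fun s ↦ Φ s x) Z)) ∧
        IsConnected W ∧ (∃ x ∈ W, Z x ≠ 0) ∧
        (∃ U'' : Set 𝓑.carrier, IsOpen U'' ∧ 𝓑.horizon ⊆ U'' ∧ U'' ∩ 𝓑.doc ⊆ W ∧
          ∃ α β : ℝ, β ≠ 0 ∧ ∀ x ∈ U'' ∩ 𝓑.doc, K x = α • 𝓑.killing x + β • Z x) :=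
  Summit.FinalStateConjecture.FinalStateConjecture.Theorems.NonTrappingHawkingRigidity.AzimuthalPartialAnalyticity.stub_farAxialSeed

/-- **Stub N2 · highAzimuthalFrequencyBound — (T1), THE HIGH-AZIMUTHAL-FREQUENCY NON-TRAPPING BOUND, scalar
interior form; NO VACUUM; size L in print / XL to formalise.**  For an `I⁺`-regular, future-presented `𝓑`
with `T ≠ 0` on the d.o.c. and no zero-energy null geodesic trapped mod `T` (h2, h3, h4, h16 ONLY), and given
the Chruściel–Costa time function (to form the quotient `doc/T ≈ S₀`): `HighFrequencyModeBound 𝓑` (§1) —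
for every smooth `T`-commuting `Ẑ` on the d.o.c. and compact `S ⊆ doc`, exact `T`-invariant `m`-mode pairs
`(u, v)` of `Ẑ` supported in the `T`-orbit of `S` obey `sup(|u| + |v|) ≤ C m^N · sup_S (|□u|, |□v|, |d□u|, |d□v|)`
for `m ≥ m₀(Ẑ, S)`.
PROOF IN PRINT (modulo the reduction).  (a) ZERO-MOMENTUM REDUCTION: `T`-invariant functions on the d.o.c. are
functions on the 3-manifold `S₀ = doc/T` (CC08 structure: `doc ≈ ℝ × S₀`, `T = ∂_t`); `□_g` descends to a
second-order operator `P` on `S₀` with REAL principal symbol `p(x, ξ) = g⁻¹(ξ̃, ξ̃)`, `ξ̃` the lift annihilating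
`T`; the integral curves of `H_p` on `T*S₀ ∖ 0` are exactly the zero-energy null geodesics of `g` modulo `T`
(symplectic reduction at momentum `ξ(T) = 0`, affine parameter preserved).  (b) REAL PRINCIPAL TYPE from h16:
a complete bicharacteristic strip staying over a compact `K ⊆ S₀` projects to a maximal zero-energy null
geodesic with `γ̇ ≠ 0` staying in the `T`-orbit of a compact lift of `K` — excluded by h16; this INCLUDES the
radial/fixed points of `H_p` (they sit over ergosurface points with `d g(T,T) ∥ T♭`, where the `T`-orbit itself
is such a geodesic: module docstring, finding 1).  (c) Hörmander, ALPDO IV Thm. 26.1.7: for `u ∈ 𝓔'(K)`,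
`‖u‖₍ₛ₎ ≤ C_K(‖Pu‖₍ₛ₋₁₎ + ‖u‖₍ₛ₋₁₎)`.  (d) ABSORPTION for exact mode pairs (`u = m⁻¹ Ẑv`, `v = −m⁻¹ Ẑu`):
`‖(u,v)‖₍ₛ₋₁₎ ≤ (C_Ẑ/m)‖(u,v)‖₍ₛ₎`, so for `m ≥ 2 C_K C_Ẑ`: `‖(u,v)‖₍ₛ₎ ≤ 2C_K ‖(Pu,Pv)‖₍ₛ₋₁₎` — SHARP, no
loss.  (e) `s = 2`, Sobolev `H² ⊂ C⁰` on a fundamental piece and `‖Pu‖_{H¹} ≲ sup_S(|Pu| + |dPu|)` give the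
registered sup form with `N = 0`.  The same proof covers `P + ` (first-order `T`-invariant terms) and square
systems with diagonal principal part (Dencker / Taylor), which is the form N3 consumes; uniformity of `C_K`
under `C^∞`-convergent backgrounds with uniformly non-trapped flow is part of N3's burden, not of this stub.
Kit evidence (card): Kerr `a = 0.9`, `s(m)/m = 17.6 → 8.7` (linear law) vs. bounded with resonance dips under
a trapped deformation (j021196/j021219).
WHY IT MIGHT FAIL. Only in the dictionary (a)–(b): maximality/completeness conventions between affine null
geodesics on open order-connected domains (`IsMaximalGeodesicOn`) and Hörmander's "complete bicharacteristic
strip" (cosphere-bundle flow); a zero-energy null geodesic incomplete INSIDE a compact-mod-`T` region is still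
excluded by h16 as typed (any maximal domain `s`).  A refuter kills the FEED (not the crux) with a smooth
stationary metric satisfying h2–h4, h16 and a sequence of compactly-supported-mod-`T` exact mode pairs with
`‖□u_j‖_{C¹} / ‖u_j‖_∞ → 0`, `m_j → ∞` (TRIAGE-r1-1 "attack T1 first") — by (c)–(d) none exists.
[cite: Hormander2009ALPDO4, Thm. 26.1.7 and Def. 26.1.8] [cite: ChruscielCosta2008, Thm. 4.5]
[cite: IonescuKlainerman2015, §4] [cite: Vasy2013, §2] -/
theorem stub_highAzimuthalFrequencyBound :
    chruscielCosta2008_equivariantTimeFunction →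
    ∀ (𝓑 : StationaryAFBlackHole.{0}) [𝓑.metric.HasLeviCivita],
      𝓑.IsIPlusRegular →
      (∀ p : 𝓑.carrier, p ∈ 𝓑.metric.chronologicalFuture 𝓑.timeOrientation 𝓑.Mext) →
      (∀ p ∈ 𝓑.doc, 𝓑.killing p ≠ 0) →
      (∀ S : Set 𝓑.carrier, IsCompact S → S ⊆ 𝓑.doc → ∀ (γ : ℝ → 𝓑.carrier) (s : Set ℝ),
        IsMaximalGeodesicOn 𝓑.metric.toPseudoRiemannianMetric.leviCivita γ s → s.Nonempty →
        (∀ t ∈ s, 𝓑.metric.val (γ t) (velocity (𝓡 4) γ t) (velocity (𝓡 4) γ t) = 0 ∧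
          velocity (𝓡 4) γ t ≠ 0 ∧ 𝓑.metric.val (γ t) (velocity (𝓡 4) γ t) (𝓑.killing (γ t)) = 0) →
        ∃ t ∈ s, γ t ∉ stationaryOrbit 𝓑.killing S) →
      (∀ (Zhat : Π x : 𝓑.carrier, TangentSpace (𝓡 4) x) (S : Set 𝓑.carrier),
        ContMDiffOn (𝓡 4) ((𝓡 4).prod 𝓘(ℝ, E4)) ((⊤ : ℕ∞) : WithTop ℕ∞)
          (fun x ↦ (Bundle.TotalSpace.mk' E4 x (Zhat x) : TangentBundle (𝓡 4) 𝓑.carrier)) 𝓑.doc →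
        (∀ x ∈ 𝓑.doc, VectorField.mlieBracket (𝓡 4) 𝓑.killing Zhat x = 0) →
        IsCompact S → S ⊆ 𝓑.doc →
        ∃ (m₀ : ℕ) (C : ℝ) (N : ℕ), ∀ m : ℕ, m₀ ≤ m → ∀ u v : 𝓑.carrier → ℝ,
          ContMDiffOn (𝓡 4) 𝓘(ℝ, ℝ) ((⊤ : ℕ∞) : WithTop ℕ∞) u 𝓑.doc →
          ContMDiffOn (𝓡 4) 𝓘(ℝ, ℝ) ((⊤ : ℕ∞) : WithTop ℕ∞) v 𝓑.doc →
          (∀ x ∈ 𝓑.doc, mfderiv (𝓡 4) 𝓘(ℝ, ℝ) u x (𝓑.killing x) = 0 ∧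
            mfderiv (𝓡 4) 𝓘(ℝ, ℝ) v x (𝓑.killing x) = 0) →
          (∀ x ∈ 𝓑.doc, mfderiv (𝓡 4) 𝓘(ℝ, ℝ) u x (Zhat x) = -((m : ℝ) * v x) ∧
            mfderiv (𝓡 4) 𝓘(ℝ, ℝ) v x (Zhat x) = (m : ℝ) * u x) →
          (∀ x ∈ 𝓑.doc, x ∉ stationaryOrbit 𝓑.killing S → u x = 0 ∧ v x = 0) →
          ∀ B : ℝ, 0 ≤ B →
          (∀ y ∈ S, |𝓑.metric.dalembertian u y| ≤ B ∧ |𝓑.metric.dalembertian v y| ≤ B ∧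
            ∀ w : E4, |(show ℝ from mfderiv (𝓡 4) 𝓘(ℝ, ℝ) (𝓑.metric.dalembertian u) y w)| ≤ B * ‖w‖ ∧
              |(show ℝ from mfderiv (𝓡 4) 𝓘(ℝ, ℝ) (𝓑.metric.dalembertian v) y w)| ≤ B * ‖w‖) →
          ∀ x ∈ 𝓑.doc, |u x| + |v x| ≤ C * (m : ℝ) ^ N * B) := by
  sorry

/-- **Stub N3a · commutingKillingFlowBox — TWO COMMUTING KILLING FIELDS WITH TIMELIKE SPAN GIVE TWO-VARIABLE
ANALYTICITY (NEW, rev 2, lead a1; the soft last step (vi) of the cascade split off N3); size M–L; differential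
topology, provable with the tree's infrastructure.**  For every `𝓑` (no telescope hypothesis is needed: `T` is a
global smooth Killing field of every `StationaryAFBlackHole`), every open `O`, every vector field `Y` smooth and
Killing on `O` with `[T, Y] = 0` on `O`, and every `q ∈ O` at which `T q, Y q` are linearly independent and span a
plane containing a timelike vector: `TwoVariableAnalyticAt 𝓑 q` (inlined) — a chart `ψ` of the maximal `C^∞` atlas
around `q` with `span{∂₀, ∂₁}` timelike at `q` and, pair by pair, `C^∞` components obeying
`‖Dᵏ G_{ab}(z)(v)‖ ≤ M Cᵏ k!` for `vᵢ ∈ {𝐞₀, 𝐞₁}` on a coordinate ball inside `ψ.target`.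
PROOF INTENDED. (1) JOINT FLOW BOX (Lee 2012, Thm. 9.46, canonical form for commuting vector fields, `k = 2`):
a chart `ψ ∈ maximalAtlas` about `q` with `d(ψ⁻¹)_{p} 𝐞₀ = T (ψ⁻¹ p)` and `d(ψ⁻¹)_p 𝐞₁ = Y (ψ⁻¹ p)` on
`ψ.target` — built exactly as the tree's one-field box `Literature.Geometry.Manifold.exists_chart_mfderiv_eq_const`
(`FlowBox.lean`: `Λ q = Fl_{ℓ(q−x₀)}(x₀ + P(q − x₀))`, inverse function theorem), now with
`Λ u = Fl^T_{ℓ₀(u−x₀)} (Fl^Y_{ℓ₁(u−x₀)} (x₀ + P(u − x₀)))`, `P` the projection onto a complement of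
`span{T x₀, Y x₀}`; `DΛ_{x₀} = id`; `DΛ_u 𝐞₀ = T(Λ u)` (flow property) and `DΛ_u 𝐞₁ = Y(Λ u)` because the
flow of `T` preserves `Y` (`[T, Y] = 0`: `Literature/Geometry/Lorentzian/CommutingFlowLocal.lean`,
`mfderiv_flow_apply_eq_of_forall_mem`; local `C^∞` flows: `Literature.Analysis.ODE.exists_contDiffOn_flow`,
global flow of `T`: `StationaryAFBlackHole.exists_stationary_flow` / `IsStationaryKilling.contMDiff_flow`).
This step is a Literature theorem of its own (`Literature/Geometry/Manifold/CommutingFlowBox.lean`, to be landed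
by the worker as a helper; no named fact).  (2) COMPONENTS CONSTANT IN `(x⁰, x¹)`: Killing's equation for a
coordinate field gives `∂₀ G_{ab} = ∂₁ G_{ab} = 0` on `ψ.target`
(`PseudoRiemannianMetric.hasDerivAt_val_coordVector_of_killing_at`, `KillingComovingChart.lean` — the lemma
behind `StationaryAFBlackHole.exists_comovingChart`).  (3) BOUNDS: on a ball in the (open) target the
components are `C^∞` (chart metric of a smooth metric in a maximal-atlas chart); every iterated derivative of
order `k ≥ 1` in directions from `{𝐞₀, 𝐞₁}` vanishes (`iteratedFDeriv_succ_apply_right` + the vanishing of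
`p ↦ DG(p) 𝐞ᵢ` on the open ball), and order `0` is bounded by continuity on a smaller closed ball: take
`C = 0`, `M = 1 + sup |G_{ab}|`.  (4) TIMELIKE PLANE: `∂₀|_q = T q`, `∂₁|_q = Y q`.  WHY IT MIGHT FAIL. Only
bookkeeping (maximal-atlas membership of `ψ = Λ⁻¹ ∘ φ`, `mfderiv` of compositions, the `Fin k → E4` directional
form of `iteratedFDeriv`); the mathematics is textbook.  USED BY N3 at belt points of the far seed's domain `W`
where `span{T, Z}` is timelike (on Kerr: every belt point — `det g|_{span{∂_t,∂_φ}} = −Δ sin²θ < 0` off the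
axis outside `𝓗⁺`, and the closed ergoregion meets the axis only on `𝓗⁺`).
[cite: LeeSmoothManifolds2013, Thm. 9.46] [cite: ONeill1983, Ch. 9, Prop. 9.25] [cite: KrantzParks2002, Prop. 2.2.10] -/
theorem stub_commutingKillingFlowBox :
    ∀ (𝓑 : StationaryAFBlackHole.{0}) [𝓑.metric.HasLeviCivita],
      ∀ (O : Set 𝓑.carrier) (Y : Π x : 𝓑.carrier, TangentSpace (𝓡 4) x), IsOpen O →
      (ContMDiffOn (𝓡 4) ((𝓡 4).prod 𝓘(ℝ, E4)) ((⊤ : ℕ∞) : WithTop ℕ∞)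
          (fun x ↦ (Bundle.TotalSpace.mk' E4 x (Y x) : TangentBundle (𝓡 4) 𝓑.carrier)) O ∧
        (∀ x ∈ O, ∀ v w : TangentSpace (𝓡 4) x,
          𝓑.metric.val x (𝓑.metric.leviCivita Y x v) w + 𝓑.metric.val x v (𝓑.metric.leviCivita Y x w) = 0) ∧
        ∀ x ∈ O, VectorField.mlieBracket (𝓡 4) 𝓑.killing Y x = 0) →
      ∀ q ∈ O, (∀ a b : ℝ, a • 𝓑.killing q + b • Y q = 0 → a = 0 ∧ b = 0) →
      (∃ a b : ℝ, 𝓑.metric.val q (a • 𝓑.killing q + b • Y q) (a • 𝓑.killing q + b • Y q) < 0) →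
      (∃ ψ ∈ IsManifold.maximalAtlas (𝓡 4) ((⊤ : ℕ∞) : WithTop ℕ∞) 𝓑.carrier, q ∈ ψ.source ∧
        (∃ a b : ℝ, 𝓑.metric.val q
            (a • mfderiv 𝓘(ℝ, E4) (𝓡 4) ψ.symm (ψ q) (EuclideanSpace.single 0 1) +
              b • mfderiv 𝓘(ℝ, E4) (𝓡 4) ψ.symm (ψ q) (EuclideanSpace.single 1 1))
            (a • mfderiv 𝓘(ℝ, E4) (𝓡 4) ψ.symm (ψ q) (EuclideanSpace.single 0 1) +
              b • mfderiv 𝓘(ℝ, E4) (𝓡 4) ψ.symm (ψ q) (EuclideanSpace.single 1 1)) < 0) ∧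
        ∀ a b : E4, ∃ δ > (0 : ℝ), ∃ M C : ℝ, 0 ≤ M ∧ 0 ≤ C ∧ Metric.ball (ψ q) δ ⊆ ψ.target ∧
          ContDiffOn ℝ ((⊤ : ℕ∞) : WithTop ℕ∞)
            (fun p : E4 ↦ 𝓑.metric.val (ψ.symm p) (mfderiv 𝓘(ℝ, E4) (𝓡 4) ψ.symm p a) (mfderiv 𝓘(ℝ, E4) (𝓡 4) ψ.symm p b)) (Metric.ball (ψ q) δ) ∧
          ∀ z ∈ Metric.ball (ψ q) δ, ∀ (k : ℕ) (v : Fin k → E4),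
            (∀ i, v i = EuclideanSpace.single 0 1 ∨ v i = EuclideanSpace.single 1 1) →
            ‖iteratedFDeriv ℝ k
                (fun p : E4 ↦ 𝓑.metric.val (ψ.symm p) (mfderiv 𝓘(ℝ, E4) (𝓡 4) ψ.symm p a) (mfderiv 𝓘(ℝ, E4) (𝓡 4) ψ.symm p b)) z v‖ ≤ M * C ^ k * k !) :=
  Summit.FinalStateConjecture.FinalStateConjecture.Theorems.NonTrappingHawkingRigidity.AzimuthalPartialAnalyticity.stub_commutingKillingFlowBox

/-- **Stub N3 · azimuthalCascade — THE ENGINE C⁺ FED (replaces rev-4 S4b; rev 2: consumes N3a's flow-box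
analyticity as an extra input); size XL; new mathematics; the
hardest stub.**  Under the crux's binders, GIVEN a structural radial function `ρ₀` (S1b), a GENUINE FAR AXIAL
SEED `(W, Z, Φ)` (N1's rotating branch: `Z` a local `T`-commuting Killing field, not identically zero, with
complete `2π`-periodic flow on an open connected `W ⊆ doc` containing everything outside the `T`-orbit of a
compact set, docked to the collar field as `K = αT + βZ`, `β ≠ 0`, near `𝓔⁺`) and the HIGH-FREQUENCY BOUND
(N2's output, `HighFrequencyModeBound 𝓑`): there is a radial function `ρ` of the d.o.c. ((R1)–(R6)) whose gradient
is SPACELIKE at every point of the closed ergoregion `{g(T,T) ≥ 0} ∩ doc` (its levels are `T`-invariant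
TIMELIKE — non-characteristic — hypersurfaces there) and such that the metric is TWO-VARIABLE ANALYTIC
(`TwoVariableAnalyticAt`, §1: a chart of the maximal atlas with a timelike coordinate 2-plane in whose two
directions the components obey uniform Cauchy bounds) at every BELT point `q ∈ doc`, `g(T,T)(q) ≥ 0`, `q ∉ U`.
(Points of `U` and `T`-timelike points are S4a's, landed.)  The conclusion is EXISTENTIAL in `ρ` on purpose
(module docstring, finding 2: any ∀-frame version is refuted on Kerr by pure-gauge images, TRIAGE-r1-1 B1).
PROOF INTENDED (the card's mechanism, with the triage sharpenings and findings 1–3 of the module docstring).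
(i) CANONICAL RADIAL GAUGE (G1′): `ρ := F(scalar invariants of (g, T))`, analytic `F` — e.g. the Ernst pair
`𝓔_T = −g(T,T) + iω_T` (twist potential: `dω = ⋆(T♭ ∧ dT♭)` is closed in vacuum and exact on the simply
connected d.o.c., h5 — the one place h5 is used), on Kerr `r − ia cos θ = 2M/(1 − 𝓔_T)` EXACTLY —; `ρ` is then
invariant under EVERY local `T`-commuting Killing field (under `K` on `U`: spacelike gradient at closed-ergoregion
points of `U` by h14 + O'Neill 5.26; under `Z` on `W`); `X := ∇ρ/|∇ρ|²` (canonical; needs `dρ` non-null on the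
slab — part of (G1′)); `Ẑ := Θ^X_* Z`, the transport of the far seed INWARD along `X` from a level `Σ_top ⊆ W`
above the closed ergoregion (h15 + far seed): `[X, Ẑ] = 0`, `Ẑρ = 0`, `[T, Ẑ] = 0`, `e^{sẐ} = Θ_u e^{sZ} Θ_u⁻¹`
`2π`-periodic (flow of a vector field: no caustics), `Ẑ = Z` Killing upstream (all `Ẑ`-Fourier modes `m ≠ 0`
of `g` vanish EXACTLY above `Σ_top`), and the `m ≠ 0` modes live on the slab from `Σ_top` down THROUGH `𝓗⁺`
(finding 3; `X` is singular at `𝓗⁺` like Boyer–Lindquist `∂_r`, but `Ẑ` is `(T, K)`-invariant near `𝓗⁺` and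
extends; the analysis near `𝓗⁺` is done in regular coordinates).  (ii) SYSTEM: the Ionescu–Klainerman
variables `π := 𝓛_Ẑ g`, `P`, `W := 𝓛_Ẑ Riem (− B ⊙ Riem)` satisfy in vacuum a CLOSED wave–transport system
`□_g W = 𝓜₀(W, P, π)`, `∇_X(π, P) = 𝓜₁(W, P, π)` with ZEROTH-ORDER couplings (IK 2013 §2 / AIK 2010 §2, there
for a geodesic transversal; for the canonical non-geodesic `X` extra zeroth-order terms) — transport data ZERO
at `Σ_top`.  (iii) ESTIMATE: the `Φ`-Fourier pieces at frequency `λ` (exact mode pairs in a `T`-, `Φ`-invariant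
frame) obey the SHARP bound of N2 in system form (diagonal principal part `□_{g<λ/16}`, Hörmander 26.1.7 /
Dencker), uniform over the truncated backgrounds `g_{<λ/16} → g` (non-trapping with bounded escape time is
`C¹`-open; constants from an escape-function proof), with the horizon end treated WITHOUT boundary condition by
regularity across the non-degenerate `𝓗⁺` (Vasy 2013-type radial estimates at the generators' conormal;
threshold `s > 1/2` at `T`-frequency `0`, effective `K`-frequency `λβ ≠ 0`; `κ ≠ 0` from h14, Disproof (F7));
transport along `X`-lines by Grönwall (zero data upstream).  (iv) BOOKKEEPING (W7′, TRIAGE-r1-1 B3): in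
`□_g − □_{g<λ/16}` the high-coefficient × low-unknown terms are LINEAR in the frequency-`λ` unknowns with
coefficient `O(1/λ)` (`ĝ_λ = π̂_λ/(iλ)`, `R̂_λ = Ŵ_λ/(iλ)` since `Ẑ = ∂_φ̃` on components; the lapse `|∇ρ|⁻¹`
and `X` are slaved to `g` because `ρ` is canonical), absorbable ONLY because (iii) is sharp; high × high terms
are the quadratic source.  (v) CLOSURE: `a(λ) ≤ C λ^N sup_{μ ∈ [λ/16, λ/2]} a(μ) a(λ − μ)` bootstraps the
smooth tail to `a(λ) ≲ λ^{−N−2} e^{−cλ}` (`Lines/Sketch-dead.md` §3, checked arithmetic: no condition on the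
loss `N`).  (vi) CHART (G4 + flow box): at a belt point `q ∉ U`, `span{T, Ẑ}(q)` is TIMELIKE (G4; on the known
side `ρ² = −det g(Kᵢ, Kⱼ) > 0` off the axis, CC08 §4; the belt misses the axis since the ergosurface meets it
only on `𝓗⁺`), the joint flow box of the commuting `T, Ẑ` completed by `(ρ, y)` is a chart of the maximal
atlas in which `G_ab(t, s, y) = ((Φ_s)^* g)_y`, and exponential decay of the modes is the Cauchy bound in `s`
(Krantz–Parks 2.2.10) — `TwoVariableAnalyticAt 𝓑 q`; `dρ_q` annihilates the timelike plane, hence is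
spacelike (O'Neill 5.26).  (vii) Near `𝓗⁺` and near infinity `ρ` keeps (R4)–(R6) by comparison with `ρ₀`.
WHY IT MIGHT FAIL. (G1′) the canonical `ρ` may have critical points or a NULL level direction somewhere on an
unknown belt (codimension-one condition: not generic-free), and (G4) the transported `Ẑ` may go null-span with
`T` inside the hair — both are "Kerr-like structure" bets, refutable by a single smooth stationary (non-vacuum)
belt with Γ₀ = ∅ and no `T`-invariant function with timelike levels (the `disprover-wanted` of `Lines/Sketch.md`);
(ii) the zeroth-order closure of the IK system for a NON-geodesic transversal is unprinted; (iii) uniformity over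
truncations and the horizon end at azimuthal (not temporal) high frequency are unprinted (Vasy's framework is
for `ω → ∞`; here `ω = 0`, `m → ∞`, same zero-energy flow); degenerate horizons are excluded only through h14.
What does NOT threaten it any more: the residual "glancing" set (empty: two analytic variables), radial points
in the belt (finding 1), the derivative count of the closure (Sketch-dead §3), the pure-gauge orbit (finding 2).
[cite: IonescuKlainerman2012, §2 and Thm. 1.2] [cite: AlexakisIonescuKlainerman2010, §2 and Lemma A.3]
[cite: Hormander2009ALPDO4, Thm. 26.1.7] [cite: Vasy2013, §2 and §6] [cite: ChruscielCosta2008, §4]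
[cite: KrantzParks2002, Prop. 2.2.10] [cite: ONeill1983, Ch. 5, Lemma 5.26] [cite: IonescuKlainerman2015, §4] -/
theorem stub_azimuthalCascade :
    chruscielCosta2008_equivariantTimeFunction → mullerZumHagen1970_analytic_of_timelikeKilling →
    chruscielCosta2008_docProductStructure →
    ∀ (𝓑 : StationaryAFBlackHole.{0}) [𝓑.metric.HasLeviCivita],
      𝓑.metric.toPseudoRiemannianMetric.IsRicciFlat → 𝓑.IsIPlusRegular →
      (∀ p : 𝓑.carrier, p ∈ 𝓑.metric.chronologicalFuture 𝓑.timeOrientation 𝓑.Mext) →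
      (∀ p ∈ 𝓑.doc, 𝓑.killing p ≠ 0) → SimplyConnectedSpace 𝓑.doc →
      ∀ (U : Set 𝓑.carrier) (K : Π x : 𝓑.carrier, TangentSpace (𝓡 4) x), IsOpen U → 𝓑.horizon ⊆ U →
      IsConnected 𝓑.horizon →
      ContMDiffOn (𝓡 4) ((𝓡 4).prod 𝓘(ℝ, E4)) ((⊤ : ℕ∞) : WithTop ℕ∞)
        (fun x ↦ (Bundle.TotalSpace.mk' E4 x (K x) : TangentBundle (𝓡 4) 𝓑.carrier)) U →
      (∀ x ∈ U, ∀ v w : TangentSpace (𝓡 4) x,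
        𝓑.metric.val x (𝓑.metric.leviCivita K x v) w + 𝓑.metric.val x v (𝓑.metric.leviCivita K x w) = 0) →
      (∀ x ∈ U, VectorField.mlieBracket (𝓡 4) 𝓑.killing K x = 0) → (∀ p ∈ 𝓑.horizon, K p ≠ 0) →
      (∀ γ : ℝ → 𝓑.carrier, IsMIntegralCurve γ K → γ 0 ∈ 𝓑.horizon → ∀ t, γ t ∈ 𝓑.horizon) →
      (∀ x ∈ U ∩ 𝓑.doc, 𝓑.metric.val x (K x) (K x) < 0) →
      (∃ S₀ : Set 𝓑.carrier, IsCompact S₀ ∧ S₀ ⊆ 𝓑.doc ∧ ∀ y ∈ 𝓑.doc,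
        0 ≤ 𝓑.metric.val y (𝓑.killing y) (𝓑.killing y) → y ∉ U → y ∈ stationaryOrbit 𝓑.killing S₀) →
      (∀ S : Set 𝓑.carrier, IsCompact S → S ⊆ 𝓑.doc → ∀ (γ : ℝ → 𝓑.carrier) (s : Set ℝ),
        IsMaximalGeodesicOn 𝓑.metric.toPseudoRiemannianMetric.leviCivita γ s → s.Nonempty →
        (∀ t ∈ s, 𝓑.metric.val (γ t) (velocity (𝓡 4) γ t) (velocity (𝓡 4) γ t) = 0 ∧
          velocity (𝓡 4) γ t ≠ 0 ∧ 𝓑.metric.val (γ t) (velocity (𝓡 4) γ t) (𝓑.killing (γ t)) = 0) →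
        ∃ t ∈ s, γ t ∉ stationaryOrbit 𝓑.killing S) →
      ∀ ρ₀ : 𝓑.carrier → ℝ,
      (ContMDiffOn (𝓡 4) 𝓘(ℝ, ℝ) ((⊤ : ℕ∞) : WithTop ℕ∞) ρ₀ 𝓑.doc ∧
        (∀ x ∈ 𝓑.doc, mfderiv (𝓡 4) 𝓘(ℝ, ℝ) ρ₀ x (𝓑.killing x) = 0) ∧
        (∀ x ∈ 𝓑.doc, mfderiv (𝓡 4) 𝓘(ℝ, ℝ) ρ₀ x ≠ 0) ∧
        (∀ c : ℝ, 0 < c → ∃ U' : Set 𝓑.carrier, IsOpen U' ∧ 𝓑.horizon ⊆ U' ∧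
          U' ∩ 𝓑.doc = {x | x ∈ 𝓑.doc ∧ ρ₀ x < c}) ∧
        (∀ U₁ : Set 𝓑.carrier, IsOpen U₁ → 𝓑.horizon ⊆ U₁ →
          (∀ γ : ℝ → 𝓑.carrier, IsMIntegralCurve γ 𝓑.killing → γ 0 ∈ U₁ ∩ 𝓑.doc →
            ∀ t, γ t ∈ U₁ ∩ 𝓑.doc) →
          ∃ c : ℝ, 0 < c ∧ {x | x ∈ 𝓑.doc ∧ ρ₀ x < c} ⊆ U₁) ∧
        (∀ c₀ c : ℝ, 0 < c₀ → ∃ S : Set 𝓑.carrier, IsCompact S ∧ S ⊆ 𝓑.doc ∧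
          {x | x ∈ 𝓑.doc ∧ c₀ ≤ ρ₀ x ∧ ρ₀ x ≤ c} ⊆ stationaryOrbit 𝓑.killing S)) →
      ∀ (W : Set 𝓑.carrier) (Z : Π x : 𝓑.carrier, TangentSpace (𝓡 4) x) (Φ : ℝ → 𝓑.carrier → 𝓑.carrier),
      (IsOpen W ∧ W ⊆ 𝓑.doc ∧
        (∃ S₁ : Set 𝓑.carrier, IsCompact S₁ ∧ S₁ ⊆ 𝓑.doc ∧
          ∀ x ∈ 𝓑.doc, x ∉ stationaryOrbit 𝓑.killing S₁ → x ∈ W) ∧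
        (ContMDiffOn (𝓡 4) ((𝓡 4).prod 𝓘(ℝ, E4)) ((⊤ : ℕ∞) : WithTop ℕ∞)
            (fun x ↦ (Bundle.TotalSpace.mk' E4 x (Z x) : TangentBundle (𝓡 4) 𝓑.carrier)) W ∧
          (∀ x ∈ W, ∀ v w : TangentSpace (𝓡 4) x,
            𝓑.metric.val x (𝓑.metric.leviCivita Z x v) w + 𝓑.metric.val x v (𝓑.metric.leviCivita Z x w) = 0) ∧
          ∀ x ∈ W, VectorField.mlieBracket (𝓡 4) 𝓑.killing Z x = 0) ∧
        (∀ x ∈ W, Φ 0 x = x ∧ (∀ s : ℝ, Φ s x ∈ W) ∧ (∀ s : ℝ, Φ (s + 2 * Real.pi) x = Φ s x) ∧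
          IsMIntegralCurve (fun s ↦ Φ s x) Z)) →
      IsConnected W → (∃ x ∈ W, Z x ≠ 0) →
      (∃ U'' : Set 𝓑.carrier, IsOpen U'' ∧ 𝓑.horizon ⊆ U'' ∧ U'' ∩ 𝓑.doc ⊆ W ∧
        ∃ α β : ℝ, β ≠ 0 ∧ ∀ x ∈ U'' ∩ 𝓑.doc, K x = α • 𝓑.killing x + β • Z x) →
      (∀ (Zhat : Π x : 𝓑.carrier, TangentSpace (𝓡 4) x) (S : Set 𝓑.carrier),
        ContMDiffOn (𝓡 4) ((𝓡 4).prod 𝓘(ℝ, E4)) ((⊤ : ℕ∞) : WithTop ℕ∞)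
          (fun x ↦ (Bundle.TotalSpace.mk' E4 x (Zhat x) : TangentBundle (𝓡 4) 𝓑.carrier)) 𝓑.doc →
        (∀ x ∈ 𝓑.doc, VectorField.mlieBracket (𝓡 4) 𝓑.killing Zhat x = 0) →
        IsCompact S → S ⊆ 𝓑.doc →
        ∃ (m₀ : ℕ) (C : ℝ) (N : ℕ), ∀ m : ℕ, m₀ ≤ m → ∀ u v : 𝓑.carrier → ℝ,
          ContMDiffOn (𝓡 4) 𝓘(ℝ, ℝ) ((⊤ : ℕ∞) : WithTop ℕ∞) u 𝓑.doc →
          ContMDiffOn (𝓡 4) 𝓘(ℝ, ℝ) ((⊤ : ℕ∞) : WithTop ℕ∞) v 𝓑.doc →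
          (∀ x ∈ 𝓑.doc, mfderiv (𝓡 4) 𝓘(ℝ, ℝ) u x (𝓑.killing x) = 0 ∧
            mfderiv (𝓡 4) 𝓘(ℝ, ℝ) v x (𝓑.killing x) = 0) →
          (∀ x ∈ 𝓑.doc, mfderiv (𝓡 4) 𝓘(ℝ, ℝ) u x (Zhat x) = -((m : ℝ) * v x) ∧
            mfderiv (𝓡 4) 𝓘(ℝ, ℝ) v x (Zhat x) = (m : ℝ) * u x) →
          (∀ x ∈ 𝓑.doc, x ∉ stationaryOrbit 𝓑.killing S → u x = 0 ∧ v x = 0) →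
          ∀ B : ℝ, 0 ≤ B →
          (∀ y ∈ S, |𝓑.metric.dalembertian u y| ≤ B ∧ |𝓑.metric.dalembertian v y| ≤ B ∧
            ∀ w : E4, |(show ℝ from mfderiv (𝓡 4) 𝓘(ℝ, ℝ) (𝓑.metric.dalembertian u) y w)| ≤ B * ‖w‖ ∧
              |(show ℝ from mfderiv (𝓡 4) 𝓘(ℝ, ℝ) (𝓑.metric.dalembertian v) y w)| ≤ B * ‖w‖) →
          ∀ x ∈ 𝓑.doc, |u x| + |v x| ≤ C * (m : ℝ) ^ N * B) →
      (∀ (O : Set 𝓑.carrier) (Y : Π x : 𝓑.carrier, TangentSpace (𝓡 4) x), IsOpen O →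
        (ContMDiffOn (𝓡 4) ((𝓡 4).prod 𝓘(ℝ, E4)) ((⊤ : ℕ∞) : WithTop ℕ∞)
            (fun x ↦ (Bundle.TotalSpace.mk' E4 x (Y x) : TangentBundle (𝓡 4) 𝓑.carrier)) O ∧
          (∀ x ∈ O, ∀ v w : TangentSpace (𝓡 4) x,
            𝓑.metric.val x (𝓑.metric.leviCivita Y x v) w + 𝓑.metric.val x v (𝓑.metric.leviCivita Y x w) = 0) ∧
          ∀ x ∈ O, VectorField.mlieBracket (𝓡 4) 𝓑.killing Y x = 0) →
        ∀ q ∈ O, (∀ a b : ℝ, a • 𝓑.killing q + b • Y q = 0 → a = 0 ∧ b = 0) →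
        (∃ a b : ℝ, 𝓑.metric.val q (a • 𝓑.killing q + b • Y q) (a • 𝓑.killing q + b • Y q) < 0) →
        (∃ ψ ∈ IsManifold.maximalAtlas (𝓡 4) ((⊤ : ℕ∞) : WithTop ℕ∞) 𝓑.carrier, q ∈ ψ.source ∧
          (∃ a b : ℝ, 𝓑.metric.val q
              (a • mfderiv 𝓘(ℝ, E4) (𝓡 4) ψ.symm (ψ q) (EuclideanSpace.single 0 1) +
                b • mfderiv 𝓘(ℝ, E4) (𝓡 4) ψ.symm (ψ q) (EuclideanSpace.single 1 1))
              (a • mfderiv 𝓘(ℝ, E4) (𝓡 4) ψ.symm (ψ q) (EuclideanSpace.single 0 1) +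
                b • mfderiv 𝓘(ℝ, E4) (𝓡 4) ψ.symm (ψ q) (EuclideanSpace.single 1 1)) < 0) ∧
          ∀ a b : E4, ∃ δ > (0 : ℝ), ∃ M C : ℝ, 0 ≤ M ∧ 0 ≤ C ∧ Metric.ball (ψ q) δ ⊆ ψ.target ∧
            ContDiffOn ℝ ((⊤ : ℕ∞) : WithTop ℕ∞)
              (fun p : E4 ↦ 𝓑.metric.val (ψ.symm p) (mfderiv 𝓘(ℝ, E4) (𝓡 4) ψ.symm p a) (mfderiv 𝓘(ℝ, E4) (𝓡 4) ψ.symm p b)) (Metric.ball (ψ q) δ) ∧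
            ∀ z ∈ Metric.ball (ψ q) δ, ∀ (k : ℕ) (v : Fin k → E4),
              (∀ i, v i = EuclideanSpace.single 0 1 ∨ v i = EuclideanSpace.single 1 1) →
              ‖iteratedFDeriv ℝ k
                  (fun p : E4 ↦ 𝓑.metric.val (ψ.symm p) (mfderiv 𝓘(ℝ, E4) (𝓡 4) ψ.symm p a) (mfderiv 𝓘(ℝ, E4) (𝓡 4) ψ.symm p b)) z v‖ ≤ M * C ^ k * k !)) →
      ∃ ρ : 𝓑.carrier → ℝ,
      (ContMDiffOn (𝓡 4) 𝓘(ℝ, ℝ) ((⊤ : ℕ∞) : WithTop ℕ∞) ρ 𝓑.doc ∧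
        (∀ x ∈ 𝓑.doc, mfderiv (𝓡 4) 𝓘(ℝ, ℝ) ρ x (𝓑.killing x) = 0) ∧
        (∀ x ∈ 𝓑.doc, mfderiv (𝓡 4) 𝓘(ℝ, ℝ) ρ x ≠ 0) ∧
        (∀ c : ℝ, 0 < c → ∃ U' : Set 𝓑.carrier, IsOpen U' ∧ 𝓑.horizon ⊆ U' ∧
          U' ∩ 𝓑.doc = {x | x ∈ 𝓑.doc ∧ ρ x < c}) ∧
        (∀ U₁ : Set 𝓑.carrier, IsOpen U₁ → 𝓑.horizon ⊆ U₁ →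
          (∀ γ : ℝ → 𝓑.carrier, IsMIntegralCurve γ 𝓑.killing → γ 0 ∈ U₁ ∩ 𝓑.doc →
            ∀ t, γ t ∈ U₁ ∩ 𝓑.doc) →
          ∃ c : ℝ, 0 < c ∧ {x | x ∈ 𝓑.doc ∧ ρ x < c} ⊆ U₁) ∧
        (∀ c₀ c : ℝ, 0 < c₀ → ∃ S : Set 𝓑.carrier, IsCompact S ∧ S ⊆ 𝓑.doc ∧
          {x | x ∈ 𝓑.doc ∧ c₀ ≤ ρ x ∧ ρ x ≤ c} ⊆ stationaryOrbit 𝓑.killing S)) ∧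
      (∀ q ∈ 𝓑.doc, 0 ≤ 𝓑.metric.val q (𝓑.killing q) (𝓑.killing q) →
        ∃ w : TangentSpace (𝓡 4) q, 0 < 𝓑.metric.val q w w ∧
          ∀ u : TangentSpace (𝓡 4) q, mfderiv (𝓡 4) 𝓘(ℝ, ℝ) ρ q u = 𝓑.metric.val q w u) ∧
      ∀ q ∈ 𝓑.doc, 0 ≤ 𝓑.metric.val q (𝓑.killing q) (𝓑.killing q) → q ∉ U →
      (∃ ψ ∈ IsManifold.maximalAtlas (𝓡 4) ((⊤ : ℕ∞) : WithTop ℕ∞) 𝓑.carrier, q ∈ ψ.source ∧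
        (∃ a b : ℝ, 𝓑.metric.val q
            (a • mfderiv 𝓘(ℝ, E4) (𝓡 4) ψ.symm (ψ q) (EuclideanSpace.single 0 1) +
              b • mfderiv 𝓘(ℝ, E4) (𝓡 4) ψ.symm (ψ q) (EuclideanSpace.single 1 1))
            (a • mfderiv 𝓘(ℝ, E4) (𝓡 4) ψ.symm (ψ q) (EuclideanSpace.single 0 1) +
              b • mfderiv 𝓘(ℝ, E4) (𝓡 4) ψ.symm (ψ q) (EuclideanSpace.single 1 1)) < 0) ∧
        ∀ a b : E4, ∃ δ > (0 : ℝ), ∃ M C : ℝ, 0 ≤ M ∧ 0 ≤ C ∧ Metric.ball (ψ q) δ ⊆ ψ.target ∧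
          ContDiffOn ℝ ((⊤ : ℕ∞) : WithTop ℕ∞)
            (fun p : E4 ↦ 𝓑.metric.val (ψ.symm p) (mfderiv 𝓘(ℝ, E4) (𝓡 4) ψ.symm p a) (mfderiv 𝓘(ℝ, E4) (𝓡 4) ψ.symm p b)) (Metric.ball (ψ q) δ) ∧
          ∀ z ∈ Metric.ball (ψ q) δ, ∀ (k : ℕ) (v : Fin k → E4),
            (∀ i, v i = EuclideanSpace.single 0 1 ∨ v i = EuclideanSpace.single 1 1) →
            ‖iteratedFDeriv ℝ k
                (fun p : E4 ↦ 𝓑.metric.val (ψ.symm p) (mfderiv 𝓘(ℝ, E4) (𝓡 4) ψ.symm p a) (mfderiv 𝓘(ℝ, E4) (𝓡 4) ψ.symm p b)) z v‖ ≤ M * C ^ k * k !) := by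
  sorry

/-- **Stub D · literatureDebts — FIVE NAMED FACTS OF THE TREE (unproved there), by name (rev 9):** the
Chruściel–Costa equivariant time function (`DocStructureTimeFunction.lean`, def p138635; rev-4 S1c; feeds the LANDED S1a and
N2/N3's quotient `doc/T`; under active discharge in `DocStructureTimeFunctionProofs.lean` — reduced there to the existence of a
smooth spacelike flow section, CC08 Prop. 4.4/4.6), Müller zum Hagen's analyticity where a Killing field is timelike
(`MullerZumHagenAnalyticity.lean`; rev-4 S4c; feeds the LANDED S4a and N1/N3 — it is what lets the line honour Disproof (F5):
vacuum is consumed on `{g(T,T) < 0} ∖ U`; conditional chain `mullerZumHagen1970_analytic_of_timelikeKilling_holds_of` in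
`MullerZumHagenStationaryHarmonicGauge.lean`), the Chruściel–Costa product structure (`DocProductStructure.lean`, p145855; feeds
S1b/S1b₇/N1b/N1), the Alexakis–Ionescu–Klainerman near-horizon axial Killing field (`NearHorizonAxialKilling.lean`, p157253; feeds
N1) and the Chruściel–Costa norm asymptotics (`StationaryNormAtInfinity.lean`, p157385; feeds N1).  Each conjunct closes by its
`_holds` the day a literature prover discharges it; sizes L + XL + XL + XL + XL as formalizations.  REV 9: the rev-8 sixth conjunct,
Nomizu's extension theorem `PseudoRiemannianMetric.Nomizu1960_killing_extension`, is DISCHARGED in the tree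
(`PseudoRiemannianMetric.Nomizu1960_killing_extension_holds`, `NomizuKillingExtensionProofs.lean`) and has left this stub; the
composition calls the theorem.
[cite: ChruscielCosta2008, Thm. 4.5 and Prop. 4.6] [cite: MullerZumHagen1970, Thm.] [cite: AlexakisIonescuKlainerman2010, Thm. 1.2]
[cite: BeigChrusciel1996, Prop. 3.1–3.2] -/
theorem stub_literatureDebts :
    chruscielCosta2008_equivariantTimeFunction ∧ mullerZumHagen1970_analytic_of_timelikeKilling ∧
      chruscielCosta2008_docProductStructure ∧ alexakisIonescuKlainerman2010_nearHorizonAxialKilling ∧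
      chruscielCosta2008_stationaryNormAtInfinity := by
  sorry

end Holds

/-! ### By-name handles of the statements (no second copy of the text) -/

/-- Statement of the LANDED rev-4 stub S1a (`Holds.stub_invariantKillingSubcollar`), by name. -/
def stub_invariantKillingSubcollar : Prop := type_of% Holds.stub_invariantKillingSubcollar

/-- Statement of registered stub S1b (`Holds.stub_invariantRadialFunction`), by name. -/
def stub_invariantRadialFunction : Prop := type_of% Holds.stub_invariantRadialFunction

/-- Statement of registered stub S2 (`Holds.stub_pointContinuation`), by name. -/
def stub_pointContinuation : Prop := type_of% Holds.stub_pointContinuation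

/-- Statement of registered stub S2a (`Holds.stub_pointContinuationAnalytic`), by name (rev 3). -/
def stub_pointContinuationAnalytic : Prop := type_of% Holds.stub_pointContinuationAnalytic

/-- Statement of the LANDED rev-4 stub S3 (`Holds.stub_slabPatching`), by name. -/
def stub_slabPatching : Prop := type_of% Holds.stub_slabPatching

/-- Statement of the LANDED rev-4 stub S4a (`Holds.stub_twoVariableAnalyticitySeeds`), by name. -/
def stub_twoVariableAnalyticitySeeds : Prop := type_of% Holds.stub_twoVariableAnalyticitySeeds

/-- Statement of registered stub N1b (`Holds.stub_farSeedBets`), by name (rev 6). -/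
def stub_farSeedBets : Prop := type_of% Holds.stub_farSeedBets

/-- Statement of registered stub S1b₇ (`Holds.stub_invariantRadialFunctionConnected`), by name (rev 6). -/
def stub_invariantRadialFunctionConnected : Prop := type_of% Holds.stub_invariantRadialFunctionConnected

/-- Statement of registered stub N1 (`Holds.stub_farAxialSeed`), by name. -/
def stub_farAxialSeed : Prop := type_of% Holds.stub_farAxialSeed

/-- Statement of registered stub N2 (`Holds.stub_highAzimuthalFrequencyBound`), by name. -/
def stub_highAzimuthalFrequencyBound : Prop := type_of% Holds.stub_highAzimuthalFrequencyBound

/-- Statement of registered stub N3a (`Holds.stub_commutingKillingFlowBox`), by name (rev 2). -/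
def stub_commutingKillingFlowBox : Prop := type_of% Holds.stub_commutingKillingFlowBox

/-- Statement of registered stub N3 (`Holds.stub_azimuthalCascade`), by name. -/
def stub_azimuthalCascade : Prop := type_of% Holds.stub_azimuthalCascade

/-- Statement of registered stub D (`Holds.stub_literatureDebts`), by name (five Literature named facts since rev 9). -/
def stub_literatureDebts : Prop := type_of% Holds.stub_literatureDebts

/-! ### Read-backs: the registered (inlined) statements are the vocabulary forms, definitionally -/

section ReadBack

/-- **From a radial function with non-null levels off the sub-collar to the timelike sweep** (W5's
reduction, rev 4 form).  Given `ρ` with (R1)–(R6), the spacelike-gradient property on the closed ergoregion, and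
an open `U₁ ⊇ 𝓔⁺` with flow-invariant trace: (R5) gives `c₀ > 0` with `{ρ < c₀} ∩ doc ⊆ U₁`; (R4) an open
`U' ⊇ 𝓔⁺` with `U' ∩ doc = {ρ < c₀} ∩ doc`; take `f = ρ`; where `g(T,T) < 0`, `dρ(T) = 0` and `dρ ≠ 0` force a
spacelike gradient (`LorentzianMetric.exists_pos_val_and_mfderiv_eq_val`). [folklore] -/
theorem sweep_of_radial (𝓑 : StationaryAFBlackHole.{0}) {ρ : 𝓑.carrier → ℝ} (hρ : IsInvariantRadialFunction 𝓑 ρ)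
    (hergo : ∀ x ∈ 𝓑.doc, 0 ≤ 𝓑.metric.val x (𝓑.killing x) (𝓑.killing x) →
      ∃ w : TangentSpace (𝓡 4) x, 0 < 𝓑.metric.val x w w ∧
        ∀ u : TangentSpace (𝓡 4) x, mfderiv (𝓡 4) 𝓘(ℝ, ℝ) ρ x u = 𝓑.metric.val x w u)
    (U₁ : Set 𝓑.carrier) (hU₁ : IsOpen U₁) (hHU₁ : 𝓑.horizon ⊆ U₁)
    (hinv : ∀ γ : ℝ → 𝓑.carrier, IsMIntegralCurve γ 𝓑.killing → γ 0 ∈ U₁ ∩ 𝓑.doc →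
      ∀ t, γ t ∈ U₁ ∩ 𝓑.doc) :
    ∃ (U' : Set 𝓑.carrier) (c₀ : ℝ),
      IsOpen U' ∧ 𝓑.horizon ⊆ U' ∧ U' ∩ 𝓑.doc ⊆ U₁ ∧ IsTimelikeSweep 𝓑 U' ρ c₀ := by
  obtain ⟨hρs, hρT, hρreg, hadj, hthin, hslab⟩ := hρ
  obtain ⟨c₀, hc₀, hsub⟩ := hthin U₁ hU₁ hHU₁ hinv
  obtain ⟨U', hU'o, hU'H, hU'eq⟩ := hadj c₀ hc₀
  refine ⟨U', c₀, hU'o, hU'H, ?_, hρs, hρT, hU'eq.symm, ?_, fun c ↦ hslab c₀ c hc₀⟩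
  · rw [hU'eq]; exact hsub
  · intro x hx _
    by_cases hTT : 0 ≤ 𝓑.metric.val x (𝓑.killing x) (𝓑.killing x)
    · exact hergo x hx hTT
    · exact 𝓑.metric.exists_pos_val_and_mfderiv_eq_val (T := 𝓑.killing) (not_le.mp hTT)
        (hρT x hx) (hρreg x hx)

/-- S1b read back: the registered (inlined) statement is `∃ ρ, IsInvariantRadialFunction 𝓑 ρ` under h1–h5, h8
(definitional unfolding). [folklore] -/
theorem stub_invariantRadialFunction_iff :
    stub_invariantRadialFunction ↔
      (chruscielCosta2008_docProductStructure →
      ∀ (𝓑 : StationaryAFBlackHole.{0}) [𝓑.metric.HasLeviCivita],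
        𝓑.metric.toPseudoRiemannianMetric.IsRicciFlat → 𝓑.IsIPlusRegular →
        (∀ p : 𝓑.carrier, p ∈ 𝓑.metric.chronologicalFuture 𝓑.timeOrientation 𝓑.Mext) →
        (∀ p ∈ 𝓑.doc, 𝓑.killing p ≠ 0) → SimplyConnectedSpace 𝓑.doc → IsConnected 𝓑.horizon →
        ∃ ρ : 𝓑.carrier → ℝ, IsInvariantRadialFunction 𝓑 ρ) :=
  Iff.rfl

/-- N2 read back: the registered statement is `HighFrequencyModeBound` under h2, h3, h4, h16 and the
Chruściel–Costa time function (definitional unfolding). [folklore] -/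
theorem stub_highAzimuthalFrequencyBound_iff :
    stub_highAzimuthalFrequencyBound ↔
      (chruscielCosta2008_equivariantTimeFunction →
        ∀ (𝓑 : StationaryAFBlackHole.{0}) [𝓑.metric.HasLeviCivita],
          𝓑.IsIPlusRegular →
          (∀ p : 𝓑.carrier, p ∈ 𝓑.metric.chronologicalFuture 𝓑.timeOrientation 𝓑.Mext) →
          (∀ p ∈ 𝓑.doc, 𝓑.killing p ≠ 0) → NoTrappedGeodesicModFlow 𝓑 → HighFrequencyModeBound 𝓑) :=
  Iff.rfl

/-- S1b₇ read back (definitional unfolding; rev 6). [folklore] -/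
theorem stub_invariantRadialFunctionConnected_iff :
    stub_invariantRadialFunctionConnected ↔
      (chruscielCosta2008_docProductStructure →
      ∀ (𝓑 : StationaryAFBlackHole.{0}) [𝓑.metric.HasLeviCivita],
        𝓑.metric.toPseudoRiemannianMetric.IsRicciFlat → 𝓑.IsIPlusRegular →
        (∀ p : 𝓑.carrier, p ∈ 𝓑.metric.chronologicalFuture 𝓑.timeOrientation 𝓑.Mext) →
        (∀ p ∈ 𝓑.doc, 𝓑.killing p ≠ 0) → SimplyConnectedSpace 𝓑.doc → IsConnected 𝓑.horizon →
        ∃ ρ : 𝓑.carrier → ℝ,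
          (ContMDiffOn (𝓡 4) 𝓘(ℝ, ℝ) ((⊤ : ℕ∞) : WithTop ℕ∞) ρ 𝓑.doc ∧
          (∀ x ∈ 𝓑.doc, mfderiv (𝓡 4) 𝓘(ℝ, ℝ) ρ x (𝓑.killing x) = 0) ∧
          (∀ x ∈ 𝓑.doc, mfderiv (𝓡 4) 𝓘(ℝ, ℝ) ρ x ≠ 0) ∧
          (∀ c : ℝ, 0 < c → ∃ U' : Set 𝓑.carrier, IsOpen U' ∧ 𝓑.horizon ⊆ U' ∧
            U' ∩ 𝓑.doc = {x | x ∈ 𝓑.doc ∧ ρ x < c}) ∧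
          (∀ U₁ : Set 𝓑.carrier, IsOpen U₁ → 𝓑.horizon ⊆ U₁ →
            (∀ γ : ℝ → 𝓑.carrier, IsMIntegralCurve γ 𝓑.killing → γ 0 ∈ U₁ ∩ 𝓑.doc →
              ∀ t, γ t ∈ U₁ ∩ 𝓑.doc) →
            ∃ c : ℝ, 0 < c ∧ {x | x ∈ 𝓑.doc ∧ ρ x < c} ⊆ U₁) ∧
          (∀ c₀ c : ℝ, 0 < c₀ → ∃ S : Set 𝓑.carrier, IsCompact S ∧ S ⊆ 𝓑.doc ∧
            {x | x ∈ 𝓑.doc ∧ c₀ ≤ ρ x ∧ ρ x ≤ c} ⊆ stationaryOrbit 𝓑.killing S)) ∧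
          SubLevelsPreconnected 𝓑 ρ) := by
  simp only [stub_invariantRadialFunctionConnected, SubLevelsPreconnected, and_assoc]

/-- N1b read back in the vocabulary of §1 (definitional unfolding up to binder bundling; rev 6). [folklore] -/
theorem stub_farSeedBets_iff :
    stub_farSeedBets ↔
      (chruscielCosta2008_docProductStructure →
        ∀ (𝓑 : StationaryAFBlackHole.{0}) [𝓑.metric.HasLeviCivita]
          (U : Set 𝓑.carrier) (K : Π x : 𝓑.carrier, TangentSpace (𝓡 4) x),
          𝓑.metric.toPseudoRiemannianMetric.IsRicciFlat → 𝓑.IsIPlusRegular →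
          (∀ p : 𝓑.carrier, p ∈ 𝓑.metric.chronologicalFuture 𝓑.timeOrientation 𝓑.Mext) →
          (∀ p ∈ 𝓑.doc, 𝓑.killing p ≠ 0) → SimplyConnectedSpace 𝓑.doc →
          IsKillingTimelikeCollar 𝓑 U K → BeltCompactModFlow 𝓑 U → NoTrappedGeodesicModFlow 𝓑 →
            ∀ ρ₀ : 𝓑.carrier → ℝ, IsInvariantRadialFunction 𝓑 ρ₀ →
            CollarNonDegenerate 𝓑 K ∧ TimelikeReach 𝓑 ρ₀ ∧ KillingContinuationCoherence 𝓑 U K) := by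
  constructor
  · intro h hP 𝓑 _ U K h1 h2 h3 h4 h5 ⟨hU, hHU, hconn, ⟨hsm, hkil, hcomm⟩, hne, htan, htl⟩ hbelt hnt
    exact h hP 𝓑 h1 h2 h3 h4 h5 U K hU hHU hconn hsm hkil hcomm hne htan htl hbelt hnt
  · intro h hP 𝓑 _ h1 h2 h3 h4 h5 U K hU hHU hconn hsm hkil hcomm hne htan htl hbelt hnt
    exact h hP 𝓑 U K h1 h2 h3 h4 h5 ⟨hU, hHU, hconn, ⟨hsm, hkil, hcomm⟩, hne, htan, htl⟩ hbelt hnt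

/-- N1 read back in the vocabulary of §1 (definitional unfolding up to binder bundling and the contraction of the
local Killing pairs to `IsKillingFieldOn`; rev 7 hypothesis list: the idle h15–h16 are no longer inputs of N1). [folklore] -/
theorem stub_farAxialSeed_iff :
    stub_farAxialSeed ↔
      (alexakisIonescuKlainerman2010_nearHorizonAxialKilling → chruscielCosta2008_stationaryNormAtInfinity →
        mullerZumHagen1970_analytic_of_timelikeKilling → PseudoRiemannianMetric.Nomizu1960_killing_extension →
        chruscielCosta2008_equivariantTimeFunction → chruscielCosta2008_docProductStructure →
        ∀ (𝓑 : StationaryAFBlackHole.{0}) [𝓑.metric.HasLeviCivita]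
          (U : Set 𝓑.carrier) (K : Π x : 𝓑.carrier, TangentSpace (𝓡 4) x),
          𝓑.metric.toPseudoRiemannianMetric.IsRicciFlat → 𝓑.IsIPlusRegular →
          (∀ p : 𝓑.carrier, p ∈ 𝓑.metric.chronologicalFuture 𝓑.timeOrientation 𝓑.Mext) →
          (∀ p ∈ 𝓑.doc, 𝓑.killing p ≠ 0) → SimplyConnectedSpace 𝓑.doc →
          IsKillingTimelikeCollar 𝓑 U K → CollarNonDegenerate 𝓑 K →
            ∀ ρ₀ : 𝓑.carrier → ℝ, IsInvariantRadialFunction 𝓑 ρ₀ → SubLevelsPreconnected 𝓑 ρ₀ →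
            TimelikeReach 𝓑 ρ₀ → KillingContinuationCoherence 𝓑 U K →
            NonRotatingCollar 𝓑 K ∨
            ∃ (W : Set 𝓑.carrier) (Z : Π x : 𝓑.carrier, TangentSpace (𝓡 4) x)
              (Φ : ℝ → 𝓑.carrier → 𝓑.carrier),
              FarAxialSeed 𝓑 W Z Φ ∧ IsConnected W ∧ (∃ x ∈ W, Z x ≠ 0) ∧ SeedDocksWith 𝓑 K W Z) := by
  constructor
  · intro h hA hF hM hN hC hP 𝓑 _ U K h1 h2 h3 h4 h5 ⟨hU, hHU, hconn, ⟨hsm, hkil, hcomm⟩, hne, htan, htl⟩ h17 ρ₀ hρ hR7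
      hreach hcoh
    rcases h hA hF hM hN hC hP 𝓑 h1 h2 h3 h4 h5 U K hU hHU hconn hsm hkil hcomm hne htan htl h17 ρ₀ hρ hR7 hreach
        (fun D₁ D₂ L₁ L₂ ho₁ hc₁ ho₂ hc₂ hs₁ hs₂ hK₁ hb₁ hK₂ hb₂ hdk hag ↦
          hcoh D₁ D₂ L₁ L₂ ho₁ hc₁ ho₂ hc₂ hs₁ hs₂ hK₁.1 hK₁.2 hb₁ hK₂.1 hK₂.2 hb₂ hdk hag) with
      hl | ⟨W, Z, Φ, ⟨hWo, hWd, hS₁, ⟨hZK, hZc⟩, hΦ⟩, hWc, hZ, hd⟩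
    · exact Or.inl hl
    · exact Or.inr ⟨W, Z, Φ, ⟨hWo, hWd, hS₁, ⟨hZK.1, hZK.2, hZc⟩, hΦ⟩, hWc, hZ, hd⟩
  · intro h hA hF hM hN hC hP 𝓑 _ h1 h2 h3 h4 h5 U K hU hHU hconn hsm hkil hcomm hne htan htl h17 ρ₀ hρ hR7 hreach hcoh
    rcases h hA hF hM hN hC hP 𝓑 U K h1 h2 h3 h4 h5 ⟨hU, hHU, hconn, ⟨hsm, hkil, hcomm⟩, hne, htan, htl⟩ h17 ρ₀ hρ hR7
        hreach (fun D₁ D₂ L₁ L₂ ho₁ hc₁ ho₂ hc₂ hs₁ hs₂ hsm₁ hk₁ hb₁ hsm₂ hk₂ hb₂ hdk hag ↦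
          hcoh D₁ D₂ L₁ L₂ ho₁ hc₁ ho₂ hc₂ hs₁ hs₂ ⟨hsm₁, hk₁⟩ hb₁ ⟨hsm₂, hk₂⟩ hb₂ hdk hag) with
      hl | ⟨W, Z, Φ, ⟨hWo, hWd, hS₁, ⟨hZs, hZk, hZc⟩, hΦ⟩, hWc, hZ, hd⟩
    · exact Or.inl hl
    · exact Or.inr ⟨W, Z, Φ, ⟨hWo, hWd, hS₁, ⟨⟨hZs, hZk⟩, hZc⟩, hΦ⟩, hWc, hZ, hd⟩

/-- N3a read back: the registered (inlined) statement is `CommutingKillingFlowBoxAnalyticity` for every `𝓑`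
(definitional unfolding; rev 2). [folklore] -/
theorem stub_commutingKillingFlowBox_iff :
    stub_commutingKillingFlowBox ↔
      ∀ (𝓑 : StationaryAFBlackHole.{0}) [𝓑.metric.HasLeviCivita], CommutingKillingFlowBoxAnalyticity 𝓑 :=
  Iff.rfl

/-- N3 read back in the vocabulary of §1 (definitional unfolding up to binder bundling; rev 2 adds the
flow-box analyticity input). [folklore] -/
theorem stub_azimuthalCascade_iff :
    stub_azimuthalCascade ↔
      (chruscielCosta2008_equivariantTimeFunction → mullerZumHagen1970_analytic_of_timelikeKilling →
        chruscielCosta2008_docProductStructure →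
        ∀ (𝓑 : StationaryAFBlackHole.{0}) [𝓑.metric.HasLeviCivita]
          (U : Set 𝓑.carrier) (K : Π x : 𝓑.carrier, TangentSpace (𝓡 4) x),
          𝓑.metric.toPseudoRiemannianMetric.IsRicciFlat → 𝓑.IsIPlusRegular →
          (∀ p : 𝓑.carrier, p ∈ 𝓑.metric.chronologicalFuture 𝓑.timeOrientation 𝓑.Mext) →
          (∀ p ∈ 𝓑.doc, 𝓑.killing p ≠ 0) → SimplyConnectedSpace 𝓑.doc →
          IsKillingTimelikeCollar 𝓑 U K → BeltCompactModFlow 𝓑 U → NoTrappedGeodesicModFlow 𝓑 →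
            ∀ ρ₀ : 𝓑.carrier → ℝ, IsInvariantRadialFunction 𝓑 ρ₀ →
            ∀ (W : Set 𝓑.carrier) (Z : Π x : 𝓑.carrier, TangentSpace (𝓡 4) x)
              (Φ : ℝ → 𝓑.carrier → 𝓑.carrier), FarAxialSeed 𝓑 W Z Φ → IsConnected W →
              (∃ x ∈ W, Z x ≠ 0) → SeedDocksWith 𝓑 K W Z → HighFrequencyModeBound 𝓑 →
              CommutingKillingFlowBoxAnalyticity 𝓑 →
              ∃ ρ : 𝓑.carrier → ℝ, IsInvariantRadialFunction 𝓑 ρ ∧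
                (∀ q ∈ 𝓑.doc, 0 ≤ 𝓑.metric.val q (𝓑.killing q) (𝓑.killing q) →
                  ∃ w : TangentSpace (𝓡 4) q, 0 < 𝓑.metric.val q w w ∧
                    ∀ u : TangentSpace (𝓡 4) q, mfderiv (𝓡 4) 𝓘(ℝ, ℝ) ρ q u = 𝓑.metric.val q w u) ∧
                ∀ q ∈ 𝓑.doc, 0 ≤ 𝓑.metric.val q (𝓑.killing q) (𝓑.killing q) → q ∉ U →
                  TwoVariableAnalyticAt 𝓑 q) := by
  constructor
  · intro h hC hM hP 𝓑 _ U K h1 h2 h3 h4 h5 ⟨hU, hHU, hconn, ⟨hsm, hkil, hcomm⟩, hne, htan, htl⟩ hbelt hnt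
    exact h hC hM hP 𝓑 h1 h2 h3 h4 h5 U K hU hHU hconn hsm hkil hcomm hne htan htl hbelt hnt
  · intro h hC hM hP 𝓑 _ h1 h2 h3 h4 h5 U K hU hHU hconn hsm hkil hcomm hne htan htl hbelt hnt
    exact h hC hM hP 𝓑 U K h1 h2 h3 h4 h5 ⟨hU, hHU, hconn, ⟨hsm, hkil, hcomm⟩, hne, htan, htl⟩ hbelt hnt

/-- S2 read back in the vocabulary of §1 (definitional unfolding). [folklore] -/
theorem stub_pointContinuation_iff :
    stub_pointContinuation ↔
      ∀ (𝓑 : StationaryAFBlackHole.{0}) [𝓑.metric.HasLeviCivita],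
        𝓑.metric.toPseudoRiemannianMetric.IsRicciFlat →
        ∀ (D : Set 𝓑.carrier) (L : Π x : 𝓑.carrier, TangentSpace (𝓡 4) x),
          IsOpen D → D ⊆ 𝓑.doc → IsLocalKilling 𝓑 D L →
          ∀ q ∈ 𝓑.doc, ∀ f : 𝓑.carrier → ℝ, NonNullSupportAt 𝓑 D q f → TwoVariableAnalyticAt 𝓑 q →
            PointContinuationAt 𝓑 D L q :=
  Iff.rfl

/-- S2a read back in the vocabulary of §1 and `ChartwiseAnalyticity.lean` (definitional unfolding; rev 3). [folklore] -/
theorem stub_pointContinuationAnalytic_iff :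
    stub_pointContinuationAnalytic ↔
      (PseudoRiemannianMetric.Nomizu1960_killing_extension →
      ∀ (𝓑 : StationaryAFBlackHole.{0}) [𝓑.metric.HasLeviCivita],
        ∀ (D : Set 𝓑.carrier) (L : Π x : 𝓑.carrier, TangentSpace (𝓡 4) x),
          IsOpen D → D ⊆ 𝓑.doc → IsLocalKilling 𝓑 D L →
          ∀ q ∈ 𝓑.doc, ∀ f : 𝓑.carrier → ℝ, NonNullSupportAt 𝓑 D q f → 𝓑.IsChartwiseAnalyticAt q →
            PointContinuationAt 𝓑 D L q) :=
  Iff.rfl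

/-- S3 read back in the vocabulary of §1 (definitional unfolding). [folklore] -/
theorem stub_slabPatching_iff :
    stub_slabPatching ↔
      ∀ (𝓑 : StationaryAFBlackHole.{0}) [𝓑.metric.HasLeviCivita], 𝓑.IsIPlusRegular →
        ∀ (U' : Set 𝓑.carrier) (f : 𝓑.carrier → ℝ) (c₀ : ℝ), IsTimelikeSweep 𝓑 U' f c₀ →
        ∀ c : ℝ, c₀ ≤ c →
        ∀ L : Π x : 𝓑.carrier, TangentSpace (𝓡 4) x, IsLocalKilling 𝓑 (subLevel 𝓑 f c) L →
          (∀ q ∈ 𝓑.doc, f q = c → PointContinuationAt 𝓑 (subLevel 𝓑 f c) L q) →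
          ∃ ε : ℝ, 0 < ε ∧ ∃ L' : Π x : 𝓑.carrier, TangentSpace (𝓡 4) x,
            IsLocalKilling 𝓑 (subLevel 𝓑 f (c + ε)) L' ∧ ∀ x ∈ subLevel 𝓑 f c, L' x = L x :=
  Iff.rfl

/-- S4a read back in the vocabulary of §1 (definitional unfolding). [folklore] -/
theorem stub_twoVariableAnalyticitySeeds_iff :
    stub_twoVariableAnalyticitySeeds ↔
      (mullerZumHagen1970_analytic_of_timelikeKilling →
      ∀ (𝓑 : StationaryAFBlackHole.{0}) [𝓑.metric.HasLeviCivita]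
        (U : Set 𝓑.carrier) (K : Π x : 𝓑.carrier, TangentSpace (𝓡 4) x),
        𝓑.metric.toPseudoRiemannianMetric.IsRicciFlat → 𝓑.IsIPlusRegular →
        (∀ p : 𝓑.carrier, p ∈ 𝓑.metric.chronologicalFuture 𝓑.timeOrientation 𝓑.Mext) →
        (∀ p ∈ 𝓑.doc, 𝓑.killing p ≠ 0) → SimplyConnectedSpace 𝓑.doc →
        IsKillingTimelikeCollar 𝓑 U K → BeltCompactModFlow 𝓑 U → NoTrappedGeodesicModFlow 𝓑 →
          ∀ q ∈ 𝓑.doc, (𝓑.metric.val q (𝓑.killing q) (𝓑.killing q) < 0 ∨ q ∈ U) →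
            TwoVariableAnalyticAt 𝓑 q) := by
  constructor
  · intro h hM 𝓑 _ U K h1 h2 h3 h4 h5 ⟨hU, hHU, hconn, ⟨hsm, hkil, hcomm⟩, hne, htan, htl⟩ hbelt hnt
    exact h hM 𝓑 h1 h2 h3 h4 h5 U K hU hHU hconn hsm hkil hcomm hne htan htl hbelt hnt
  · intro h hM 𝓑 _ h1 h2 h3 h4 h5 U K hU hHU hconn hsm hkil hcomm hne htan htl hbelt hnt
    exact h hM 𝓑 U K h1 h2 h3 h4 h5 ⟨hU, hHU, hconn, ⟨hsm, hkil, hcomm⟩, hne, htan, htl⟩ hbelt hnt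

end ReadBack

/-! ## §4 The composition (sorry-free): Zorn on anchored partial continuations -/

section Composition

variable {𝓑 : StationaryAFBlackHole.{0}} [𝓑.metric.HasLeviCivita]
  {U' : Set 𝓑.carrier} {f : 𝓑.carrier → ℝ} {c₀ : ℝ}
  {K₀ : Π x : 𝓑.carrier, TangentSpace (𝓡 4) x}

variable (𝓑 U' f c₀ K₀) in
/-- An ANCHORED PARTIAL CONTINUATION of the sub-collar field `K₀` along the sweep `f`: a level
`c ∈ [c₀, +∞]` (in `EReal`) and a local `T`-commuting Killing field `L` on `{f < c} ∩ doc` which equals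
`K₀` on the sub-collar `U' ∩ doc`.  Level `⊤` means: `L` lives on the whole d.o.c. [folklore] -/
structure Cont where
  /-- the level reached -/
  c : EReal
  /-- the continued field (a global section; only its values on `{f < c} ∩ doc` matter) -/
  L : Π x : 𝓑.carrier, TangentSpace (𝓡 4) x
  /-- the level is at least the bottom level of the sweep -/
  hc : ((c₀ : ℝ) : EReal) ≤ c
  /-- `L` is a local `T`-commuting Killing field below the level -/
  killing : IsLocalKilling 𝓑 {x | x ∈ 𝓑.doc ∧ ((f x : ℝ) : EReal) < c} L
  /-- `L` is anchored to the sub-collar field -/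
  anchored : ∀ x ∈ U' ∩ 𝓑.doc, L x = K₀ x

/-- Partial continuations are ordered by EXTENSION: `a ≤ b` iff `b` reaches at least the level of `a`
and agrees with `a` below the level of `a`.  (A preorder; antisymmetry fails off the domains.) [folklore] -/
instance : Preorder (Cont 𝓑 U' f c₀ K₀) where
  le a b := a.c ≤ b.c ∧ ∀ x ∈ 𝓑.doc, ((f x : ℝ) : EReal) < a.c → b.L x = a.L x
  le_refl a := ⟨le_rfl, fun _ _ _ ↦ rfl⟩
  le_trans a b d hab hbd :=
    ⟨hab.1.trans hbd.1, fun x hx hlt ↦ (hbd.2 x hx (lt_of_lt_of_le hlt hab.1)).trans (hab.2 x hx hlt)⟩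

omit [𝓑.metric.HasLeviCivita] in
/-- Unfolding lemma for the extension order. [folklore] -/
theorem Cont.le_def [𝓑.metric.HasLeviCivita] {a b : Cont 𝓑 U' f c₀ K₀} :
    a ≤ b ↔ a.c ≤ b.c ∧ ∀ x ∈ 𝓑.doc, ((f x : ℝ) : EReal) < a.c → b.L x = a.L x := Iff.rfl

/-- For a real level the `EReal` domain of a partial continuation is the sub-level set. [folklore] -/
theorem setOf_ereal_lt_coe (c : ℝ) :
    {x | x ∈ 𝓑.doc ∧ ((f x : ℝ) : EReal) < (c : EReal)} = subLevel 𝓑 f c := by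
  ext x
  simp only [mem_setOf_eq, EReal.coe_lt_coe_iff, mem_subLevel]

/-- At level `⊤` the domain of a partial continuation is the whole d.o.c. [folklore] -/
theorem setOf_ereal_lt_top :
    {x | x ∈ 𝓑.doc ∧ ((f x : ℝ) : EReal) < (⊤ : EReal)} = 𝓑.doc := by
  ext x
  simp only [mem_setOf_eq, EReal.coe_lt_top, and_true]

/-- The `EReal`-domain `{x ∈ doc | f x < c}` of a level is open when `f` is continuous on the d.o.c. [folklore] -/
theorem isOpen_setOf_ereal_lt (hf : ContinuousOn f 𝓑.doc) (c : EReal) :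
    IsOpen {x | x ∈ 𝓑.doc ∧ ((f x : ℝ) : EReal) < c} := by
  have : {x | x ∈ 𝓑.doc ∧ ((f x : ℝ) : EReal) < c} = 𝓑.doc ∩ f ⁻¹' {r : ℝ | (r : EReal) < c} := by
    ext x; simp only [mem_setOf_eq, mem_inter_iff, mem_preimage]
  rw [this]
  exact hf.isOpen_inter_preimage (isOpen_doc 𝓑) (isOpen_Iio.preimage continuous_coe_real_ereal)

/-- **Chains of partial continuations have upper bounds** (the gluing step of Zorn).  The base
continuation `(c₀, K₀)` bounds the empty chain; a non-empty chain is bounded by the supremum level with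
the GLUED field (well defined because any two members of a chain are comparable, and comparable members
agree below the smaller level), which is a local `T`-commuting Killing field by `IsLocalKilling.of_locally`.
[folklore] -/
theorem Cont.bddAbove_of_isChain (hf : ContinuousOn f 𝓑.doc) (hbase : subLevel 𝓑 f c₀ = U' ∩ 𝓑.doc)
    (hK₀ : IsLocalKilling 𝓑 (U' ∩ 𝓑.doc) K₀)
    (S : Set (Cont 𝓑 U' f c₀ K₀)) (hS : IsChain (· ≤ ·) S) : BddAbove S := by
  classical
  rcases S.eq_empty_or_nonempty with rfl | hne
  · -- the base continuation bounds the empty chain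
    refine ⟨⟨(c₀ : EReal), K₀, le_rfl, ?_, fun _ _ ↦ rfl⟩, fun _ h ↦ h.elim⟩
    rw [setOf_ereal_lt_coe, hbase]
    exact hK₀
  · -- glue the chain
    let cs : EReal := sSup (Cont.c '' S)
    let Lg : Π x : 𝓑.carrier, TangentSpace (𝓡 4) x := fun x ↦
      if h : ∃ a ∈ S, ((f x : ℝ) : EReal) < a.c then h.choose.L x else K₀ x
    -- comparable members agree below the smaller level
    have hagree : ∀ a ∈ S, ∀ b ∈ S, ∀ x ∈ 𝓑.doc,
        ((f x : ℝ) : EReal) < a.c → ((f x : ℝ) : EReal) < b.c → a.L x = b.L x := by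
      intro a ha b hb x hx hxa hxb
      rcases hS.total ha hb with hab | hba
      · exact (hab.2 x hx hxa).symm
      · exact hba.2 x hx hxb
    -- the glued field agrees with every member below that member's level
    have hLg : ∀ a ∈ S, ∀ x ∈ 𝓑.doc, ((f x : ℝ) : EReal) < a.c → Lg x = a.L x := by
      intro a ha x hx hxa
      have h : ∃ a ∈ S, ((f x : ℝ) : EReal) < a.c := ⟨a, ha, hxa⟩
      simp only [Lg, dif_pos h]
      exact hagree _ h.choose_spec.1 a ha x hx h.choose_spec.2 hxa
    obtain ⟨a₀, ha₀⟩ := hne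
    refine ⟨⟨cs, Lg, ?_, ?_, ?_⟩, ?_⟩
    · -- level ≥ c₀
      exact a₀.hc.trans (le_sSup (mem_image_of_mem Cont.c ha₀))
    · -- local Killing on the glued domain
      refine IsLocalKilling.of_locally fun x hx ↦ ?_
      obtain ⟨hxdoc, hxlt⟩ := hx
      obtain ⟨_, ⟨a, ha, rfl⟩, hxa⟩ := lt_sSup_iff.mp hxlt
      refine ⟨{y | y ∈ 𝓑.doc ∧ ((f y : ℝ) : EReal) < a.c}, a.L, isOpen_setOf_ereal_lt hf a.c,
        ⟨hxdoc, hxa⟩, a.killing, fun y hy ↦ hLg a ha y hy.1 hy.2⟩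
    · -- anchored
      intro x hx
      have hx' : x ∈ subLevel 𝓑 f c₀ := hbase ▸ hx
      have hlt : ((f x : ℝ) : EReal) < a₀.c :=
        lt_of_lt_of_le (EReal.coe_lt_coe_iff.mpr hx'.2) a₀.hc
      rw [hLg a₀ ha₀ x hx.2 hlt]
      exact a₀.anchored x hx
    · -- upper bound
      intro a ha
      exact ⟨le_sSup (mem_image_of_mem Cont.c ha), fun x hx hxa ↦ hLg a ha x hx hxa⟩

end Composition

/-! ## §5 Assembly of the engine, the sweep datum, and the skeleton theorem -/

/-! ### The non-rotating branch (Disproof (F3), copied: kernel-checked there) -/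

/-- Constant multiples of the stationary Killing field are Killing fields (the Killing equation is
linear; `∇(c • T) = c • ∇T` by `IsCovariantDerivativeOn.smul_const` at the smooth section `T`).
Copied from `Cruxes/NonTrappingHawkingRigidity/Disproof.lean` (F3). [cite: ONeill1983, Ch. 9, Prop. 9.25] -/
theorem isKillingField_const_smul_killing (𝓑 : StationaryAFBlackHole.{0}) [𝓑.metric.HasLeviCivita] (c : ℝ) :
    𝓑.metric.IsKillingField (c • 𝓑.killing) := by
  have hT : 𝓑.metric.IsKillingField 𝓑.killing := 𝓑.isStationaryKilling.isKillingField
  refine ⟨hT.contMDiff.const_smul_section, fun x Y₀ Z₀ ↦ ?_⟩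
  have hTx : MDifferentiableAt (𝓡 4) (𝓡 4).tangent
      (fun y ↦ (⟨y, 𝓑.killing y⟩ : TangentBundle (𝓡 4) 𝓑.carrier)) x :=
    (hT.contMDiff x).mdifferentiableAt (by simp)
  have hs : 𝓑.metric.leviCivita (c • 𝓑.killing) x = c • 𝓑.metric.leviCivita 𝓑.killing x :=
    𝓑.metric.leviCivita.isCovariantDerivativeOnUniv.smul_const c hTx
  have h := hT.val_leviCivita_add x Y₀ Z₀
  simp only [hs, FunLike.coe_smul, Pi.smul_apply, map_smul, smul_eq_mul]
  linear_combination c * h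

/-- `[T, c • T] = 0` pointwise.  Copied from `Disproof.lean` (F3). [folklore] -/
theorem mlieBracket_killing_const_smul_killing (𝓑 : StationaryAFBlackHole.{0}) [𝓑.metric.HasLeviCivita]
    (c : ℝ) (x : 𝓑.carrier) :
    VectorField.mlieBracket (𝓡 4) 𝓑.killing (c • 𝓑.killing) x = 0 := by
  have hT : 𝓑.metric.IsKillingField 𝓑.killing := 𝓑.isStationaryKilling.isKillingField
  have hTx : MDifferentiableAt (𝓡 4) (𝓡 4).tangent
      (fun y ↦ (⟨y, 𝓑.killing y⟩ : TangentBundle (𝓡 4) 𝓑.carrier)) x :=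
    (hT.contMDiff x).mdifferentiableAt (by simp)
  rw [VectorField.mlieBracket_const_smul_right hTx, VectorField.mlieBracket_self]
  simp

/-- **The NON-ROTATING branch is trivial as typed** (Disproof (F3)): if `K = α • T` on the trace of an
open `U'' ⊇ 𝓔⁺` then `K' := α • T` is smooth, Killing and `T`-commuting on the d.o.c. and docks on `U''`.
[folklore] -/
theorem conclusion_of_nonRotating {𝓑 : StationaryAFBlackHole.{0}} [𝓑.metric.HasLeviCivita]
    {K : Π x : 𝓑.carrier, TangentSpace (𝓡 4) x} (h : NonRotatingCollar 𝓑 K) :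
    ∃ K' : Π x : 𝓑.carrier, TangentSpace (𝓡 4) x, IsLocalKilling 𝓑 𝓑.doc K' ∧
      ∃ U' : Set 𝓑.carrier, IsOpen U' ∧ 𝓑.horizon ⊆ U' ∧ ∀ x ∈ U' ∩ 𝓑.doc, K' x = K x := by
  obtain ⟨U₀, hU₀, hh, c, hK⟩ := h
  have hcT := isKillingField_const_smul_killing 𝓑 c
  exact ⟨c • 𝓑.killing, ⟨hcT.contMDiff.contMDiffOn, fun x _ v w ↦ hcT.val_leviCivita_add x v w,
    fun x _ ↦ mlieBracket_killing_const_smul_killing 𝓑 c x⟩, U₀, hU₀, hh,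
    fun x hx ↦ by rw [Pi.smul_apply, hK x hx]⟩

/-! ### The rotating branch: the engine -/

/-- **The engine assembled (S1b structure + a GENUINE far seed + N2 bound + N3 cascade):** under the
regular telescope, given a far axial seed `(W, Z, Φ)` that is connected, non-trivial and docked (N1's
rotating branch), there is a radial function `ρ` of the d.o.c. with SPACELIKE gradient on the closed
ergoregion and TWO-VARIABLE ANALYTICITY of the metric at every belt point off the collar `U`. Pure
plumbing through the read-backs. [folklore] -/
theorem engine_of (h1b : stub_invariantRadialFunction) (hN2 : stub_highAzimuthalFrequencyBound)
    (hN3a : stub_commutingKillingFlowBox) (hN3 : stub_azimuthalCascade)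
    (hCC : chruscielCosta2008_equivariantTimeFunction)
    (hMzH : mullerZumHagen1970_analytic_of_timelikeKilling) (hDPS : chruscielCosta2008_docProductStructure)
    {𝓑 : StationaryAFBlackHole.{0}} [𝓑.metric.HasLeviCivita]
    {U : Set 𝓑.carrier} {K : Π x : 𝓑.carrier, TangentSpace (𝓡 4) x}
    (hvac : 𝓑.metric.toPseudoRiemannianMetric.IsRicciFlat) (hreg : 𝓑.IsIPlusRegular)
    (hfp : ∀ p : 𝓑.carrier, p ∈ 𝓑.metric.chronologicalFuture 𝓑.timeOrientation 𝓑.Mext)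
    (hT : ∀ p ∈ 𝓑.doc, 𝓑.killing p ≠ 0) (hsc : SimplyConnectedSpace 𝓑.doc)
    (hcol : IsKillingTimelikeCollar 𝓑 U K) (hbelt : BeltCompactModFlow 𝓑 U)
    (hnt : NoTrappedGeodesicModFlow 𝓑) {ρ₀ : 𝓑.carrier → ℝ} (hρ₀ : IsInvariantRadialFunction 𝓑 ρ₀)
    {W : Set 𝓑.carrier} {Z : Π x : 𝓑.carrier, TangentSpace (𝓡 4) x} {Φ : ℝ → 𝓑.carrier → 𝓑.carrier}
    (hFS : FarAxialSeed 𝓑 W Z Φ) (hWc : IsConnected W) (hZ : ∃ x ∈ W, Z x ≠ 0)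
    (hdock : SeedDocksWith 𝓑 K W Z) :
    ∃ ρ : 𝓑.carrier → ℝ, IsInvariantRadialFunction 𝓑 ρ ∧
      (∀ q ∈ 𝓑.doc, 0 ≤ 𝓑.metric.val q (𝓑.killing q) (𝓑.killing q) →
        ∃ w : TangentSpace (𝓡 4) q, 0 < 𝓑.metric.val q w w ∧
          ∀ u : TangentSpace (𝓡 4) q, mfderiv (𝓡 4) 𝓘(ℝ, ℝ) ρ q u = 𝓑.metric.val q w u) ∧
      ∀ q ∈ 𝓑.doc, 0 ≤ 𝓑.metric.val q (𝓑.killing q) (𝓑.killing q) → q ∉ U →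
        TwoVariableAnalyticAt 𝓑 q :=
  have hT1 : HighFrequencyModeBound 𝓑 :=
    stub_highAzimuthalFrequencyBound_iff.mp hN2 hCC 𝓑 hreg hfp hT hnt
  stub_azimuthalCascade_iff.mp hN3 hCC hMzH hDPS 𝓑 U K hvac hreg hfp hT hsc hcol hbelt hnt ρ₀ hρ₀ W Z Φ hFS
    hWc hZ hdock hT1 (stub_commutingKillingFlowBox_iff.mp hN3a 𝓑)

/-- **Sub-collar, timelike sweep and docking datum**: the `T`-invariant Killing sub-collar `(U₁, K₁)` of S1a
(LANDED, fed by the Chruściel–Costa time function) and a radial function `ρ` with spacelike gradient on the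
closed ergoregion (the engine's) give, by W5's `sweep_of_radial`, the datum `(U', f := ρ, c₀, K₀ := K₁)` the
Zorn composition consumes, docking on `U''`. [folklore] -/
theorem collarSweep_of (h₁ : stub_invariantKillingSubcollar) (hCC : chruscielCosta2008_equivariantTimeFunction)
    {𝓑 : StationaryAFBlackHole.{0}} [𝓑.metric.HasLeviCivita]
    {U : Set 𝓑.carrier} {K : Π x : 𝓑.carrier, TangentSpace (𝓡 4) x}
    (hvac : 𝓑.metric.toPseudoRiemannianMetric.IsRicciFlat) (hreg : 𝓑.IsIPlusRegular)
    (hfp : ∀ p : 𝓑.carrier, p ∈ 𝓑.metric.chronologicalFuture 𝓑.timeOrientation 𝓑.Mext)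
    (hT : ∀ p ∈ 𝓑.doc, 𝓑.killing p ≠ 0) (hsc : SimplyConnectedSpace 𝓑.doc)
    (hcol : IsKillingTimelikeCollar 𝓑 U K) (hbelt : BeltCompactModFlow 𝓑 U)
    (hnt : NoTrappedGeodesicModFlow 𝓑) {ρ : 𝓑.carrier → ℝ} (hρ : IsInvariantRadialFunction 𝓑 ρ)
    (hergo : ∀ x ∈ 𝓑.doc, 0 ≤ 𝓑.metric.val x (𝓑.killing x) (𝓑.killing x) →
      ∃ w : TangentSpace (𝓡 4) x, 0 < 𝓑.metric.val x w w ∧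
        ∀ u : TangentSpace (𝓡 4) x, mfderiv (𝓡 4) 𝓘(ℝ, ℝ) ρ x u = 𝓑.metric.val x w u) :
    ∃ (U' : Set 𝓑.carrier) (c₀ : ℝ) (K₀ : Π x : 𝓑.carrier, TangentSpace (𝓡 4) x),
      IsOpen U' ∧ 𝓑.horizon ⊆ U' ∧ IsTimelikeSweep 𝓑 U' ρ c₀ ∧ IsLocalKilling 𝓑 (U' ∩ 𝓑.doc) K₀ ∧
      ∃ U'' : Set 𝓑.carrier, IsOpen U'' ∧ 𝓑.horizon ⊆ U'' ∧ ∀ x ∈ U'' ∩ 𝓑.doc, K₀ x = K x := by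
  obtain ⟨hU, hHU, hconn, ⟨hsm, hkil, hcomm⟩, hne, htan, htl⟩ := hcol
  obtain ⟨U₁, V, U'', K₁, hU₁, hHU₁, hinv, hV, hHV, hVU, hVU₁, ⟨hsm₁, hkil₁, hcomm₁⟩, hU'', hHU'',
    hdock⟩ :=
    (h₁ : type_of% Holds.stub_invariantKillingSubcollar) hCC 𝓑 hvac hreg hfp hT hsc U K hU hHU hconn hsm
      hkil hcomm hne htan htl hbelt hnt
  obtain ⟨U', c₀, hU', hHU', hU'U₁, hsweep⟩ := sweep_of_radial 𝓑 hρ hergo U₁ hU₁ hHU₁ hinv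
  have hsub : U' ∩ 𝓑.doc ⊆ U₁ ∩ 𝓑.doc := fun x hx ↦ ⟨hU'U₁ hx, hx.2⟩
  exact ⟨U', c₀, K₁, hU', hHU', hsweep,
    ⟨hsm₁.mono hsub, fun x hx ↦ hkil₁ x (hsub hx), fun x hx ↦ hcomm₁ x (hsub hx)⟩,
    U'', hU'', hHU'', hdock⟩

/-- **`NonTrappingHawkingRigidity_of` — THE SKELETON (registered stubs ⇒ the crux BY NAME; rev 5: 6 open — S2, N1c, N1, N2,
N3, D; landed and discharged inside — S1a, S1b, S2a, S3, N3a).**  S1b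
(structure, LANDED p152581), N1c (corridor), N1 (far axial seed), N2 (high-frequency bound), N3a (flow-box analyticity, LANDED p149613 and discharged inside), N3 (the fed engine) and D (debts) give a radial
function with spacelike gradient on the closed ergoregion and two-variable analyticity on the belt
(`engine_of`, in the ROTATING branch of N1; the non-rotating branch docks `K' := α • T` directly, Disproof (F3)); S1a (landed) + D give the anchored sub-collar field and the timelike sweep (`collarSweep_of`);
then rev 4's Zorn argument VERBATIM: chains of anchored partial continuations glue
(`Cont.bddAbove_of_isChain`); a maximal element of finite level `c` would be strictly extended — every point
of the level `{ρ = c}` is supported by the sub-level set through a NON-NULL level (spacelike gradient: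
engine on the closed ergoregion, `T`-timelike points automatic), is two-variable analytic (S4a LANDED + MzH
where `T` is timelike or on `U`; N3 on the belt off `U`), hence admits a one-step continuation by S2, and S3
(LANDED) patches these to `{ρ < c + ε}`; so the maximal level is `⊤`, its field is Killing and `T`-commuting
on the whole d.o.c. and docks to `K` on `U' ∩ U''`.  Concludes
`Theses.ZeroEnergyKerrOrBomb.NonTrappingHawkingRigidity` (primary route of this unit) by name; the
letter-identical AIE copy is `NonTrappingHawkingRigidity_of'`. [folklore] -/
theorem NonTrappingHawkingRigidity_of (h2 : stub_pointContinuation)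
    (hN1b : stub_farSeedBets) (hN2 : stub_highAzimuthalFrequencyBound)
    (hN3 : stub_azimuthalCascade) (hD : stub_literatureDebts) : NonTrappingHawkingRigidity := by
  -- the LANDED stubs S2a (p154819), S1b₇ (p162333, supersedes S1b p152581) and N1 (p163426), discharged inside
  have h2a : stub_pointContinuationAnalytic := Holds.stub_pointContinuationAnalytic
  have h1b7 : stub_invariantRadialFunctionConnected := Holds.stub_invariantRadialFunctionConnected
  have hN1 : stub_farAxialSeed := Holds.stub_farAxialSeed
  intro 𝓑 _ hvac hreg hfp h5 hsc U K hU hHU hconn hsm hkil hcomm hne htan htl hbelt hnt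
  have hcol : IsKillingTimelikeCollar 𝓑 U K := ⟨hU, hHU, hconn, ⟨hsm, hkil, hcomm⟩, hne, htan, htl⟩
  obtain ⟨hCC, hMzH, hDPS, hAIK, hFar⟩ := (id hD : type_of% Holds.stub_literatureDebts)
  -- rev 9: Nomizu's extension theorem is a THEOREM of the tree (discharged named fact)
  have hNo : PseudoRiemannianMetric.Nomizu1960_killing_extension :=
    PseudoRiemannianMetric.Nomizu1960_killing_extension_holds
  -- structure of the d.o.c. (S1b₇, fed by the Chruściel–Costa product structure): a radial function `ρ₀` with (R1)–(R7)
  obtain ⟨ρ₀, hρ₀, hR7⟩ := stub_invariantRadialFunctionConnected_iff.mp h1b7 hDPS 𝓑 hvac hreg hfp h5 hsc hconn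
  -- N1b: the far seed's residual hypotheses (non-degeneracy, timelike reach, continuation coherence) — rev 6
  obtain ⟨h17, hreach, hcoh⟩ := stub_farSeedBets_iff.mp hN1b hDPS 𝓑 U K hvac hreg hfp h5 hsc hcol hbelt hnt ρ₀ hρ₀
  -- N1: the non-rotating branch, or a genuine far axial seed
  rcases stub_farAxialSeed_iff.mp hN1 hAIK hFar hMzH hNo hCC hDPS 𝓑 U K hvac hreg hfp h5 hsc hcol h17 ρ₀ hρ₀ hR7
      hreach hcoh with
    hnr | ⟨W, Z, Φ, hFS, hWc, hZ, hdk⟩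
  · -- NON-ROTATING: `K' := α • T` (Disproof (F3))
    obtain ⟨K', ⟨hK's, hK'k, hK'c⟩, U', hU', hHU'', hdock'⟩ := conclusion_of_nonRotating hnr
    exact ⟨K', hK's, hK'k, hK'c, U', hU', hHU'', hdock'⟩
  -- ROTATING: the engine gives the radial function `f`, spacelike gradient on the closed ergoregion and
  -- two-variable analyticity on the belt off `U`
  obtain ⟨f, hρ, hergo, hbeltAn⟩ :=
    engine_of Holds.stub_invariantRadialFunction hN2 Holds.stub_commutingKillingFlowBox hN3 hCC hMzH hDPS hvac hreg hfp
      h5 hsc hcol hbelt hnt hρ₀ hFS hWc hZ hdk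
  -- the anchored sub-collar field and the timelike sweep along `f`
  obtain ⟨U', c₀, K₀, hU'o, hHU', ⟨hfs, hfT, hbase, hgrad, hproper⟩, hK₀', U'', hU''o, hHU'', hdock⟩ :=
    collarSweep_of Holds.stub_invariantKillingSubcollar hCC hvac hreg hfp h5 hsc hcol hbelt hnt hρ hergo
  -- FULL chartwise analyticity where `T` is timelike or on the collar: Müller zum Hagen's theorem (the debt
  -- `hMzH`) applied to `(univ, T)`, resp. to the collar pair `(U, K)` — rev 3: these points are continued by S2a
  have hAn : ∀ q ∈ 𝓑.doc, (𝓑.metric.val q (𝓑.killing q) (𝓑.killing q) < 0 ∨ q ∈ U) →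
      𝓑.IsChartwiseAnalyticAt q := by
    intro q hq hqU
    rcases hqU with hT | hqU
    · have hKF := 𝓑.isStationaryKilling.isKillingField
      obtain ⟨ψ₀, hψ₀, hqψ₀, hG₀⟩ := hMzH 𝓑 hvac Set.univ 𝓑.killing isOpen_univ
        hKF.contMDiff.contMDiffOn (fun x _ v w ↦ hKF.val_leviCivita_add x v w) q (mem_univ q) hT
      exact ⟨ψ₀, hψ₀, hqψ₀, hG₀⟩
    · obtain ⟨ψ₀, hψ₀, hqψ₀, hG₀⟩ := hMzH 𝓑 hvac U K hU hsm hkil q hqU (htl q ⟨hqU, hq⟩)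
      exact ⟨ψ₀, hψ₀, hqψ₀, hG₀⟩
  have hfc : ContinuousOn f 𝓑.doc := hfs.continuousOn
  -- the step: a partial continuation of finite level is strictly extended
  have step : ∀ a : Cont 𝓑 U' f c₀ K₀, a.c ≠ ⊤ → ∃ b : Cont 𝓑 U' f c₀ K₀, a ≤ b ∧ a.c < b.c := by
    intro a hatop
    have habot : a.c ≠ ⊥ := ne_bot_of_le_ne_bot (EReal.coe_ne_bot c₀) a.hc
    set c : ℝ := a.c.toReal with hcdef
    have hac : a.c = (c : EReal) := (EReal.coe_toReal hatop habot).symm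
    have hc₀c : c₀ ≤ c := by
      have := a.hc; rw [hac] at this; exact EReal.coe_le_coe_iff.mp this
    have hdom : {x | x ∈ 𝓑.doc ∧ ((f x : ℝ) : EReal) < a.c} = subLevel 𝓑 f c := by
      rw [hac]; exact setOf_ereal_lt_coe c
    have hL : IsLocalKilling 𝓑 (subLevel 𝓑 f c) a.L := hdom ▸ a.killing
    -- pointwise continuations along the level `{f = c}`
    have hpt : ∀ q ∈ 𝓑.doc, f q = c → PointContinuationAt 𝓑 (subLevel 𝓑 f c) a.L q := by
      intro q hq hfq
      have hsupp : NonNullSupportAt 𝓑 (subLevel 𝓑 f c) q f := by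
        obtain ⟨w, hw, hdw⟩ := hgrad q hq (hfq ▸ hc₀c)
        refine ⟨𝓑.doc, isOpen_doc 𝓑, hq, hfs, ⟨w, ne_of_gt hw, hdw⟩, ?_⟩
        intro x hx
        rw [hfq]
        exact ⟨fun h ↦ h.2, fun hlt ↦ ⟨hx.2, hlt⟩⟩
      by_cases hreg' : 𝓑.metric.val q (𝓑.killing q) (𝓑.killing q) < 0 ∨ q ∈ U
      · -- `T`-timelike or collar point: full analyticity (MzH) + local Nomizu (S2a)
        exact stub_pointContinuationAnalytic_iff.mp h2a hNo 𝓑 (subLevel 𝓑 f c) a.L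
          (isOpen_subLevel hfc c) (subLevel_subset_doc f c) hL q hq f hsupp (hAn q hq hreg')
      · -- belt point off `U`: two-variable analyticity from the engine + the partially-analytic lever (S2)
        simp only [not_or, not_lt] at hreg'
        exact (h2 : type_of% Holds.stub_pointContinuation) 𝓑 hvac (subLevel 𝓑 f c) a.L
          (isOpen_subLevel hfc c) (subLevel_subset_doc f c) hL q hq f hsupp (hbeltAn q hq hreg'.1 hreg'.2)
    obtain ⟨ε, hε, L', hL', hext⟩ :=
      Holds.stub_slabPatching 𝓑 hreg U' f c₀ ⟨hfs, hfT, hbase, hgrad, hproper⟩ c hc₀c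
        a.L hL hpt
    have hL'' : IsLocalKilling 𝓑 (subLevel 𝓑 f (c + ε)) L' := hL'
    refine ⟨⟨((c + ε : ℝ) : EReal), L', ?_, ?_, ?_⟩, ?_, ?_⟩
    · exact EReal.coe_le_coe_iff.mpr (hc₀c.trans (le_add_of_nonneg_right hε.le))
    · rw [setOf_ereal_lt_coe]; exact hL''
    · intro x hx
      have hx' : x ∈ subLevel 𝓑 f c := subLevel_mono f hc₀c (hbase ▸ hx : x ∈ subLevel 𝓑 f c₀)
      rw [hext x hx']
      exact a.anchored x hx
    · refine ⟨?_, fun x hx hlt ↦ ?_⟩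
      · show a.c ≤ ((c + ε : ℝ) : EReal)
        rw [hac]; exact EReal.coe_le_coe_iff.mpr (le_add_of_nonneg_right hε.le)
      · rw [hac] at hlt
        exact hext x ⟨hx, EReal.coe_lt_coe_iff.mp hlt⟩
    · show a.c < ((c + ε : ℝ) : EReal)
      rw [hac]; exact EReal.coe_lt_coe_iff.mpr (lt_add_of_pos_right c hε)
  -- Zorn
  obtain ⟨m, hm⟩ : ∃ m : Cont 𝓑 U' f c₀ K₀, IsMax m :=
    zorn_le (fun S hS ↦ Cont.bddAbove_of_isChain hfc hbase hK₀' S hS)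
  have hmtop : m.c = ⊤ := by
    by_contra hne'
    obtain ⟨b, hmb, hlt⟩ := step m hne'
    exact (lt_irrefl m.c) (lt_of_lt_of_le hlt (hm hmb).1)
  have hKill : IsLocalKilling 𝓑 𝓑.doc m.L := by
    have := m.killing
    rw [hmtop, setOf_ereal_lt_top] at this
    exact this
  refine ⟨m.L, hKill.1, hKill.2.1, hKill.2.2, U' ∩ U'', hU'o.inter hU''o, subset_inter hHU' hHU'', ?_⟩
  rintro x ⟨⟨hxU', hxU''⟩, hxdoc⟩
  rw [m.anchored x ⟨hxU', hxdoc⟩]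
  exact hdock x ⟨hxU'', hxdoc⟩

/-- D-0027 §3.3: the crux from the registered stubs themselves (a proof of the crux once the five `sorry`s
are discharged; until then it is `sorry`-tainted through the stubs and credits nothing). -/
theorem NonTrappingHawkingRigidity_proof : NonTrappingHawkingRigidity :=
  NonTrappingHawkingRigidity_of Holds.stub_pointContinuation
    Holds.stub_farSeedBets Holds.stub_highAzimuthalFrequencyBound
    Holds.stub_azimuthalCascade Holds.stub_literatureDebts

/-- The two routes wanting the crux type it with letter-identical bodies: the skeleton closes the
`AnalyticityInvadesErgoregion` copy (stmt-13896 as wanted by route `AnalyticityInvadesErgoregion`, rank 4)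
definitionally as well. [folklore] -/
theorem NonTrappingHawkingRigidity_of' (h2 : stub_pointContinuation)
    (hN1b : stub_farSeedBets) (hN2 : stub_highAzimuthalFrequencyBound)
    (hN3 : stub_azimuthalCascade) (hD : stub_literatureDebts) :
    Summit.FinalStateConjecture.FinalStateConjecture.Theses.AnalyticityInvadesErgoregion.NonTrappingHawkingRigidity :=
  NonTrappingHawkingRigidity_of h2 hN1b hN2 hN3 hD

end Summit.FinalStateConjecture.FinalStateConjecture.Cruxes.NonTrappingHawkingRigidity.AzimuthalPartialAnalyticity

end
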